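import Literature.Topology.FourManifolds.ConjugationQuotientsComparison
import Literature.Topology.FourManifolds.BranchedModelCalculus
import Mathlib.Geometry.Manifold.ContMDiff.Atlas
import HarnessLib
import Mathlib.Analysis.Calculus.ContDiff.RCLike
import Mathlib.Analysis.Normed.Operator.Prod
import Mathlib.Analysis.Normed.Operator.BoundedLinearMaps
import Literature.Topology.FourManifolds.NormalRetraction
import Mathlib.Geometry.Manifold.PartitionOfUnity
import Mathlib.Geometry.Manifold.WhitneyEmbedding
import Mathlib.Analysis.SpecialFunctions.SmoothTransition
import Mathlib.Analysis.SpecialFunctions.Log.Deriv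
import Literature.Topology.FourManifolds.BranchedModelAveraging

/-!
# Uniqueness of the smooth branched double quotient `X/conj`: local theory and set-up

Topic `Topology/FourManifolds`; namespace `Literature.Topology.FourManifolds`. First of the two
files proving the named fact `DegtyarevKharlamov2000_conjQuotient_unique` of
`ConjugationQuotients.lean` (Degtyarev–Kharlamov, Russian Math. Surveys 55 (2000), §3.2 ¶1,
arXiv:math/0004134 p. 14, ll. 21–26); the discharge
`DegtyarevKharlamov2000_conjQuotient_unique_holds` is the last declaration of the sequel
`ConjugationQuotientsProofs.lean`. Everything here is proved; NO named facts are introduced.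

The argument (a downstairs Whitney-averaging of explicit local solutions with a logarithmic
radial cutoff) was developed in parts which are concatenated below in dependency order, each
keeping its own header (a header saying "N-th file of the proof" means "N-th part"; parts 1, 2
and 7 are the imported tree files `ConjugationQuotientsComparison`, `BranchedModelCalculus`,
`BranchedModelAveraging`). Contents of this file:

* part 3 `ChartPair` — adapted chart pairs at fixed points; the mixed transition `θ`, the
  comparison map read in the pair `Θh` (`Θh ∘ sqModel = sqModel ∘ θ`), the explicit local solution
  `Θloc (u, w) = (γ u, polarSq (L u) w)` / `floc`, smoothness and first-order structure;
* part 4 `polarDeriv` — the polar derivative field of a descended `flipIm`-equivariant map,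
  continuous down to the branch locus;
* part 5 positive pairs — every fixed point has a POSITIVE pair (`‖anticonformal‖ < ‖conformal‖`
  for the normal derivative), by flipping and shrinking;
* part 6 transitions — self pairs, the local solution of one pair read in another
  (`crossLoc`), its first-order structure at branch points (`crossLoc_firstOrder`), and the polar
  derivative of `Θh` (`hasFDerivAt_Θh_polar`);
* part 8 `Setup` — finitely many positive pairs covering the fixed points, a smooth partition of
  unity, a Whitney embedding `Y₂ ↪ ℝᴺ` with normal retraction, the radial function `rad`, the
  logarithmic cutoff `χ = cut (log rad)`, the weights and the averaged map
  `Φ = retr (∑ tᵢ • emb ∘ flocᵢ + t∞ • emb ∘ h)`;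
* part 9 smooth average — `Φ` is smooth where the average lies in the tube; its expression in the
  charts of a pair near a branch point.

## References

* [DegtyarevKharlamov2000] A. Degtyarev, V. Kharlamov, Russian Math. Surveys 55 (2000)
  (arXiv:math/0004134), §3.2 ¶1.
-/

/-!
# Chart pairs of two branched double quotients and the explicit local solutions

Topic `Topology/FourManifolds`; namespace `Literature.Topology.FourManifolds`. Third file of the
proof of `Literature.Topology.FourManifolds.DegtyarevKharlamov2000_conjQuotient_unique`
(`ConjugationQuotients.lean`). Everything is proved; no named facts.

Let `q₁ : X → Y₁`, `q₂ : X → Y₂` be branched double quotients of `X` by the same involution `σ`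
(`IsBranchedDoubleQuotient`). A **chart pair** (`ChartPair σ q₁ q₂`) is the data, at a common
region of `X`, of an adapted chart `(φ₁, ψ₁)` for `q₁` and an adapted chart `(φ₂, ψ₂)` for `q₂`
(fields of `IsBranchedDoubleQuotient.exists_adapted_charts`). In the split coordinates of
`BranchedModelCalculus.lean` (`𝕄 = (Fin 2 → ℝ) × ℂ`, model `sqModel (u, z) = (u, z²)`,
conjugation `flipIm`) a chart pair carries:

* the **mixed transition** `c.θ = split ∘ φ₂ ∘ φ₁⁻¹ ∘ split⁻¹`, an `OpenPartialHomeomorph 𝕄 𝕄`,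
  `C^∞` with `C^∞` inverse on its source and `flipIm`-equivariant (`ChartPair.contDiffOn_θ`,
  `ChartPair.θ_flipIm`); its real points are exactly the images of the fixed points of `σ`
  (`ChartPair.snd_eq_zero_iff`);
* the **comparison map read in the pair**, `c.Θh = splitW ∘ ψ₂ ∘ comparison ∘ ψ₁⁻¹ ∘ splitW⁻¹`,
  which DESCENDS the mixed transition: `c.Θh (sqModel x) = sqModel (c.θ x)` (`ChartPair.Θh_sqModel`)
  — smooth off the branch locus, in general not differentiable on it;
* the tangential part `c.γ u = (c.θ (u, 0)).1`, the normal derivative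
  `c.L u = normalPart (D c.θ (u, 0))`, and the **explicit local solution**
  `c.Θloc (u, w) = (c.γ u, polarSq (c.L u) w)` with its manifold version
  `c.floc = ψ₂⁻¹ ∘ splitW⁻¹ ∘ c.Θloc ∘ splitW ∘ ψ₁ : Y₁ → Y₂`, which agrees with the comparison
  map on the branch locus (`ChartPair.floc_apply_of_mem_fixedPoints`).

The uniqueness proof averages the maps `c.floc` of finitely many chart pairs with the comparison
map (sequel files).

## References

* A. Degtyarev, V. Kharlamov, Russian Math. Surveys 55 (2000), arXiv:math/0004134, §3.2 ¶1.
  [DegtyarevKharlamov2000]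
-/

noncomputable section

open scoped Manifold ContDiff Topology ComplexConjugate
open Set Function Filter
open Literature.Topology.FourManifolds.BranchedModel

namespace Literature.Topology.FourManifolds

/-- Local notation: `𝕄` is the split model space `(Fin 2 → ℝ) × ℂ`. -/
local notation "𝕄" => (Fin 2 → ℝ) × ℂ

variable {X : Type*} [TopologicalSpace X] [ChartedSpace (Fin 2 → ℂ) X]
  {Y₁ : Type*} [TopologicalSpace Y₁] [ChartedSpace (EuclideanSpace ℝ (Fin 4)) Y₁]
  {Y₂ : Type*} [TopologicalSpace Y₂] [ChartedSpace (EuclideanSpace ℝ (Fin 4)) Y₂]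

/-- **A chart pair** of two branched double quotients `q₁ : X → Y₁`, `q₂ : X → Y₂` of `X` by the
same involution `σ`: an adapted chart `(φ₁, ψ₁)` for `q₁` and an adapted chart `(φ₂, ψ₂)` for
`q₂` — charts of the `C^∞` structures (`maximalAtlas`) such that `φᵢ ∘ σ = star ∘ φᵢ` on the
`σ`-invariant source of `φᵢ` and `ψᵢ ∘ qᵢ = branchedDoubleModel ∘ φᵢ` there (the two clauses of
`IsBranchedDoubleQuotient.exists_adapted_charts`). The interesting region is the common domain
`φ₁.source ∩ φ₂.source` (`ChartPair.dom`). [folklore] -/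
structure ChartPair (σ : X → X) (q₁ : X → Y₁) (q₂ : X → Y₂) where
  /-- the adapted chart of `X` for `q₁` -/
  φ₁ : OpenPartialHomeomorph X (Fin 2 → ℂ)
  /-- the chart of `Y₁` in which `q₁` is the model -/
  ψ₁ : OpenPartialHomeomorph Y₁ (EuclideanSpace ℝ (Fin 4))
  /-- the adapted chart of `X` for `q₂` -/
  φ₂ : OpenPartialHomeomorph X (Fin 2 → ℂ)
  /-- the chart of `Y₂` in which `q₂` is the model -/
  ψ₂ : OpenPartialHomeomorph Y₂ (EuclideanSpace ℝ (Fin 4))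
  φ₁_mem : φ₁ ∈ IsManifold.maximalAtlas 𝓘(ℝ, Fin 2 → ℂ) ∞ X
  ψ₁_mem : ψ₁ ∈ IsManifold.maximalAtlas (𝓡 4) ∞ Y₁
  φ₂_mem : φ₂ ∈ IsManifold.maximalAtlas 𝓘(ℝ, Fin 2 → ℂ) ∞ X
  ψ₂_mem : ψ₂ ∈ IsManifold.maximalAtlas (𝓡 4) ∞ Y₂
  adapted₁ : ∀ y ∈ φ₁.source, σ y ∈ φ₁.source ∧ φ₁ (σ y) = star (φ₁ y) ∧
    q₁ y ∈ ψ₁.source ∧ ψ₁ (q₁ y) = branchedDoubleModel (φ₁ y)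
  adapted₂ : ∀ y ∈ φ₂.source, σ y ∈ φ₂.source ∧ φ₂ (σ y) = star (φ₂ y) ∧
    q₂ y ∈ ψ₂.source ∧ ψ₂ (q₂ y) = branchedDoubleModel (φ₂ y)

namespace ChartPair

variable {σ : X → X} {q₁ : X → Y₁} {q₂ : X → Y₂}

/-- **Chart pairs exist at every fixed point** of `σ` (from the adapted charts of the two
branched double quotients). [folklore] -/
theorem exists_mem_dom (h₁ : IsBranchedDoubleQuotient σ q₁) (h₂ : IsBranchedDoubleQuotient σ q₂)
    {x : X} (hx : σ x = x) :
    ∃ c : ChartPair σ q₁ q₂, x ∈ c.φ₁.source ∩ c.φ₂.source := by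
  obtain ⟨φ₁, hφ₁, ψ₁, hψ₁, hx₁, had₁⟩ := h₁.exists_adapted_charts x hx
  obtain ⟨φ₂, hφ₂, ψ₂, hψ₂, hx₂, had₂⟩ := h₂.exists_adapted_charts x hx
  exact ⟨⟨φ₁, ψ₁, φ₂, ψ₂, hφ₁, hψ₁, hφ₂, hψ₂, had₁, had₂⟩, hx₁, hx₂⟩

/-! ### The common domain -/

/-- The common domain `φ₁.source ∩ φ₂.source` of a chart pair. [folklore] -/
def dom (c : ChartPair σ q₁ q₂) : Set X :=
  c.φ₁.source ∩ c.φ₂.source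

/-- The common domain is open. [folklore] -/
theorem isOpen_dom (c : ChartPair σ q₁ q₂) : IsOpen c.dom :=
  c.φ₁.open_source.inter c.φ₂.open_source

/-- The common domain is `σ`-invariant. [folklore] -/
theorem σ_mem_dom (c : ChartPair σ q₁ q₂) {y : X} (hy : y ∈ c.dom) : σ y ∈ c.dom :=
  ⟨(c.adapted₁ y hy.1).1, (c.adapted₂ y hy.2).1⟩

/-! ### The mixed transition `θ = split ∘ φ₂ ∘ φ₁⁻¹ ∘ split⁻¹` -/

/-- The split coordinates as an open partial homeomorphism. [folklore] -/
def splitH : OpenPartialHomeomorph (Fin 2 → ℂ) 𝕄 :=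
  split.toHomeomorph.toOpenPartialHomeomorph

omit [TopologicalSpace X] [ChartedSpace (Fin 2 → ℂ) X] in
/-- `splitH` is `split`. [folklore] -/
@[simp]
theorem splitH_apply (v : Fin 2 → ℂ) : splitH v = split v := rfl

omit [TopologicalSpace X] [ChartedSpace (Fin 2 → ℂ) X] in
/-- `splitH.symm` is `split.symm`. [folklore] -/
@[simp]
theorem splitH_symm_apply (x : 𝕄) : splitH.symm x = split.symm x := rfl

omit [TopologicalSpace X] [ChartedSpace (Fin 2 → ℂ) X] in
/-- The source of `splitH` is everything. [folklore] -/
@[simp]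
theorem splitH_source : splitH.source = univ := rfl

omit [TopologicalSpace X] [ChartedSpace (Fin 2 → ℂ) X] in
/-- The target of `splitH` is everything. [folklore] -/
@[simp]
theorem splitH_target : splitH.target = univ := rfl

/-- **The mixed transition of a chart pair**, `θ = split ∘ φ₂ ∘ φ₁⁻¹ ∘ split⁻¹`, as an open
partial homeomorphism of the split model. [folklore] -/
def θ (c : ChartPair σ q₁ q₂) : OpenPartialHomeomorph 𝕄 𝕄 :=
  (splitH.symm.trans (c.φ₁.symm.trans c.φ₂)).trans splitH

/-- The mixed transition as a map. [folklore] -/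
@[simp]
theorem θ_apply (c : ChartPair σ q₁ q₂) (x : 𝕄) :
    c.θ x = split (c.φ₂ (c.φ₁.symm (split.symm x))) :=
  rfl

/-- The inverse mixed transition as a map. [folklore] -/
@[simp]
theorem θ_symm_apply (c : ChartPair σ q₁ q₂) (x : 𝕄) :
    c.θ.symm x = split (c.φ₁ (c.φ₂.symm (split.symm x))) :=
  rfl

/-- The source of the mixed transition: the points `x` with `φ₁⁻¹ (split⁻¹ x)` in the common
domain. [folklore] -/
theorem mem_θ_source (c : ChartPair σ q₁ q₂) (x : 𝕄) :
    x ∈ c.θ.source ↔ split.symm x ∈ c.φ₁.target ∧ c.φ₁.symm (split.symm x) ∈ c.φ₂.source := by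
  simp [θ]

/-- Points of the common domain give points of the source of `θ`. [folklore] -/
theorem split_mem_θ_source (c : ChartPair σ q₁ q₂) {y : X} (hy : y ∈ c.dom) :
    split (c.φ₁ y) ∈ c.θ.source := by
  rw [mem_θ_source, ContinuousLinearEquiv.symm_apply_apply, c.φ₁.left_inv hy.1]
  exact ⟨c.φ₁.map_source hy.1, hy.2⟩

/-- Conversely every point of the source of `θ` comes from the common domain. [folklore] -/
theorem symm_mem_dom (c : ChartPair σ q₁ q₂) {x : 𝕄} (hx : x ∈ c.θ.source) :
    c.φ₁.symm (split.symm x) ∈ c.dom := by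
  rw [mem_θ_source] at hx
  exact ⟨c.φ₁.map_target hx.1, hx.2⟩

/-- Reconstruction of a source point of `θ` from its point of `X`. [folklore] -/
theorem split_φ₁_symm (c : ChartPair σ q₁ q₂) {x : 𝕄} (hx : x ∈ c.θ.source) :
    split (c.φ₁ (c.φ₁.symm (split.symm x))) = x := by
  rw [mem_θ_source] at hx
  rw [c.φ₁.right_inv hx.1, ContinuousLinearEquiv.apply_symm_apply]

/-- The value of `θ` at the point of `y ∈ dom`. [folklore] -/
theorem θ_apply_split (c : ChartPair σ q₁ q₂) {y : X} (hy : y ∈ c.dom) :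
    c.θ (split (c.φ₁ y)) = split (c.φ₂ y) := by
  rw [θ_apply, ContinuousLinearEquiv.symm_apply_apply, c.φ₁.left_inv hy.1]

/-- The source of `θ` is open. [folklore] -/
theorem isOpen_θ_source (c : ChartPair σ q₁ q₂) : IsOpen c.θ.source :=
  c.θ.open_source

/-- **The mixed transition is `C^∞` on its source** (both charts lie in the `C^∞` maximal
atlas of `X`). [folklore] -/
theorem contDiffOn_θ (c : ChartPair σ q₁ q₂) : ContDiffOn ℝ ∞ c.θ c.θ.source := by
  have h := ((contDiffGroupoid ∞ 𝓘(ℝ, Fin 2 → ℂ)).compatible_of_mem_maximalAtlas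
    c.φ₁_mem c.φ₂_mem).1
  simp only [contDiffPregroupoid, modelWithCornersSelf_coe, modelWithCornersSelf_coe_symm,
    CompTriple.comp_eq, range_id, inter_univ, preimage_id_eq, id_eq] at h
  -- `h : ContDiffOn ℝ ∞ (φ₂ ∘ φ₁.symm) (φ₁.symm ≫ φ₂).source`
  have h2 : ContDiffOn ℝ ∞ ((split : (Fin 2 → ℂ) → 𝕄) ∘ (c.φ₁.symm.trans c.φ₂) ∘
      (split.symm : 𝕄 → Fin 2 → ℂ)) (split.symm ⁻¹' (c.φ₁.symm.trans c.φ₂).source) :=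
    split.contDiff.comp_contDiffOn (h.comp split.symm.contDiff.contDiffOn fun u hu => hu)
  refine h2.congr_mono (fun x _ => rfl) ?_
  intro x hx
  simpa [θ, OpenPartialHomeomorph.trans_source] using hx

/-- The inverse mixed transition is `C^∞` on its source (the target of `θ`). [folklore] -/
theorem contDiffOn_θ_symm (c : ChartPair σ q₁ q₂) : ContDiffOn ℝ ∞ c.θ.symm c.θ.target := by
  have h := ((contDiffGroupoid ∞ 𝓘(ℝ, Fin 2 → ℂ)).compatible_of_mem_maximalAtlas
    c.φ₂_mem c.φ₁_mem).1
  simp only [contDiffPregroupoid, modelWithCornersSelf_coe, modelWithCornersSelf_coe_symm,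
    CompTriple.comp_eq, range_id, inter_univ, preimage_id_eq, id_eq] at h
  have h2 : ContDiffOn ℝ ∞ ((split : (Fin 2 → ℂ) → 𝕄) ∘ (c.φ₂.symm.trans c.φ₁) ∘
      (split.symm : 𝕄 → Fin 2 → ℂ)) (split.symm ⁻¹' (c.φ₂.symm.trans c.φ₁).source) :=
    split.contDiff.comp_contDiffOn (h.comp split.symm.contDiff.contDiffOn fun u hu => hu)
  refine h2.congr_mono (fun x _ => rfl) ?_
  intro x hx
  simp only [θ, OpenPartialHomeomorph.trans_target, OpenPartialHomeomorph.symm_target,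
    splitH_source, preimage_univ, inter_univ, splitH_target, univ_inter, mem_inter_iff,
    mem_preimage] at hx
  simp only [mem_preimage, OpenPartialHomeomorph.trans_source, OpenPartialHomeomorph.symm_source,
    mem_inter_iff]
  exact hx

/-- `θ` is `C^∞` at every point of its source. [folklore] -/
theorem contDiffAt_θ (c : ChartPair σ q₁ q₂) {x : 𝕄} (hx : x ∈ c.θ.source) :
    ContDiffAt ℝ ∞ c.θ x :=
  (c.contDiffOn_θ x hx).contDiffAt (c.isOpen_θ_source.mem_nhds hx)

/-- `θ` is differentiable at every point of its source, with derivative `fderiv ℝ c.θ x`.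
[folklore] -/
theorem hasFDerivAt_θ (c : ChartPair σ q₁ q₂) {x : 𝕄} (hx : x ∈ c.θ.source) :
    HasFDerivAt c.θ (fderiv ℝ c.θ x) x :=
  ((c.contDiffAt_θ hx).differentiableAt (by simp)).hasFDerivAt

/-! ### Equivariance -/

omit [TopologicalSpace X] [ChartedSpace (Fin 2 → ℂ) X] in
/-- `split⁻¹ ∘ flipIm = star ∘ split⁻¹`. [folklore] -/
theorem split_symm_flipIm (x : 𝕄) : split.symm (flipIm x) = star (split.symm x) := by
  have h := split_star (split.symm x)
  rw [ContinuousLinearEquiv.apply_symm_apply] at h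
  rw [← h, ContinuousLinearEquiv.symm_apply_apply]

/-- **The source of `θ` is `flipIm`-invariant and `θ` is `flipIm`-equivariant.** [folklore] -/
theorem θ_flipIm (c : ChartPair σ q₁ q₂) {x : 𝕄} (hx : x ∈ c.θ.source) :
    flipIm x ∈ c.θ.source ∧ c.θ (flipIm x) = flipIm (c.θ x) := by
  set y := c.φ₁.symm (split.symm x) with hy
  have hyd : y ∈ c.dom := c.symm_mem_dom hx
  have hx' : x = split (c.φ₁ y) := (c.split_φ₁_symm hx).symm
  have hσy : σ y ∈ c.dom := c.σ_mem_dom hyd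
  have h1 : split.symm (flipIm x) = c.φ₁ (σ y) := by
    rw [split_symm_flipIm, (c.adapted₁ y hyd.1).2.1, hx', ContinuousLinearEquiv.symm_apply_apply]
  have hflip : flipIm x = split (c.φ₁ (σ y)) := by
    rw [← h1, ContinuousLinearEquiv.apply_symm_apply]
  refine ⟨hflip ▸ c.split_mem_θ_source hσy, ?_⟩
  rw [hflip, c.θ_apply_split hσy, (c.adapted₂ y hyd.2).2.1, split_star, hx',
    c.θ_apply_split hyd]

/-- Equivariance as an eventual identity at a point of the source. [folklore] -/
theorem eventually_θ_flipIm (c : ChartPair σ q₁ q₂) {x : 𝕄} (hx : x ∈ c.θ.source) :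
    ∀ᶠ x' in 𝓝 x, c.θ (flipIm x') = flipIm (c.θ x') := by
  filter_upwards [c.isOpen_θ_source.mem_nhds hx] with x' hx'
  exact (c.θ_flipIm hx').2

/-- **Real points of the source of `θ` are exactly the fixed points of `σ`**: for
`x ∈ θ.source`, `x.2 = 0 ↔ σ y = y` where `y = φ₁⁻¹ (split⁻¹ x)`. [folklore] -/
theorem snd_eq_zero_iff (c : ChartPair σ q₁ q₂) {x : 𝕄} (hx : x ∈ c.θ.source) :
    x.2 = 0 ↔ σ (c.φ₁.symm (split.symm x)) = c.φ₁.symm (split.symm x) := by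
  set y := c.φ₁.symm (split.symm x) with hy
  have hyd : y ∈ c.dom := c.symm_mem_dom hx
  have hx' : x = split (c.φ₁ y) := (c.split_φ₁_symm hx).symm
  have hflip : x.2 = 0 ↔ flipIm x = x := by
    constructor
    · intro h
      simp [flipIm_apply, h, Prod.ext_iff]
    · intro h
      have h2 := congrArg Prod.snd h
      simp only [flipIm_apply] at h2
      linear_combination -h2 / 2
  rw [hflip]
  constructor
  · intro h
    -- `φ₁ (σ y) = star (φ₁ y) = φ₁ y`
    have h1 : c.φ₁ (σ y) = c.φ₁ y := by
      rw [(c.adapted₁ y hyd.1).2.1]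
      apply split.injective
      rw [split_star, ← hx', h]
    exact c.φ₁.injOn (c.adapted₁ y hyd.1).1 hyd.1 h1
  · intro h
    have h1 : star (c.φ₁ y) = c.φ₁ y := by
      rw [← (c.adapted₁ y hyd.1).2.1, h]
    rw [hx', ← split_star, h1]

/-- At a real point of its source, `θ` takes a real value: `(θ (u, 0)).2 = 0`. [folklore] -/
theorem θ_snd_eq_zero (c : ChartPair σ q₁ q₂) {u : Fin 2 → ℝ} (hu : ((u, 0) : 𝕄) ∈ c.θ.source) :
    (c.θ (u, 0)).2 = 0 :=
  snd_apply_eq_zero_of_equivariant (c.eventually_θ_flipIm hu)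

/-! ### The comparison map read in the chart pair -/

/-- `sqModel ∘ split ∘ φ₁ = splitW ∘ ψ₁ ∘ q₁` on the source of `φ₁` (the chart clause in split
coordinates). [folklore] -/
theorem sqModel_split_φ₁ (c : ChartPair σ q₁ q₂) {y : X} (hy : y ∈ c.φ₁.source) :
    sqModel (split (c.φ₁ y)) = splitW (c.ψ₁ (q₁ y)) := by
  rw [(c.adapted₁ y hy).2.2.2, splitW_branchedDoubleModel]

/-- `sqModel ∘ split ∘ φ₂ = splitW ∘ ψ₂ ∘ q₂` on the source of `φ₂`. [folklore] -/
theorem sqModel_split_φ₂ (c : ChartPair σ q₁ q₂) {y : X} (hy : y ∈ c.φ₂.source) :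
    sqModel (split (c.φ₂ y)) = splitW (c.ψ₂ (q₂ y)) := by
  rw [(c.adapted₂ y hy).2.2.2, splitW_branchedDoubleModel]

/-- **The comparison map read in the chart pair**:
`Θh = splitW ∘ ψ₂ ∘ comparison ∘ ψ₁⁻¹ ∘ splitW⁻¹ : 𝕄 → 𝕄`. [folklore] -/
def Θh (c : ChartPair σ q₁ q₂) (h₁ : IsBranchedDoubleQuotient σ q₁)
    (h₂ : IsBranchedDoubleQuotient σ q₂) (w : 𝕄) : 𝕄 :=
  splitW (c.ψ₂ (IsBranchedDoubleQuotient.comparison h₁ h₂ (c.ψ₁.symm (splitW.symm w))))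

/-- **The comparison map descends the mixed transition**: `Θh (sqModel x) = sqModel (θ x)` on
the source of `θ`. [folklore] -/
theorem Θh_sqModel (c : ChartPair σ q₁ q₂) (h₁ : IsBranchedDoubleQuotient σ q₁)
    (h₂ : IsBranchedDoubleQuotient σ q₂) {x : 𝕄} (hx : x ∈ c.θ.source) :
    c.Θh h₁ h₂ (sqModel x) = sqModel (c.θ x) := by
  set y := c.φ₁.symm (split.symm x) with hy
  have hyd : y ∈ c.dom := c.symm_mem_dom hx
  have hx' : x = split (c.φ₁ y) := (c.split_φ₁_symm hx).symm
  rw [hx', c.θ_apply_split hyd, c.sqModel_split_φ₁ hyd.1, Θh]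
  simp only [ContinuousLinearEquiv.symm_apply_apply]
  rw [c.ψ₁.left_inv (c.adapted₁ y hyd.1).2.2.1, IsBranchedDoubleQuotient.comparison_apply,
    c.sqModel_split_φ₂ hyd.2]

/-- The comparison map read in the chart pair, as an eventual identity near a source point of
`θ`: `Θh ∘ sqModel = sqModel ∘ θ`. [folklore] -/
theorem eventually_Θh_sqModel (c : ChartPair σ q₁ q₂) (h₁ : IsBranchedDoubleQuotient σ q₁)
    (h₂ : IsBranchedDoubleQuotient σ q₂) {x : 𝕄} (hx : x ∈ c.θ.source) :
    ∀ᶠ x' in 𝓝 x, c.Θh h₁ h₂ (sqModel x') = sqModel (c.θ x') := by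
  filter_upwards [c.isOpen_θ_source.mem_nhds hx] with x' hx'
  exact c.Θh_sqModel h₁ h₂ hx'

/-- **Off the branch locus the comparison map read in the pair is `C^∞`**: at `sqModel x` for a
non-real source point `x` of `θ`. [folklore] -/
theorem contDiffAt_Θh (c : ChartPair σ q₁ q₂) (h₁ : IsBranchedDoubleQuotient σ q₁)
    (h₂ : IsBranchedDoubleQuotient σ q₂) {x : 𝕄} (hx : x ∈ c.θ.source) (hx2 : x.2 ≠ 0) :
    ContDiffAt ℝ ∞ (c.Θh h₁ h₂) (sqModel x) := by
  set y := c.φ₁.symm (split.symm x) with hy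
  have hyd : y ∈ c.dom := c.symm_mem_dom hx
  have hx' : x = split (c.φ₁ y) := (c.split_φ₁_symm hx).symm
  have hfix : σ y ≠ y := fun h => hx2 ((c.snd_eq_zero_iff hx).2 h)
  have hsm := IsBranchedDoubleQuotient.contMDiffAt_comparison h₁ h₂ hfix
  have hq₁ : q₁ y ∈ c.ψ₁.source := (c.adapted₁ y hyd.1).2.2.1
  have hq₂ : IsBranchedDoubleQuotient.comparison h₁ h₂ (q₁ y) ∈ c.ψ₂.source := by
    rw [IsBranchedDoubleQuotient.comparison_apply]
    exact (c.adapted₂ y hyd.2).2.2.1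
  rw [contMDiffAt_iff_of_mem_maximalAtlas c.ψ₁_mem c.ψ₂_mem hq₁ hq₂] at hsm
  have h2 := hsm.2
  simp only [OpenPartialHomeomorph.extend_coe, OpenPartialHomeomorph.extend_coe_symm,
    modelWithCornersSelf_coe, modelWithCornersSelf_coe_symm, CompTriple.comp_eq, range_id] at h2
  have h3 : ContDiffAt ℝ ∞ (c.ψ₂ ∘ IsBranchedDoubleQuotient.comparison h₁ h₂ ∘ c.ψ₁.symm)
      (c.ψ₁ (q₁ y)) := h2.contDiffAt univ_mem
  have hpt : sqModel x = splitW (c.ψ₁ (q₁ y)) := by rw [hx', c.sqModel_split_φ₁ hyd.1]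
  rw [hpt]
  have h4 : ContDiffAt ℝ ∞ (c.ψ₂ ∘ IsBranchedDoubleQuotient.comparison h₁ h₂ ∘ c.ψ₁.symm)
      (splitW.symm (splitW (c.ψ₁ (q₁ y)))) := by
    rwa [ContinuousLinearEquiv.symm_apply_apply]
  exact splitW.contDiff.contDiffAt.comp _ (h4.comp _ splitW.symm.contDiff.contDiffAt)

/-! ### The tangential part, the normal derivative and the explicit local solution -/

/-- **The tangential part** `γ u = (θ (u, 0)).1` of the mixed transition along the real locus
(a local diffeomorphism of `Fin 2 → ℝ`: the comparison map restricted to the branch locus, in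
coordinates). [folklore] -/
def γ (c : ChartPair σ q₁ q₂) (u : Fin 2 → ℝ) : Fin 2 → ℝ :=
  (c.θ (u, 0)).1

/-- **The normal derivative** `L u = (D θ (u, 0)) (0, ·) .2 : ℂ →L[ℝ] ℂ` of the mixed transition
along the real locus. [folklore] -/
def L (c : ChartPair σ q₁ q₂) (u : Fin 2 → ℝ) : ℂ →L[ℝ] ℂ :=
  normalPart (fderiv ℝ c.θ (u, 0))

/-- At a real point `θ (u, 0) = (γ u, 0)`. [folklore] -/
theorem θ_real (c : ChartPair σ q₁ q₂) {u : Fin 2 → ℝ} (hu : ((u, 0) : 𝕄) ∈ c.θ.source) :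
    c.θ (u, 0) = (c.γ u, 0) :=
  Prod.ext rfl (c.θ_snd_eq_zero hu)

/-- **The explicit local solution in coordinates**: `Θloc (u, w) = (γ u, Ô(u) w)` with
`Ô(u) = polarSq (L u)` the squared unitary polar factor of the normal derivative. It descends the
`flipIm`-equivariant local diffeomorphism `(u, z) ↦ (γ u, O(u) z)` and is LINEAR in the normal
variable, hence smooth across the branch locus (unlike `Θh`). [folklore] -/
def Θloc (c : ChartPair σ q₁ q₂) (x : 𝕄) : 𝕄 :=
  (c.γ x.1, polarSq (c.L x.1) x.2)

/-- Unfolding lemma for `Θloc`. [folklore] -/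
@[simp]
theorem Θloc_apply (c : ChartPair σ q₁ q₂) (u : Fin 2 → ℝ) (w : ℂ) :
    c.Θloc (u, w) = (c.γ u, polarSq (c.L u) w) :=
  rfl

/-- On the branch locus `Θloc (u, 0) = (γ u, 0) = θ (u, 0)`. [folklore] -/
theorem Θloc_real (c : ChartPair σ q₁ q₂) (u : Fin 2 → ℝ) : c.Θloc (u, 0) = (c.γ u, 0) := by
  simp

/-- **The explicit local solution** `floc = ψ₂⁻¹ ∘ splitW⁻¹ ∘ Θloc ∘ splitW ∘ ψ₁ : Y₁ → Y₂` of a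
chart pair. [folklore] -/
def floc (c : ChartPair σ q₁ q₂) (y : Y₁) : Y₂ :=
  c.ψ₂.symm (splitW.symm (c.Θloc (splitW (c.ψ₁ y))))

/-- A real source point of `θ` equals `(x.1, 0)`. [folklore] -/
theorem eq_real_of_snd_eq_zero {x : 𝕄} (hx : x.2 = 0) : x = (x.1, 0) :=
  Prod.ext rfl hx

/-- For a fixed point `y` of the common domain, `split (φ₁ y)` is a real point. [folklore] -/
theorem snd_split_φ₁_eq_zero (c : ChartPair σ q₁ q₂) {y : X} (hy : y ∈ c.dom) (hfix : σ y = y) :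
    (split (c.φ₁ y)).2 = 0 := by
  have hx := c.split_mem_θ_source hy
  refine (c.snd_eq_zero_iff hx).2 ?_
  rwa [ContinuousLinearEquiv.symm_apply_apply, c.φ₁.left_inv hy.1]

/-- For a fixed point `y` of the common domain, `split (φ₂ y)` is a real point. [folklore] -/
theorem snd_split_φ₂_eq_zero (c : ChartPair σ q₁ q₂) {y : X} (hy : y ∈ c.dom) (hfix : σ y = y) :
    (split (c.φ₂ y)).2 = 0 := by
  have h := c.θ_snd_eq_zero (u := (split (c.φ₁ y)).1)
    (by rw [← eq_real_of_snd_eq_zero (c.snd_split_φ₁_eq_zero hy hfix)]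
        exact c.split_mem_θ_source hy)
  rwa [← eq_real_of_snd_eq_zero (c.snd_split_φ₁_eq_zero hy hfix), c.θ_apply_split hy] at h

omit [TopologicalSpace X] [ChartedSpace (Fin 2 → ℂ) X] in
/-- `sqModel` fixes real points. [folklore] -/
theorem sqModel_of_snd_eq_zero {x : 𝕄} (hx : x.2 = 0) : sqModel x = x := by
  rw [eq_real_of_snd_eq_zero hx]
  simp [sqModel]

/-- **The local solution agrees with the comparison map on the branch locus**:
`floc (q₁ y) = q₂ y` for every fixed point `y` of the common domain. [folklore] -/
theorem floc_apply_of_mem_fixedPoints (c : ChartPair σ q₁ q₂) {y : X} (hy : y ∈ c.dom)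
    (hfix : σ y = y) : c.floc (q₁ y) = q₂ y := by
  have h0 := c.snd_split_φ₁_eq_zero hy hfix
  have h1 : splitW (c.ψ₁ (q₁ y)) = split (c.φ₁ y) := by
    rw [← c.sqModel_split_φ₁ hy.1, sqModel_of_snd_eq_zero h0]
  have hsrc : ((split (c.φ₁ y)).1, (0 : ℂ)) ∈ c.θ.source := by
    rw [← eq_real_of_snd_eq_zero h0]
    exact c.split_mem_θ_source hy
  have h2 : c.Θloc (split (c.φ₁ y)) = split (c.φ₂ y) := by
    rw [eq_real_of_snd_eq_zero h0, Θloc_real, ← c.θ_real hsrc, ← eq_real_of_snd_eq_zero h0,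
      c.θ_apply_split hy]
  have h3 : splitW.symm (split (c.φ₂ y)) = c.ψ₂ (q₂ y) := by
    rw [← sqModel_of_snd_eq_zero (c.snd_split_φ₂_eq_zero hy hfix), c.sqModel_split_φ₂ hy.2,
      ContinuousLinearEquiv.symm_apply_apply]
  rw [floc, h1, h2, h3, c.ψ₂.left_inv (c.adapted₂ y hy.2).2.2.1]

/-- **Positivity of a chart pair**: along its real locus the normal derivative of the mixed
transition is orientation preserving, `|β(u)| < |α(u)|`. Every fixed point has positive chart
pairs (sequel file: flip the second coordinate of `φ₂` if necessary, then shrink). [folklore] -/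
def IsPos (c : ChartPair σ q₁ q₂) : Prop :=
  ∀ u : Fin 2 → ℝ, ((u, 0) : 𝕄) ∈ c.θ.source →
    ‖anticonformalPart (c.L u)‖ < ‖conformalPart (c.L u)‖

/-! ### Smoothness of the local solution -/

/-- The real locus of the source of `θ`, as an open subset of `Fin 2 → ℝ`. [folklore] -/
def realSource (c : ChartPair σ q₁ q₂) : Set (Fin 2 → ℝ) :=
  {u | ((u, 0) : 𝕄) ∈ c.θ.source}

/-- The real locus of the source of `θ` is open. [folklore] -/
theorem isOpen_realSource (c : ChartPair σ q₁ q₂) : IsOpen c.realSource :=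
  c.isOpen_θ_source.preimage (Continuous.prodMk_left 0)

/-- The tangential part is `C^∞` on the real locus. [folklore] -/
theorem contDiffOn_γ (c : ChartPair σ q₁ q₂) : ContDiffOn ℝ ∞ c.γ c.realSource := by
  have h1 : ContDiffOn ℝ ∞ (fun u : Fin 2 → ℝ => ((u, 0) : 𝕄)) c.realSource :=
    (contDiff_prodMk_left 0).contDiffOn
  exact contDiff_fst.comp_contDiffOn (c.contDiffOn_θ.comp h1 fun u hu => hu)

omit [TopologicalSpace X] [ChartedSpace (Fin 2 → ℂ) X] in
/-- `normalPart` is a `C^∞` (indeed bounded linear) function of the linear map. [folklore] -/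
theorem contDiff_normalPart : ContDiff ℝ ∞ (normalPart : (𝕄 →L[ℝ] 𝕄) → ℂ →L[ℝ] ℂ) := by
  have h : IsBoundedLinearMap ℝ (normalPart : (𝕄 →L[ℝ] 𝕄) → ℂ →L[ℝ] ℂ) :=
    { map_add := fun A B => by ext b; simp
      map_smul := fun r A => by ext b; simp
      bound := ⟨1, one_pos, fun A => by
        rw [one_mul]
        refine ContinuousLinearMap.opNorm_le_bound _ (norm_nonneg A) fun b => ?_
        rw [normalPart_apply]
        calc ‖(A (0, b)).2‖ ≤ ‖A (0, b)‖ := norm_snd_le _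
          _ ≤ ‖A‖ * ‖((0 : Fin 2 → ℝ), b)‖ := A.le_opNorm _
          _ ≤ ‖A‖ * ‖b‖ := by
            gcongr
            simp [Prod.norm_def]⟩ }
  exact h.contDiff

/-- The normal derivative is `C^∞` on the real locus. [folklore] -/
theorem contDiffOn_L (c : ChartPair σ q₁ q₂) : ContDiffOn ℝ ∞ c.L c.realSource := by
  have h1 : ContDiffOn ℝ ∞ (fun u : Fin 2 → ℝ => ((u, 0) : 𝕄)) c.realSource :=
    (contDiff_prodMk_left 0).contDiffOn
  have h2 : ContDiffOn ℝ ∞ (fun x => fderiv ℝ c.θ x) c.θ.source :=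
    c.contDiffOn_θ.fderiv_of_isOpen c.isOpen_θ_source (by simp)
  exact contDiff_normalPart.comp_contDiffOn (h2.comp h1 fun u hu => hu)

omit [TopologicalSpace X] [ChartedSpace (Fin 2 → ℂ) X] in
/-- `conformalPart` is a `C^∞` function of the linear map. [folklore] -/
theorem contDiff_conformalPart : ContDiff ℝ ∞ (conformalPart : (ℂ →L[ℝ] ℂ) → ℂ) := by
  unfold conformalPart
  have h1 : ContDiff ℝ ∞ fun L : ℂ →L[ℝ] ℂ => L 1 := (ContinuousLinearMap.apply ℝ ℂ (1 : ℂ)).contDiff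
  have hI : ContDiff ℝ ∞ fun L : ℂ →L[ℝ] ℂ => L Complex.I :=
    (ContinuousLinearMap.apply ℝ ℂ Complex.I).contDiff
  exact (h1.sub (contDiff_const.mul hI)).div_const _

omit [TopologicalSpace X] [ChartedSpace (Fin 2 → ℂ) X] in
/-- `anticonformalPart` is a `C^∞` function of the linear map. [folklore] -/
theorem contDiff_anticonformalPart : ContDiff ℝ ∞ (anticonformalPart : (ℂ →L[ℝ] ℂ) → ℂ) := by
  unfold anticonformalPart
  have h1 : ContDiff ℝ ∞ fun L : ℂ →L[ℝ] ℂ => L 1 := (ContinuousLinearMap.apply ℝ ℂ (1 : ℂ)).contDiff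
  have hI : ContDiff ℝ ∞ fun L : ℂ →L[ℝ] ℂ => L Complex.I :=
    (ContinuousLinearMap.apply ℝ ℂ Complex.I).contDiff
  exact (h1.add (contDiff_const.mul hI)).div_const _

omit [TopologicalSpace X] [ChartedSpace (Fin 2 → ℂ) X] in
/-- `z ↦ (‖z‖⁻¹ • z)² = (z/‖z‖)²` is `C^∞` away from `0`. [folklore] -/
theorem contDiffAt_inv_norm_smul_sq {z : ℂ} (hz : z ≠ 0) :
    ContDiffAt ℝ ∞ (fun z : ℂ => (‖z‖⁻¹ • z) ^ 2) z :=
  (((contDiffAt_norm ℝ hz).inv (norm_ne_zero_iff.2 hz)).smul contDiffAt_id).pow 2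

omit [TopologicalSpace X] [ChartedSpace (Fin 2 → ℂ) X] in
/-- `(z/‖z‖)² = (‖z‖⁻¹ • z)²`. [folklore] -/
theorem div_norm_sq_eq (z : ℂ) : (z / (‖z‖ : ℂ)) ^ 2 = (‖z‖⁻¹ • z) ^ 2 := by
  rw [Complex.real_smul, Complex.ofReal_inv, div_eq_inv_mul]

/-- **The explicit local solution in coordinates is `C^∞`** above the real locus, for a positive
chart pair. [folklore] -/
theorem contDiffOn_Θloc (c : ChartPair σ q₁ q₂) (hpos : c.IsPos) :
    ContDiffOn ℝ ∞ c.Θloc {x : 𝕄 | x.1 ∈ c.realSource} := by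
  intro x hx
  have hU : {x : 𝕄 | x.1 ∈ c.realSource} ∈ 𝓝 x :=
    (c.isOpen_realSource.preimage continuous_fst).mem_nhds hx
  refine ContDiffAt.contDiffWithinAt ?_
  -- near `x` the local solution is `(γ u, (α u/‖α u‖)² w)`
  have hα : conformalPart (c.L x.1) ≠ 0 := by
    intro h0
    have := hpos x.1 hx
    rw [h0, norm_zero] at this
    exact absurd this (not_lt.2 (norm_nonneg _))
  have hγ : ContDiffAt ℝ ∞ (fun x : 𝕄 => c.γ x.1) x :=
    ((c.contDiffOn_γ x.1 hx).contDiffAt (c.isOpen_realSource.mem_nhds hx)).comp x contDiffAt_fst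
  have hαs : ContDiffAt ℝ ∞ (fun x : 𝕄 => conformalPart (c.L x.1)) x :=
    (contDiff_conformalPart.contDiffAt.comp _
      ((c.contDiffOn_L x.1 hx).contDiffAt (c.isOpen_realSource.mem_nhds hx))).comp x contDiffAt_fst
  have hcoef : ContDiffAt ℝ ∞ ((fun z : ℂ => (‖z‖⁻¹ • z) ^ 2) ∘
      (fun x : 𝕄 => conformalPart (c.L x.1))) x :=
    (contDiffAt_inv_norm_smul_sq hα).comp x hαs
  have hform : ContDiffAt ℝ ∞ (fun x : 𝕄 => (c.γ x.1,
      ((fun z : ℂ => (‖z‖⁻¹ • z) ^ 2) ∘ (fun x : 𝕄 => conformalPart (c.L x.1))) x * x.2)) x :=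
    hγ.prodMk (hcoef.mul contDiffAt_snd)
  refine hform.congr_of_eventuallyEq ?_
  filter_upwards [hU] with x' hx'
  rw [Θloc, polarSq_apply_of_lt (hpos x'.1 hx'), Function.comp_apply, div_norm_sq_eq]

/-! ### The local solution as a smooth map of manifolds -/

/-- The open set of `Y₁` on which the local solution `floc` is a genuine chart expression:
points of `ψ₁.source` read above the real locus of `θ` and mapped by `Θloc` into the target of
`ψ₂`. It contains the branch points of the common domain (`mem_flocSource`). [folklore] -/
def flocSource (c : ChartPair σ q₁ q₂) : Set Y₁ :=
  c.ψ₁.source ∩ (fun y => splitW (c.ψ₁ y)) ⁻¹'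
    ({x : 𝕄 | x.1 ∈ c.realSource} ∩ c.Θloc ⁻¹' (splitW.symm ⁻¹' c.ψ₂.target))

/-- `flocSource` is open (for a positive pair, `Θloc` being continuous above the real locus).
[folklore] -/
theorem isOpen_flocSource (c : ChartPair σ q₁ q₂) (hpos : c.IsPos) : IsOpen c.flocSource := by
  have h1 : IsOpen ({x : 𝕄 | x.1 ∈ c.realSource} ∩ c.Θloc ⁻¹' (splitW.symm ⁻¹' c.ψ₂.target)) :=
    (c.contDiffOn_Θloc hpos).continuousOn.isOpen_inter_preimage
      (c.isOpen_realSource.preimage continuous_fst)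
      (c.ψ₂.open_target.preimage splitW.symm.continuous)
  exact (splitW.continuous.comp_continuousOn c.ψ₁.continuousOn).isOpen_inter_preimage
    c.ψ₁.open_source h1

/-- `flocSource ⊆ ψ₁.source`. [folklore] -/
theorem flocSource_subset (c : ChartPair σ q₁ q₂) : c.flocSource ⊆ c.ψ₁.source :=
  inter_subset_left

/-- `floc` maps `flocSource` into `ψ₂.source`. [folklore] -/
theorem mapsTo_floc (c : ChartPair σ q₁ q₂) : MapsTo c.floc c.flocSource c.ψ₂.source :=
  fun _ hy => c.ψ₂.map_target hy.2.2

/-- **Branch points of the common domain lie in `flocSource`.** [folklore] -/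
theorem mem_flocSource (c : ChartPair σ q₁ q₂) {y : X} (hy : y ∈ c.dom) (hfix : σ y = y) :
    q₁ y ∈ c.flocSource := by
  have h0 := c.snd_split_φ₁_eq_zero hy hfix
  have h1 : splitW (c.ψ₁ (q₁ y)) = split (c.φ₁ y) := by
    rw [← c.sqModel_split_φ₁ hy.1, sqModel_of_snd_eq_zero h0]
  have hsrc : ((split (c.φ₁ y)).1, (0 : ℂ)) ∈ c.θ.source := by
    rw [← eq_real_of_snd_eq_zero h0]
    exact c.split_mem_θ_source hy
  have h2 : c.Θloc (split (c.φ₁ y)) = split (c.φ₂ y) := by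
    rw [eq_real_of_snd_eq_zero h0, Θloc_real, ← c.θ_real hsrc, ← eq_real_of_snd_eq_zero h0,
      c.θ_apply_split hy]
  have h3 : splitW.symm (split (c.φ₂ y)) = c.ψ₂ (q₂ y) := by
    rw [← sqModel_of_snd_eq_zero (c.snd_split_φ₂_eq_zero hy hfix), c.sqModel_split_φ₂ hy.2,
      ContinuousLinearEquiv.symm_apply_apply]
  refine ⟨(c.adapted₁ y hy.1).2.2.1, ?_⟩
  simp only [mem_preimage, mem_inter_iff, mem_setOf_eq]
  rw [h1, h2, h3]
  exact ⟨hsrc, c.ψ₂.map_source (c.adapted₂ y hy.2).2.2.1⟩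

/-- **The local solution `floc` is `C^∞` on `flocSource`** (positive pair). [folklore] -/
theorem contMDiffOn_floc [IsManifold (𝓡 4) ∞ Y₁] [IsManifold (𝓡 4) ∞ Y₂]
    (c : ChartPair σ q₁ q₂) (hpos : c.IsPos) :
    ContMDiffOn (𝓡 4) (𝓡 4) ∞ c.floc c.flocSource := by
  rw [contMDiffOn_iff_of_mem_maximalAtlas' c.ψ₁_mem c.ψ₂_mem c.flocSource_subset c.mapsTo_floc]
  simp only [OpenPartialHomeomorph.extend_coe, OpenPartialHomeomorph.extend_coe_symm,
    modelWithCornersSelf_coe, modelWithCornersSelf_coe_symm, CompTriple.comp_eq]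
  -- the chart expression is `splitW⁻¹ ∘ Θloc ∘ splitW`
  have h : ContDiffOn ℝ ∞ (fun w => splitW.symm (c.Θloc (splitW w))) (c.ψ₁ '' c.flocSource) := by
    refine splitW.symm.contDiff.comp_contDiffOn ((c.contDiffOn_Θloc hpos).comp
      splitW.contDiff.contDiffOn ?_)
    rintro _ ⟨y, hy, rfl⟩
    exact hy.2.1
  refine h.congr ?_
  rintro _ ⟨y, hy, rfl⟩
  simp only [Function.comp_apply, floc, c.ψ₁.left_inv hy.1]
  rw [c.ψ₂.right_inv hy.2.2]

/-! ### First-order structure at the branch locus -/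

/-- The derivative of `θ` at a real point kills the normal component of real vectors:
`(Dθ (a, 0)).2 = 0`. [folklore] -/
theorem snd_fderiv_θ_inl (c : ChartPair σ q₁ q₂) {u : Fin 2 → ℝ} (hu : u ∈ c.realSource)
    (a : Fin 2 → ℝ) : (fderiv ℝ c.θ (u, 0) (a, 0)).2 = 0 :=
  snd_fderiv_inl_eq_zero_of_equivariant (c.hasFDerivAt_θ hu) (c.eventually_θ_flipIm hu) a

/-- The derivative of `θ` at a real point sends normal vectors to normal vectors:
`(Dθ (0, b)).1 = 0`. [folklore] -/
theorem fst_fderiv_θ_inr (c : ChartPair σ q₁ q₂) {u : Fin 2 → ℝ} (hu : u ∈ c.realSource)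
    (b : ℂ) : (fderiv ℝ c.θ (u, 0) (0, b)).1 = 0 :=
  fst_fderiv_inr_eq_zero_of_equivariant (c.hasFDerivAt_θ hu) (c.eventually_θ_flipIm hu) b

/-- The normal block of `Dθ` at a real point is `L u`: `(Dθ (0, b)).2 = L u b`. [folklore] -/
theorem snd_fderiv_θ_inr (c : ChartPair σ q₁ q₂) (u : Fin 2 → ℝ) (b : ℂ) :
    (fderiv ℝ c.θ (u, 0) (0, b)).2 = c.L u b :=
  rfl

/-- The tangential part is differentiable on the real locus, with derivative the tangential
block of `Dθ`: `Dγ a = (Dθ (a, 0)).1`. [folklore] -/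
theorem hasFDerivAt_γ (c : ChartPair σ q₁ q₂) {u : Fin 2 → ℝ} (hu : u ∈ c.realSource) :
    HasFDerivAt c.γ ((ContinuousLinearMap.fst ℝ (Fin 2 → ℝ) ℂ).comp
      ((fderiv ℝ c.θ (u, 0)).comp (ContinuousLinearMap.inl ℝ (Fin 2 → ℝ) ℂ))) u := by
  have hi : HasFDerivAt (fun u' : Fin 2 → ℝ => ((u', 0) : 𝕄))
      (ContinuousLinearMap.inl ℝ (Fin 2 → ℝ) ℂ) u :=
    (ContinuousLinearMap.inl ℝ (Fin 2 → ℝ) ℂ).hasFDerivAt.congr_of_eventuallyEq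
      (Eventually.of_forall fun u' => by simp)
  exact hasFDerivAt_fst.comp u ((c.hasFDerivAt_θ hu).comp u hi)

/-- `Dγ a = (Dθ (a, 0)).1`. [folklore] -/
theorem fderiv_γ_apply (c : ChartPair σ q₁ q₂) {u : Fin 2 → ℝ} (hu : u ∈ c.realSource)
    (a : Fin 2 → ℝ) : fderiv ℝ c.γ u a = (fderiv ℝ c.θ (u, 0) (a, 0)).1 := by
  rw [(c.hasFDerivAt_γ hu).fderiv]
  rfl

/-- **Block structure of `Dθ` at a real point**:
`Dθ (a, b) = (Dγ a + (Dθ (0, b)).1-free part…)`; precisely `Dθ (a, b) = (Dγ a, L u b)`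
(the off-diagonal blocks vanish by equivariance). [folklore] -/
theorem fderiv_θ_real_apply (c : ChartPair σ q₁ q₂) {u : Fin 2 → ℝ} (hu : u ∈ c.realSource)
    (a : Fin 2 → ℝ) (b : ℂ) :
    fderiv ℝ c.θ (u, 0) (a, b) = (fderiv ℝ c.γ u a, c.L u b) := by
  have hsplit : ((a, b) : 𝕄) = (a, 0) + (0, b) := by simp
  rw [hsplit, map_add]
  refine Prod.ext ?_ ?_
  · rw [Prod.fst_add, c.fst_fderiv_θ_inr hu, add_zero, c.fderiv_γ_apply hu]
  · rw [Prod.snd_add, c.snd_fderiv_θ_inl hu, zero_add, c.snd_fderiv_θ_inr]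

/-- **`Dθ` is invertible at every source point** (`θ` has a `C^∞` inverse):
`Dθ⁻¹ (θ x) ∘ Dθ (x) = id`. [folklore] -/
theorem fderiv_symm_comp_fderiv (c : ChartPair σ q₁ q₂) {x : 𝕄} (hx : x ∈ c.θ.source) :
    (fderiv ℝ c.θ.symm (c.θ x)).comp (fderiv ℝ c.θ x) = ContinuousLinearMap.id ℝ 𝕄 := by
  have hx' : c.θ x ∈ c.θ.target := c.θ.map_source hx
  have h1 : HasFDerivAt c.θ.symm (fderiv ℝ c.θ.symm (c.θ x)) (c.θ x) :=
    (((c.contDiffOn_θ_symm _ hx').contDiffAt (c.θ.open_target.mem_nhds hx')).differentiableAt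
      (by simp)).hasFDerivAt
  have h2 : HasFDerivAt (c.θ.symm ∘ c.θ) ((fderiv ℝ c.θ.symm (c.θ x)).comp (fderiv ℝ c.θ x)) x :=
    h1.comp x (c.hasFDerivAt_θ hx)
  have h3 : HasFDerivAt (c.θ.symm ∘ c.θ) (ContinuousLinearMap.id ℝ 𝕄) x := by
    refine (hasFDerivAt_id x).congr_of_eventuallyEq ?_
    filter_upwards [c.isOpen_θ_source.mem_nhds hx] with x' hx'
    exact c.θ.left_inv hx'
  exact h2.unique h3

/-- `Dθ` is injective at every source point. [folklore] -/
theorem injective_fderiv_θ (c : ChartPair σ q₁ q₂) {x : 𝕄} (hx : x ∈ c.θ.source) :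
    Injective (fderiv ℝ c.θ x) := by
  intro v w h
  have := congrArg (fderiv ℝ c.θ.symm (c.θ x)) h
  have key := c.fderiv_symm_comp_fderiv hx
  have hv := congrArg (fun A : 𝕄 →L[ℝ] 𝕄 => A v) key
  have hw := congrArg (fun A : 𝕄 →L[ℝ] 𝕄 => A w) key
  simp only [ContinuousLinearMap.coe_comp, Function.comp_apply] at hv hw
  rw [ContinuousLinearMap.id_apply] at hv hw
  rw [← hv, ← hw, this]

/-- **The normal derivative `L u` is injective** at every real source point. [folklore] -/
theorem injective_L (c : ChartPair σ q₁ q₂) {u : Fin 2 → ℝ} (hu : u ∈ c.realSource) :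
    Injective (c.L u) := by
  intro b b' h
  have h2 : fderiv ℝ c.θ (u, 0) (0, b) = fderiv ℝ c.θ (u, 0) (0, b') := by
    rw [c.fderiv_θ_real_apply hu, c.fderiv_θ_real_apply hu, h]
  have := c.injective_fderiv_θ hu h2
  simpa using this

/-- The derivative of the local solution at a branch point: `(a, b) ↦ (Dγ a, Ô(u) b)`, as a
continuous linear map. [folklore] -/
def ΘlocDeriv (c : ChartPair σ q₁ q₂) (u : Fin 2 → ℝ) : 𝕄 →L[ℝ] 𝕄 :=
  ((fderiv ℝ c.γ u).comp (ContinuousLinearMap.fst ℝ (Fin 2 → ℝ) ℂ)).prod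
    ((polarSq (c.L u)).comp (ContinuousLinearMap.snd ℝ (Fin 2 → ℝ) ℂ))

/-- Unfolding lemma for `ΘlocDeriv`. [folklore] -/
@[simp]
theorem ΘlocDeriv_apply (c : ChartPair σ q₁ q₂) (u : Fin 2 → ℝ) (v : 𝕄) :
    c.ΘlocDeriv u v = (fderiv ℝ c.γ u v.1, polarSq (c.L u) v.2) :=
  rfl

/-- **The derivative of the local solution at a branch point** `(u, 0)` of a positive pair is
`ΘlocDeriv u : (a, b) ↦ (Dγ a, Ô(u) b)` — block diagonal, tangential block `Dγ`, normal block
the squared unitary polar factor. [folklore] -/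
theorem hasFDerivAt_Θloc (c : ChartPair σ q₁ q₂) (hpos : c.IsPos) {u : Fin 2 → ℝ}
    (hu : u ∈ c.realSource) : HasFDerivAt c.Θloc (c.ΘlocDeriv u) (u, 0) := by
  have hα : conformalPart (c.L u) ≠ 0 := by
    intro h0
    have := hpos u hu
    rw [h0, norm_zero] at this
    exact absurd this (not_lt.2 (norm_nonneg _))
  -- the coefficient `g u' = (‖α u'‖⁻¹ • α u')²`
  set g : (Fin 2 → ℝ) → ℂ := fun u' => (‖conformalPart (c.L u')‖⁻¹ • conformalPart (c.L u')) ^ 2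
    with hg
  have hgd : DifferentiableAt ℝ g u := by
    have h1 : ContDiffAt ℝ ∞ (fun u' => conformalPart (c.L u')) u :=
      contDiff_conformalPart.contDiffAt.comp u
        ((c.contDiffOn_L u hu).contDiffAt (c.isOpen_realSource.mem_nhds hu))
    exact (((contDiffAt_inv_norm_smul_sq hα).comp u h1).differentiableAt (by simp))
  have hγd : DifferentiableAt ℝ c.γ u := (c.hasFDerivAt_γ hu).differentiableAt
  -- the local solution near `(u, 0)` is `(γ x.1, g x.1 * x.2)`
  have hU : {x : 𝕄 | x.1 ∈ c.realSource} ∈ 𝓝 ((u, 0) : 𝕄) :=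
    (c.isOpen_realSource.preimage continuous_fst).mem_nhds hu
  have heq : c.Θloc =ᶠ[𝓝 ((u, 0) : 𝕄)] fun x => (c.γ x.1, g x.1 * x.2) := by
    filter_upwards [hU] with x hx
    rw [Θloc, polarSq_apply_of_lt (hpos x.1 hx), div_norm_sq_eq]
  have hγ' : HasFDerivAt c.γ (fderiv ℝ c.γ u) (Prod.fst ((u, 0) : 𝕄)) := hγd.hasFDerivAt
  have h1 : HasFDerivAt (c.γ ∘ Prod.fst)
      ((fderiv ℝ c.γ u).comp (ContinuousLinearMap.fst ℝ (Fin 2 → ℝ) ℂ)) ((u, 0) : 𝕄) :=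
    hγ'.comp ((u, 0) : 𝕄) hasFDerivAt_fst
  have h2 : HasFDerivAt (fun x : 𝕄 => g x.1 * x.2)
      ((polarSq (c.L u)).comp (ContinuousLinearMap.snd ℝ (Fin 2 → ℝ) ℂ)) (u, 0) := by
    have hg' : HasFDerivAt g (fderiv ℝ g u) (Prod.fst ((u, 0) : 𝕄)) := hgd.hasFDerivAt
    have hg1 : HasFDerivAt (g ∘ Prod.fst)
        ((fderiv ℝ g u).comp (ContinuousLinearMap.fst ℝ (Fin 2 → ℝ) ℂ)) ((u, 0) : 𝕄) :=
      hg'.comp ((u, 0) : 𝕄) hasFDerivAt_fst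
    have h := hg1.mul (hasFDerivAt_snd (𝕜 := ℝ) (E := Fin 2 → ℝ) (F := ℂ) (p := (u, 0)))
    refine h.congr_fderiv ?_
    ext v
    · simp [polarSq_apply_of_lt (hpos u hu), div_norm_sq_eq, hg]
    · simp [polarSq_apply_of_lt (hpos u hu), div_norm_sq_eq, hg]
  exact (h1.prodMk h2).congr_of_eventuallyEq heq

end ChartPair

end Literature.Topology.FourManifolds

end


/-!
# The derivative of a descended map in polar (blown-up) coordinates

Topic `Topology/FourManifolds`; namespace `Literature.Topology.FourManifolds.BranchedModel`. Fourth
file of the proof of `Literature.Topology.FourManifolds.DegtyarevKharlamov2000_conjQuotient_unique`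
(`ConjugationQuotients.lean`); model-level calculus continuing `BranchedModelCalculus.lean`.
Everything is proved; no named facts.

Let `θ` be a `flipIm`-equivariant `C^∞` map of the split model `𝕄 = (Fin 2 → ℝ) × ℂ` near its
real locus and `Θ` the descended map, `Θ ∘ sqModel = sqModel ∘ θ` (the comparison map of two
branched double quotients read in a chart pair, `ChartPair.Θh_sqModel`). Off the branch locus
`Θ = sqModel ∘ θ ∘ sqModel⁻¹` locally, so at `w = z²`, `z = s e` (`s` real, `e` a direction)

  `DΘ (u, w) (a, b) = ((Dθ (a, 0)).1 + ½ Ξ(u,s,e) (b/e), 2 θ₂ (Dθ (a, 0)).2 + ρ(u,s,e) (Dθ (0, b/e)).2)`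

with the BLOWN-UP DIFFERENCE QUOTIENTS `ρ(u, s, e) = θ₂ (u, s e)/s` and
`Ξ(u, s, e) = (D_z θ₁)(u, s e)/s` (`slopeAlong`). Both extend continuously to `s = 0` — by the
values `D_z θ₂ (u, 0) e` and `D (D_z θ₁) (u, 0) (0, e)` — because `θ₂` and `D_z θ₁` vanish on the
real locus (equivariance) and are `C¹` (`continuousAt_slopeAlong_zero`, strict differentiability).
Hence the formula defines a field of linear maps `polarDeriv θ (u, s, e)` which is CONTINUOUS in
the polar parameters down to `s = 0` (`continuousAt_polarDeriv`), equals the derivative of the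
descended map for `s ≠ 0` (`polarDeriv_comp_sqModelDeriv`), and at `s = 0` is block upper
triangular with normal block `dirNormal (normalPart (Dθ (u, 0))) e` (`polarDeriv_zero_apply_snd`,
`polarDeriv_zero_apply_inl`): the directional limit of the derivative of the comparison map used,
with the `2 × 2` lemma of `BranchedModelCalculus.lean`, for the invertibility of the averaged
map at the branch locus.

## References

* A. Degtyarev, V. Kharlamov, Russian Math. Surveys 55 (2000), arXiv:math/0004134, §3.2 ¶1.
  [DegtyarevKharlamov2000]
-/

noncomputable section

open scoped Topology ContDiff
open Set Function Filter Asymptotics Metric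

namespace Literature.Topology.FourManifolds

namespace BranchedModel

/-- Local notation: `𝕄` is the split model space `(Fin 2 → ℝ) × ℂ` of points `(u, z)`. -/
local notation "𝕄" => (Fin 2 → ℝ) × ℂ

/-- Local notation: `ℙ` is the space of polar parameters `(u, s, e)`. -/
local notation "ℙ" => (Fin 2 → ℝ) × ℝ × ℂ

/-! ### Blown-up difference quotients -/

section Slope

variable {F : Type*} [NormedAddCommGroup F] [NormedSpace ℝ F]

/-- The point `(u, s e)` of the model with polar parameters `(u, s, e)`. [folklore] -/
def pt (p : ℙ) : 𝕄 :=
  (p.1, p.2.1 • p.2.2)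

omit [NormedSpace ℝ F] in
/-- Unfolding lemma for `pt`. [folklore] -/
@[simp]
theorem pt_apply (u : Fin 2 → ℝ) (s : ℝ) (e : ℂ) : pt (u, s, e) = (u, s • e) :=
  rfl

/-- `pt` is continuous. [folklore] -/
theorem continuous_pt : Continuous (pt : ℙ → 𝕄) :=
  continuous_fst.prodMk (continuous_snd.fst.smul continuous_snd.snd)

/-- **The blown-up difference quotient** of `g : 𝕄 → F` along the normal direction:
`(u, s, e) ↦ g (u, s e)/s` for `s ≠ 0` and `↦ Dg (u, 0) (0, e)` for `s = 0`. [folklore] -/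
def slopeAlong (g : 𝕄 → F) (p : ℙ) : F :=
  if p.2.1 = 0 then fderiv ℝ g (p.1, 0) (0, p.2.2) else (p.2.1)⁻¹ • g (pt p)

/-- `slopeAlong` off `s = 0`. [folklore] -/
theorem slopeAlong_of_ne (g : 𝕄 → F) {p : ℙ} (hs : p.2.1 ≠ 0) :
    slopeAlong g p = (p.2.1)⁻¹ • g (pt p) := by
  simp [slopeAlong, hs]

/-- `slopeAlong` at `s = 0`. [folklore] -/
theorem slopeAlong_zero (g : 𝕄 → F) (u : Fin 2 → ℝ) (e : ℂ) :
    slopeAlong g (u, 0, e) = fderiv ℝ g (u, 0) (0, e) := by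
  simp [slopeAlong]

/-- Off `s = 0` the blown-up difference quotient is continuous where `g` is. [folklore] -/
theorem continuousAt_slopeAlong_of_ne {g : 𝕄 → F} {p : ℙ} (hs : p.2.1 ≠ 0)
    (hg : ContinuousAt g (pt p)) : ContinuousAt (slopeAlong g) p := by
  have hev : slopeAlong g =ᶠ[𝓝 p] fun p => (p.2.1)⁻¹ • g (pt p) := by
    have : ∀ᶠ q : ℙ in 𝓝 p, q.2.1 ≠ 0 :=
      (continuous_snd.fst.continuousAt (x := p)).eventually_ne hs
    filter_upwards [this] with q hq
    exact slopeAlong_of_ne g hq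
  refine (ContinuousAt.congr ?_ hev.symm)
  exact ((continuous_snd.fst.continuousAt (x := p)).inv₀ hs).smul
    (hg.comp continuous_pt.continuousAt)

/-- **Continuity of the blown-up difference quotient at the real locus.** If `g` is `C¹` at
`(u₀, 0)` and vanishes on the real locus near `u₀`, then `slopeAlong g` is continuous at
`(u₀, 0, e₀)`: `g (u, s e)/s → Dg (u₀, 0) (0, e₀)` (strict differentiability of `g`).
[folklore] -/
theorem continuousAt_slopeAlong_zero {g : 𝕄 → F} {u₀ : Fin 2 → ℝ} (e₀ : ℂ)
    (hg : ContDiffAt ℝ 1 g (u₀, 0)) (h0 : ∀ᶠ u in 𝓝 u₀, g (u, 0) = 0) :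
    ContinuousAt (slopeAlong g) (u₀, 0, e₀) := by
  set A := fderiv ℝ g (u₀, 0) with hA
  have hstrict := (hg.hasStrictFDerivAt one_ne_zero).isLittleO
  have hcont : ContinuousAt (fderiv ℝ g) ((u₀, 0) : 𝕄) := hg.continuousAt_fderiv one_ne_zero
  rw [ContinuousAt, slopeAlong_zero, Metric.tendsto_nhds_nhds]
  intro ε hε
  -- the constants
  set M : ℝ := ‖e₀‖ + 1 with hM
  have hMpos : 0 < M := by positivity
  set c : ℝ := ε / (3 * M) with hc
  have hcpos : 0 < c := by positivity
  -- (1) strict differentiability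
  obtain ⟨δ₁, hδ₁, h₁⟩ := Metric.eventually_nhds_iff.1 (hstrict.def hcpos)
  -- (2) vanishing on the real locus
  obtain ⟨δ₂, hδ₂, h₂⟩ := Metric.eventually_nhds_iff.1 h0
  -- (3) continuity of the derivative
  obtain ⟨δ₃, hδ₃, h₃⟩ := Metric.tendsto_nhds_nhds.1 hcont c hcpos
  -- (4) the linear term
  set δ₄ : ℝ := ε / (3 * (‖A‖ + 1)) with hδ₄
  have hδ₄pos : 0 < δ₄ := by positivity
  refine ⟨min (min (min (δ₁ / M) δ₂) (min δ₃ δ₄)) 1, by positivity, fun p hp => ?_⟩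
  obtain ⟨u, s, e⟩ := p
  simp only [lt_min_iff] at hp
  obtain ⟨⟨⟨hp₁, hp₂⟩, hp₃, hp₄⟩, hp1⟩ := hp
  -- unpack the product distance
  have hdu : dist u u₀ ≤ dist (u, s, e) (u₀, (0 : ℝ), e₀) := by
    simp [Prod.dist_eq]
  have hds : |s| ≤ dist (u, s, e) (u₀, (0 : ℝ), e₀) := by
    have h1 : |s| = dist s 0 := by simp
    rw [h1]
    simp only [Prod.dist_eq]
    exact le_trans (le_max_left _ _) (le_max_right _ _)
  have hde : ‖e - e₀‖ ≤ dist (u, s, e) (u₀, (0 : ℝ), e₀) := by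
    rw [← dist_eq_norm]
    simp only [Prod.dist_eq]
    exact le_trans (le_max_right _ _) (le_max_right _ _)
  have he : ‖e‖ ≤ M := by
    have : ‖e‖ ≤ ‖e - e₀‖ + ‖e₀‖ := norm_le_norm_sub_add e e₀
    linarith
  -- the linear term is small
  have hlin : ‖A (0, e) - A (0, e₀)‖ < ε / 3 := by
    rw [← map_sub, Prod.mk_sub_mk, sub_zero]
    calc ‖A (0, e - e₀)‖ ≤ ‖A‖ * ‖((0 : Fin 2 → ℝ), e - e₀)‖ := A.le_opNorm _
      _ = ‖A‖ * ‖e - e₀‖ := by simp [Prod.norm_def]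
      _ ≤ ‖A‖ * δ₄ := by gcongr; linarith
      _ < (‖A‖ + 1) * δ₄ := mul_lt_mul_of_pos_right (lt_add_one ‖A‖) hδ₄pos
      _ = ε / 3 := by
        rw [hδ₄]
        field_simp
  by_cases hs : s = 0
  · -- `s = 0`: continuity of the derivative
    subst hs
    rw [slopeAlong_zero]
    have hD : ‖fderiv ℝ g (u, 0) - A‖ < c := by
      have := h₃ (x := (u, 0)) (by
        calc dist ((u, (0 : ℂ)) : 𝕄) (u₀, 0) = dist u u₀ := by simp [Prod.dist_eq]
          _ < δ₃ := lt_of_le_of_lt hdu hp₃)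
      rwa [dist_eq_norm] at this
    rw [dist_eq_norm]
    have hsplit : fderiv ℝ g (u, 0) (0, e) - A (0, e₀) =
        (fderiv ℝ g (u, 0) - A) (0, e) + (A (0, e) - A (0, e₀)) := by
      simp only [sub_apply]; abel
    rw [hsplit]
    calc ‖(fderiv ℝ g (u, 0) - A) (0, e) + (A (0, e) - A (0, e₀))‖
        ≤ ‖(fderiv ℝ g (u, 0) - A) (0, e)‖ + ‖A (0, e) - A (0, e₀)‖ := norm_add_le _ _
      _ ≤ c * M + ‖A (0, e) - A (0, e₀)‖ := by
        gcongr
        calc ‖(fderiv ℝ g (u, 0) - A) (0, e)‖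
            ≤ ‖fderiv ℝ g (u, 0) - A‖ * ‖((0 : Fin 2 → ℝ), e)‖ := ContinuousLinearMap.le_opNorm _ _
          _ = ‖fderiv ℝ g (u, 0) - A‖ * ‖e‖ := by simp [Prod.norm_def]
          _ ≤ c * M := by gcongr
      _ < ε := by
        have : c * M = ε / 3 := by rw [hc]; field_simp
        linarith
  · -- `s ≠ 0`: strict differentiability along `((u, s e), (u, 0))`
    rw [slopeAlong_of_ne g (p := (u, s, e)) hs]
    simp only [pt_apply]
    have hq : dist (((u, s • e), (u, 0)) : 𝕄 × 𝕄) ((u₀, 0), (u₀, 0)) < δ₁ := by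
      have hse : ‖s • e‖ < δ₁ := by
        rw [norm_smul, Real.norm_eq_abs]
        calc |s| * ‖e‖ ≤ |s| * M := by gcongr
          _ < δ₁ / M * M := by gcongr; exact lt_of_le_of_lt hds hp₁
          _ = δ₁ := by field_simp
      have hu' : dist u u₀ < δ₁ := by
        have : dist u u₀ < δ₁ / M := lt_of_le_of_lt hdu hp₁
        have hM1 : 1 ≤ M := by rw [hM]; linarith [norm_nonneg e₀]
        calc dist u u₀ < δ₁ / M := this
          _ ≤ δ₁ := div_le_self hδ₁.le hM1
      simp only [Prod.dist_eq, max_lt_iff, dist_self]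
      refine ⟨⟨hu', ?_⟩, hu', hδ₁⟩
      simpa [dist_eq_norm] using hse
    have hkey := h₁ hq
    simp only [Prod.mk_sub_mk, sub_self, sub_zero] at hkey
    have hg0 : g (u, 0) = 0 := h₂ (lt_of_le_of_lt hdu hp₂)
    rw [hg0, sub_zero] at hkey
    -- `‖g (u, s e) - s A (0, e)‖ ≤ c |s| ‖e‖`
    have hAse : A ((0 : Fin 2 → ℝ), s • e) = s • A (0, e) := by
      rw [← map_smul]; simp
    rw [hAse] at hkey
    have hn0 : ‖((0 : Fin 2 → ℝ), s • e)‖ = |s| * ‖e‖ := by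
      simp [Prod.norm_def]
      positivity
    rw [hn0] at hkey
    have hsabs : 0 < |s| := abs_pos.2 hs
    have hmain : ‖s⁻¹ • g (u, s • e) - A (0, e)‖ ≤ c * ‖e‖ := by
      have : s⁻¹ • g (u, s • e) - A (0, e) = s⁻¹ • (g (u, s • e) - s • A (0, e)) := by
        rw [smul_sub, smul_smul, inv_mul_cancel₀ hs, one_smul]
      rw [this, norm_smul, norm_inv, Real.norm_eq_abs]
      calc |s|⁻¹ * ‖g (u, s • e) - s • A (0, e)‖ ≤ |s|⁻¹ * (c * (|s| * ‖e‖)) := by gcongr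
        _ = c * ‖e‖ := by field_simp
    rw [dist_eq_norm]
    have hsplit : s⁻¹ • g (u, s • e) - A (0, e₀) =
        (s⁻¹ • g (u, s • e) - A (0, e)) + (A (0, e) - A (0, e₀)) := by abel
    rw [hsplit]
    calc ‖(s⁻¹ • g (u, s • e) - A (0, e)) + (A (0, e) - A (0, e₀))‖
        ≤ ‖s⁻¹ • g (u, s • e) - A (0, e)‖ + ‖A (0, e) - A (0, e₀)‖ := norm_add_le _ _
      _ ≤ c * M + ‖A (0, e) - A (0, e₀)‖ := by
        gcongr
        exact hmain.trans (by gcongr)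
      _ < ε := by
        have : c * M = ε / 3 := by rw [hc]; field_simp
        linarith

end Slope

/-! ### The polar derivative field of a descended equivariant map -/

section Polar

/-- The **tangential–normal block** `b ↦ (Dθ(p) (0, b)).1` of the derivative of `θ` at `p`: it
vanishes at real points of a `flipIm`-equivariant map (`fst_fderiv_inr_eq_zero_of_equivariant`).
[folklore] -/
def tangNormal (θ : 𝕄 → 𝕄) (p : 𝕄) : ℂ →L[ℝ] (Fin 2 → ℝ) :=
  (ContinuousLinearMap.fst ℝ (Fin 2 → ℝ) ℂ).comp
    ((fderiv ℝ θ p).comp (ContinuousLinearMap.inr ℝ (Fin 2 → ℝ) ℂ))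

/-- Unfolding lemma for `tangNormal`. [folklore] -/
@[simp]
theorem tangNormal_apply (θ : 𝕄 → 𝕄) (p : 𝕄) (b : ℂ) :
    tangNormal θ p b = (fderiv ℝ θ p (0, b)).1 :=
  rfl

/-- `A ↦ fst ∘ A ∘ inr` is a `C^∞` (bounded linear) function of the linear map. [folklore] -/
theorem contDiff_tangNormalMap :
    ContDiff ℝ ∞ (fun A : 𝕄 →L[ℝ] 𝕄 => (ContinuousLinearMap.fst ℝ (Fin 2 → ℝ) ℂ).comp
      (A.comp (ContinuousLinearMap.inr ℝ (Fin 2 → ℝ) ℂ))) := by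
  have h : IsBoundedLinearMap ℝ (fun A : 𝕄 →L[ℝ] 𝕄 => (ContinuousLinearMap.fst ℝ (Fin 2 → ℝ) ℂ).comp
      (A.comp (ContinuousLinearMap.inr ℝ (Fin 2 → ℝ) ℂ))) :=
    { map_add := fun A B => by ext b; simp
      map_smul := fun r A => by ext b; simp
      bound := ⟨1, one_pos, fun A => by
        rw [one_mul]
        refine ContinuousLinearMap.opNorm_le_bound _ (norm_nonneg A) fun b => ?_
        simp only [ContinuousLinearMap.coe_comp, Function.comp_apply, ContinuousLinearMap.inr_apply,
          ContinuousLinearMap.coe_fst']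
        calc ‖(A (0, b)).1‖ ≤ ‖A (0, b)‖ := norm_fst_le _
          _ ≤ ‖A‖ * ‖((0 : Fin 2 → ℝ), b)‖ := A.le_opNorm _
          _ ≤ ‖A‖ * ‖b‖ := by
            gcongr
            simp [Prod.norm_def]⟩ }
  exact h.contDiff

/-- **The blown-up normal quotient** `ρ(u, s, e) = θ₂ (u, s e)/s`, extended to `s = 0` by
`D_z θ₂ (u, 0) e`. [folklore] -/
def ρ (θ : 𝕄 → 𝕄) : ℙ → ℂ :=
  slopeAlong fun p => (θ p).2

/-- **The blown-up tangential–normal quotient** `Ξ(u, s, e) = (D_z θ₁)(u, s e)/s`, extended to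
`s = 0` by `D (D_z θ₁) (u, 0) (0, e)`. [folklore] -/
def Ξ (θ : 𝕄 → 𝕄) : ℙ → ℂ →L[ℝ] (Fin 2 → ℝ) :=
  slopeAlong (tangNormal θ)

/-- Division by the direction: `b ↦ e⁻¹ b` as a real-linear map. [folklore] -/
def divBy (e : ℂ) : ℂ →L[ℝ] ℂ :=
  e⁻¹ • ContinuousLinearMap.id ℝ ℂ

/-- Unfolding lemma for `divBy`. [folklore] -/
@[simp]
theorem divBy_apply (e b : ℂ) : divBy e b = e⁻¹ * b := by
  simp [divBy, smul_eq_mul]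

/-- `v ↦ (v.1, 0)`. [folklore] -/
def inlFst : 𝕄 →L[ℝ] 𝕄 :=
  (ContinuousLinearMap.inl ℝ (Fin 2 → ℝ) ℂ).comp (ContinuousLinearMap.fst ℝ (Fin 2 → ℝ) ℂ)

/-- Unfolding lemma for `inlFst`. [folklore] -/
@[simp]
theorem inlFst_apply (v : 𝕄) : inlFst v = (v.1, 0) :=
  rfl

/-- `v ↦ (0, e⁻¹ v.2)`. [folklore] -/
def inrDivSnd (e : ℂ) : 𝕄 →L[ℝ] 𝕄 :=
  (ContinuousLinearMap.inr ℝ (Fin 2 → ℝ) ℂ).comp ((divBy e).comp (ContinuousLinearMap.snd ℝ (Fin 2 → ℝ) ℂ))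

/-- Unfolding lemma for `inrDivSnd`. [folklore] -/
@[simp]
theorem inrDivSnd_apply (e : ℂ) (v : 𝕄) : inrDivSnd e v = (0, e⁻¹ * v.2) := by
  simp [inrDivSnd]

/-- The tangential (first) component of the polar derivative field. [folklore] -/
def polarDerivFst (θ : 𝕄 → 𝕄) (p : ℙ) : 𝕄 →L[ℝ] (Fin 2 → ℝ) :=
  (ContinuousLinearMap.fst ℝ (Fin 2 → ℝ) ℂ).comp ((fderiv ℝ θ (pt p)).comp inlFst) +
    (1 / 2 : ℝ) • ((Ξ θ p).comp ((divBy p.2.2).comp (ContinuousLinearMap.snd ℝ (Fin 2 → ℝ) ℂ)))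

/-- The normal (second) component of the polar derivative field. [folklore] -/
def polarDerivSnd (θ : 𝕄 → 𝕄) (p : ℙ) : 𝕄 →L[ℝ] ℂ :=
  (2 * (θ (pt p)).2) • ((ContinuousLinearMap.snd ℝ (Fin 2 → ℝ) ℂ).comp
      ((fderiv ℝ θ (pt p)).comp inlFst)) +
    (ρ θ p) • ((ContinuousLinearMap.snd ℝ (Fin 2 → ℝ) ℂ).comp
      ((fderiv ℝ θ (pt p)).comp (inrDivSnd p.2.2)))

/-- **The polar derivative field** of the descended map of `θ`: at polar parameters
`(u, s, e)`, the linear map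
`(a, b) ↦ ((Dθ (a,0)).1 + ½ Ξ (b/e), 2 θ₂ (Dθ (a,0)).2 + ρ · (Dθ (0, b/e)).2)` (all at the point
`(u, s e)`); for `s ≠ 0` it is the derivative of `sqModel ∘ θ ∘ sqModel⁻¹` at `(u, (s e)²)`
(`polarDeriv_comp_sqModelDeriv`). [folklore] -/
def polarDeriv (θ : 𝕄 → 𝕄) (p : ℙ) : 𝕄 →L[ℝ] 𝕄 :=
  (polarDerivFst θ p).prod (polarDerivSnd θ p)

/-- Unfolding lemma for `polarDeriv`. [folklore] -/
theorem polarDeriv_apply (θ : 𝕄 → 𝕄) (p : ℙ) (v : 𝕄) :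
    polarDeriv θ p v =
      ((fderiv ℝ θ (pt p) (v.1, 0)).1 + (1 / 2 : ℝ) • Ξ θ p (p.2.2⁻¹ * v.2),
        2 * (θ (pt p)).2 * (fderiv ℝ θ (pt p) (v.1, 0)).2 +
          ρ θ p * (fderiv ℝ θ (pt p) (0, p.2.2⁻¹ * v.2)).2) := by
  simp [polarDeriv, polarDerivFst, polarDerivSnd, smul_eq_mul]

/-- Real multiples in the normal slot: `Dθ (0, c b) = c • Dθ (0, b)`. [folklore] -/
theorem fderiv_inr_real_mul (θ : 𝕄 → 𝕄) (q : 𝕄) (c : ℝ) (b : ℂ) :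
    fderiv ℝ θ q (0, (c : ℂ) * b) = c • fderiv ℝ θ q (0, b) := by
  rw [← map_smul]
  congr 1
  simp [Complex.real_smul]

/-- **For `s ≠ 0` the polar derivative field is the derivative of the descended map**:
`polarDeriv θ (u, s, e) ∘ D(sqModel)(u, s e) = D(sqModel)(θ (u, s e)) ∘ Dθ (u, s e)` — the chain
rule for `Θ ∘ sqModel = sqModel ∘ θ`, solved for `DΘ`. [folklore] -/
theorem polarDeriv_comp_sqModelDeriv (θ : 𝕄 → 𝕄) {p : ℙ} (hs : p.2.1 ≠ 0) (he : p.2.2 ≠ 0) :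
    (polarDeriv θ p).comp (sqModelDeriv (p.2.1 • p.2.2)) =
      (sqModelDeriv (θ (pt p)).2).comp (fderiv ℝ θ (pt p)) := by
  obtain ⟨u, s, e⟩ := p
  simp only at hs he
  set D := fderiv ℝ θ (pt (u, s, e)) with hD
  have hρ : ρ θ (u, s, e) = s⁻¹ • (θ (pt (u, s, e))).2 := slopeAlong_of_ne _ hs
  have hΞ : Ξ θ (u, s, e) = s⁻¹ • tangNormal θ (pt (u, s, e)) := slopeAlong_of_ne _ hs
  refine ContinuousLinearMap.ext fun v => ?_
  obtain ⟨a, b⟩ := v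
  have h1 : e⁻¹ * (2 * ((s : ℂ) * e) * b) = ((2 * s : ℝ) : ℂ) * b := by
    push_cast
    field_simp
  have h2 : ((a, b) : 𝕄) = (a, 0) + (0, b) := by simp
  simp only [ContinuousLinearMap.coe_comp, Function.comp_apply, sqModelDeriv_apply,
    polarDeriv_apply, hΞ, hρ, smul_apply, tangNormal_apply, Complex.real_smul]
  rw [h1, fderiv_inr_real_mul, ← hD]
  conv_rhs => rw [h2, map_add]
  refine Prod.ext ?_ ?_
  · -- first component
    simp only [Prod.fst_add, Prod.smul_fst, smul_smul]
    have h3 : (1 / 2 : ℝ) * (s⁻¹ * (2 * s)) = 1 := by field_simp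
    rw [h3, one_smul]
  · -- second component
    have hs' : (s : ℂ) ≠ 0 := by exact_mod_cast hs
    simp only [Prod.snd_add, Prod.smul_snd, Complex.real_smul]
    push_cast
    field_simp

/-- At `s = 0` the base point is the real point `(u, 0)`. [folklore] -/
@[simp]
theorem pt_zero (u : Fin 2 → ℝ) (e : ℂ) : pt (u, 0, e) = (u, 0) := by
  simp [pt]

/-- The blown-up normal quotient at `s = 0` is the normal derivative:
`ρ (u, 0, e) = (Dθ (u, 0) (0, e)).2`. [folklore] -/
theorem ρ_zero (θ : 𝕄 → 𝕄) {u : Fin 2 → ℝ} (hθ : DifferentiableAt ℝ θ (u, 0)) (e : ℂ) :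
    ρ θ (u, 0, e) = normalPart (fderiv ℝ θ (u, 0)) e := by
  rw [ρ, slopeAlong_zero, hθ.hasFDerivAt.snd.fderiv]
  rfl

/-- **The polar derivative field at `s = 0`, normal component**: it is the directional normal
derivative `dirNormal (normalPart (Dθ (u, 0))) e` of `BranchedModelCalculus.lean` (the real point
`(u, 0)` being mapped to a real point). [folklore] -/
theorem polarDeriv_zero_apply_snd (θ : 𝕄 → 𝕄) {u : Fin 2 → ℝ} (hθ : DifferentiableAt ℝ θ (u, 0))
    (h0 : (θ (u, 0)).2 = 0) (e : ℂ) (v : 𝕄) :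
    (polarDeriv θ (u, 0, e) v).2 = dirNormal (normalPart (fderiv ℝ θ (u, 0))) e v.2 := by
  rw [polarDeriv_apply, dirNormal_apply, pt_zero, h0, ρ_zero θ hθ]
  simp

/-- **The polar derivative field at `s = 0`, on real vectors**: `(a, 0) ↦ ((Dθ (a, 0)).1, 0)`.
[folklore] -/
theorem polarDeriv_zero_apply_inl (θ : 𝕄 → 𝕄) {u : Fin 2 → ℝ} (h0 : (θ (u, 0)).2 = 0) (e : ℂ)
    (a : Fin 2 → ℝ) : polarDeriv θ (u, 0, e) (a, 0) = ((fderiv ℝ θ (u, 0) (a, 0)).1, 0) := by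
  rw [polarDeriv_apply, pt_zero, h0]
  simp [Prod.mk_zero_zero]

/-- The tangential block of the polar derivative field: `(polarDeriv (a, 0)).1 = (Dθ (a, 0)).1`
at every parameter. [folklore] -/
theorem polarDeriv_apply_inl_fst (θ : 𝕄 → 𝕄) (p : ℙ) (a : Fin 2 → ℝ) :
    (polarDeriv θ p (a, 0)).1 = (fderiv ℝ θ (pt p) (a, 0)).1 := by
  rw [polarDeriv_apply]
  simp

/-! ### Continuity of the polar derivative field down to `s = 0` -/

variable {θ : 𝕄 → 𝕄} {S : Set 𝕄}

/-- For an equivariant `C^∞` map, `p ↦ θ₂ p` is `C¹` at real points and vanishes on the real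
locus nearby, so its blown-up quotient `ρ` is continuous at `(u, 0, e)`. [folklore] -/
theorem continuousAt_ρ_zero (hS : IsOpen S) (hθ : ContDiffOn ℝ ∞ θ S)
    (heq : ∀ x ∈ S, flipIm x ∈ S ∧ θ (flipIm x) = flipIm (θ x)) {u : Fin 2 → ℝ}
    (hu : ((u, 0) : 𝕄) ∈ S) (e : ℂ) : ContinuousAt (ρ θ) (u, 0, e) := by
  refine continuousAt_slopeAlong_zero e ?_ ?_
  · exact ((hθ _ hu).contDiffAt (hS.mem_nhds hu)).snd.of_le (by exact_mod_cast le_top)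
  · have hev : ∀ᶠ u' in 𝓝 u, ((u', 0) : 𝕄) ∈ S :=
      (Continuous.prodMk_left (0 : ℂ)).continuousAt.preimage_mem_nhds (hS.mem_nhds hu)
    filter_upwards [hev] with u' hu'
    refine snd_apply_eq_zero_of_equivariant ?_
    filter_upwards [hS.mem_nhds hu'] with x hx
    exact (heq x hx).2

/-- For an equivariant `C^∞` map, the tangential–normal block is `C¹` at real points and
vanishes on the real locus nearby, so its blown-up quotient `Ξ` is continuous at `(u, 0, e)`.
[folklore] -/
theorem continuousAt_Ξ_zero (hS : IsOpen S) (hθ : ContDiffOn ℝ ∞ θ S)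
    (heq : ∀ x ∈ S, flipIm x ∈ S ∧ θ (flipIm x) = flipIm (θ x)) {u : Fin 2 → ℝ}
    (hu : ((u, 0) : 𝕄) ∈ S) (e : ℂ) : ContinuousAt (Ξ θ) (u, 0, e) := by
  refine continuousAt_slopeAlong_zero e ?_ ?_
  · have hD : ContDiffOn ℝ ∞ (fun x => fderiv ℝ θ x) S := hθ.fderiv_of_isOpen hS (by simp)
    have h1 : ContDiffAt ℝ ∞ (tangNormal θ) (u, 0) :=
      contDiff_tangNormalMap.contDiffAt.comp _ ((hD _ hu).contDiffAt (hS.mem_nhds hu))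
    exact h1.of_le (by exact_mod_cast le_top)
  · have hev : ∀ᶠ u' in 𝓝 u, ((u', 0) : 𝕄) ∈ S :=
      (Continuous.prodMk_left (0 : ℂ)).continuousAt.preimage_mem_nhds (hS.mem_nhds hu)
    filter_upwards [hev] with u' hu'
    refine ContinuousLinearMap.ext fun b => ?_
    rw [tangNormal_apply, zero_apply]
    refine fst_fderiv_inr_eq_zero_of_equivariant (θ := θ) (u := u') ?_ ?_ b
    · exact (((hθ _ hu').contDiffAt (hS.mem_nhds hu')).differentiableAt (by simp)).hasFDerivAt
    · filter_upwards [hS.mem_nhds hu'] with x hx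
      exact (heq x hx).2

/-- `e ↦ divBy e` is continuous away from `0`. [folklore] -/
theorem continuousAt_divBy {e : ℂ} (he : e ≠ 0) : ContinuousAt (fun e : ℂ => divBy e) e := by
  unfold divBy
  exact (continuousAt_inv₀ he).smul continuousAt_const

/-- **The polar derivative field is continuous in the polar parameters, down to `s = 0`**, at
every parameter `(u, s, e)` with `(u, s e)` in the open equivariant domain of smoothness of `θ`
and `e ≠ 0`. [folklore] -/
theorem continuousAt_polarDeriv (hS : IsOpen S) (hθ : ContDiffOn ℝ ∞ θ S)
    (heq : ∀ x ∈ S, flipIm x ∈ S ∧ θ (flipIm x) = flipIm (θ x)) {p : ℙ} (hp : pt p ∈ S)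
    (he : p.2.2 ≠ 0) : ContinuousAt (polarDeriv θ) p := by
  -- the ingredients
  have hθc : ContinuousAt θ (pt p) := (hθ.continuousOn.continuousAt (hS.mem_nhds hp))
  have hDc : ContinuousAt (fun x => fderiv ℝ θ x) (pt p) :=
    ((hθ _ hp).contDiffAt (hS.mem_nhds hp)).continuousAt_fderiv (by simp)
  have hD : ContinuousAt (fun q : ℙ => fderiv ℝ θ (pt q)) p :=
    hDc.comp continuous_pt.continuousAt
  have hθ₂ : ContinuousAt (fun q : ℙ => (θ (pt q)).2) p :=
    (continuous_snd.continuousAt.comp hθc).comp continuous_pt.continuousAt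
  have hρ : ContinuousAt (ρ θ) p := by
    by_cases hs : p.2.1 = 0
    · obtain ⟨u, s, e⟩ := p
      simp only at hs
      subst hs
      have hu : ((u, 0) : 𝕄) ∈ S := by simpa using hp
      exact continuousAt_ρ_zero hS hθ heq hu e
    · exact continuousAt_slopeAlong_of_ne hs (continuous_snd.continuousAt.comp hθc)
  have hΞ : ContinuousAt (Ξ θ) p := by
    by_cases hs : p.2.1 = 0
    · obtain ⟨u, s, e⟩ := p
      simp only at hs
      subst hs
      have hu : ((u, 0) : 𝕄) ∈ S := by simpa using hp
      exact continuousAt_Ξ_zero hS hθ heq hu e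
    · refine continuousAt_slopeAlong_of_ne hs ?_
      exact (contDiff_tangNormalMap.continuous.continuousAt.comp hDc)
  have hdiv : ContinuousAt (fun q : ℙ => divBy q.2.2) p :=
    ContinuousAt.comp (g := fun e : ℂ => divBy e) (f := fun q : ℙ => q.2.2) (x := p)
      (continuousAt_divBy he) (continuous_snd.snd.continuousAt)
  -- constant pieces
  have cfst : ContinuousAt (fun _ : ℙ => ContinuousLinearMap.fst ℝ (Fin 2 → ℝ) ℂ) p :=
    continuousAt_const
  have csnd : ContinuousAt (fun _ : ℙ => ContinuousLinearMap.snd ℝ (Fin 2 → ℝ) ℂ) p :=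
    continuousAt_const
  have cinl : ContinuousAt (fun _ : ℙ => inlFst) p := continuousAt_const
  have cinr : ContinuousAt (fun _ : ℙ => ContinuousLinearMap.inr ℝ (Fin 2 → ℝ) ℂ) p :=
    continuousAt_const
  have ctwo : ContinuousAt (fun _ : ℙ => (2 : ℂ)) p := continuousAt_const
  -- the two components
  have h1 : ContinuousAt (polarDerivFst θ) p := by
    unfold polarDerivFst
    refine ContinuousAt.add ?_ ?_
    · exact cfst.clm_comp (hD.clm_comp cinl)
    · exact (hΞ.clm_comp (hdiv.clm_comp csnd)).const_smul (1 / 2 : ℝ)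
  have h2 : ContinuousAt (polarDerivSnd θ) p := by
    unfold polarDerivSnd inrDivSnd
    refine ContinuousAt.add ?_ ?_
    · exact (ctwo.mul hθ₂).smul (csnd.clm_comp (hD.clm_comp cinl))
    · exact hρ.smul (csnd.clm_comp (hD.clm_comp (cinr.clm_comp (hdiv.clm_comp csnd))))
  -- assemble the product
  have h3 : ContinuousAt (fun q : ℙ => ContinuousLinearMap.prodₗᵢ ℝ (polarDerivFst θ q,
      polarDerivSnd θ q)) p :=
    (ContinuousLinearMap.prodₗᵢ ℝ).continuous.continuousAt.comp (h1.prodMk h2)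
  exact h3

end Polar

end BranchedModel

end Literature.Topology.FourManifolds

end


/-!
# Positive chart pairs exist at every fixed point

Topic `Topology/FourManifolds`; namespace `Literature.Topology.FourManifolds`. Companion of
`ConjugationQuotientsChartPairs.lean` in the proof of
`Literature.Topology.FourManifolds.DegtyarevKharlamov2000_conjQuotient_unique`
(`ConjugationQuotients.lean`). Everything is proved; no named facts.

A chart pair `c : ChartPair σ q₁ q₂` is **positive** (`ChartPair.IsPos`) when the normal
derivative `c.L u` of its mixed transition is orientation preserving (`|β(u)| < |α(u)|`) at
every real point of its source. We prove that every fixed point of `σ` lies in the common domain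
of a positive chart pair (`ChartPair.exists_isPos`):

* the normal derivative at a real point is injective (`ChartPair.injective_L`), hence
  `|α| ≠ |β|` (`BranchedModel.norm_conformalPart_ne_of_injective`: if `|α| = |β|` then
  `z = 1 + ζ` or `z = i`, `ζ = -β/α`, is a kernel vector of `z ↦ α z + β z̄`);
* if `|α| < |β|` at the base point, **flip** the pair (`ChartPair.flip`): replace the adapted
  chart `(φ₂, ψ₂)` of `q₂` by `(conj₂ ∘ φ₂, r₃ ∘ ψ₂)` with `conj₂ (v₀, v₁) = (v₀, v̄₁)` and
  `r₃ (w₀, w₁, w₂, w₃) = (w₀, w₁, w₂, -w₃)` — again adapted (`conj₂` commutes with `star`,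
  `branchedDoubleModel ∘ conj₂ = r₃ ∘ branchedDoubleModel`), with mixed transition
  `conjIm ∘ θ` and hence swapped `|α|`, `|β|` (`ChartPair.flip_L`);
* then **shrink** `φ₁` to the (open, `σ`-invariant) set above which the pair is positive
  (`ChartPair.shrink`), using that the maximal atlas is closed under restriction.

## References

* A. Degtyarev, V. Kharlamov, Russian Math. Surveys 55 (2000), arXiv:math/0004134, §3.2 ¶1.
  [DegtyarevKharlamov2000]
-/

noncomputable section

open scoped Manifold ContDiff Topology ComplexConjugate
open Set Function Filter
open Literature.Topology.FourManifolds.BranchedModel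

namespace Literature.Topology.FourManifolds

/-- Local notation: `𝕄` is the split model space `(Fin 2 → ℝ) × ℂ`. -/
local notation "𝕄" => (Fin 2 → ℝ) × ℂ

/-! ### Algebra: injectivity forces `|α| ≠ |β|`; conjugation swaps `α` and `β` -/

namespace BranchedModel

/-- **An injective real-linear `z ↦ α z + β z̄` has `|α| ≠ |β|`** (for `|α| = |β|` the vector
`1 + ζ` — or `i` when `ζ = -1` — with `ζ = -β/α` is in the kernel). [folklore] -/
theorem norm_conformalPart_ne_of_injective {L : ℂ →L[ℝ] ℂ} (hL : Injective L) :
    ‖conformalPart L‖ ≠ ‖anticonformalPart L‖ := by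
  set α := conformalPart L with hα
  set β := anticonformalPart L with hβ
  intro hnorm
  have hrep : ∀ z, L z = α * z + β * conj z := apply_eq_conformalPart_add L
  -- a nonzero kernel vector
  have key : ∃ z : ℂ, z ≠ 0 ∧ α * z + β * conj z = 0 := by
    by_cases hα0 : α = 0
    · have hβ0 : β = 0 := by
        rw [hα0, norm_zero] at hnorm
        exact norm_eq_zero.1 hnorm.symm
      exact ⟨1, one_ne_zero, by simp [hα0, hβ0]⟩
    · set ζ : ℂ := -β / α with hζ
      have hζn : ‖ζ‖ = 1 := by
        rw [hζ, norm_div, norm_neg, ← hnorm, div_self (norm_ne_zero_iff.2 hα0)]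
      have hζζ : ζ * conj ζ = 1 := by
        rw [Complex.mul_conj, Complex.normSq_eq_norm_sq, hζn]; simp
      have hβζ : β = -α * ζ := by rw [hζ]; field_simp
      by_cases h1 : ζ = -1
      · refine ⟨Complex.I, Complex.I_ne_zero, ?_⟩
        rw [hβζ, h1, Complex.conj_I]
        ring
      · refine ⟨1 + ζ, fun h0 => h1 (by linear_combination h0), ?_⟩
        rw [hβζ, map_add, map_one]
        linear_combination (-α) * hζζ
  obtain ⟨z, hz, hker⟩ := key
  have : L z = L 0 := by rw [hrep, hker, map_zero]
  exact hz (hL this)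

/-- `conformalPart (conj ∘ L) = conj (anticonformalPart L)`. [folklore] -/
theorem conformalPart_conj_comp (L : ℂ →L[ℝ] ℂ) :
    conformalPart ((Complex.conjCLE : ℂ →L[ℝ] ℂ).comp L) = conj (anticonformalPart L) := by
  simp only [conformalPart, anticonformalPart, ContinuousLinearMap.coe_comp, Function.comp_apply,
    ContinuousLinearEquiv.coe_coe, Complex.conjCLE_apply, map_div₀, map_add, map_mul,
    Complex.conj_I]
  simp [map_ofNat]
  ring

/-- `anticonformalPart (conj ∘ L) = conj (conformalPart L)`. [folklore] -/
theorem anticonformalPart_conj_comp (L : ℂ →L[ℝ] ℂ) :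
    anticonformalPart ((Complex.conjCLE : ℂ →L[ℝ] ℂ).comp L) = conj (conformalPart L) := by
  simp only [conformalPart, anticonformalPart, ContinuousLinearMap.coe_comp, Function.comp_apply,
    ContinuousLinearEquiv.coe_coe, Complex.conjCLE_apply, map_div₀, map_sub, map_mul,
    Complex.conj_I]
  simp [map_ofNat]

/-- **Conjugation of the normal variable**: `conjIm (u, z) = (u, z̄)`, a real-linear involution of
the split model. [folklore] -/
def conjIm : 𝕄 ≃L[ℝ] 𝕄 :=
  (ContinuousLinearEquiv.refl ℝ (Fin 2 → ℝ)).prodCongr (Complex.conjCLE : ℂ ≃L[ℝ] ℂ)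

/-- Unfolding lemma for `conjIm`. [folklore] -/
@[simp]
theorem conjIm_apply (x : 𝕄) : conjIm x = (x.1, conj x.2) :=
  rfl

/-- `sqModel` commutes with `conjIm`. [folklore] -/
@[simp]
theorem sqModel_conjIm (x : 𝕄) : sqModel (conjIm x) = conjIm (sqModel x) := by
  simp [sqModel, map_pow]

/-- The normal part of `conjIm ∘ A` is `conj ∘ normalPart A`. [folklore] -/
theorem normalPart_conjIm_comp (A : 𝕄 →L[ℝ] 𝕄) :
    normalPart ((conjIm : 𝕄 →L[ℝ] 𝕄).comp A) = (Complex.conjCLE : ℂ →L[ℝ] ℂ).comp (normalPart A) := by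
  ext b; simp

/-- **Conjugation of the second coordinate of `ℂ²`**: `conj₂ (v₀, v₁) = (v₀, v̄₁)`, a real-linear
involution commuting with `star` and read as `conjIm` in split coordinates. [folklore] -/
def conj₂ : (Fin 2 → ℂ) ≃L[ℝ] (Fin 2 → ℂ) :=
  LinearEquiv.toContinuousLinearEquiv
    ({ toFun := fun v => ![v 0, conj (v 1)]
       invFun := fun v => ![v 0, conj (v 1)]
       map_add' := fun v w => by
         funext i; fin_cases i <;> simp
       map_smul' := fun r v => by
         funext i; fin_cases i <;> simp
       left_inv := fun v => by
         funext i; fin_cases i <;> simp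
       right_inv := fun v => by
         funext i; fin_cases i <;> simp } : (Fin 2 → ℂ) ≃ₗ[ℝ] (Fin 2 → ℂ))

/-- Unfolding lemma for `conj₂`. [folklore] -/
@[simp]
theorem conj₂_apply (v : Fin 2 → ℂ) : conj₂ v = ![v 0, conj (v 1)] :=
  rfl

/-- `conj₂` commutes with `star`. [folklore] -/
theorem conj₂_star (v : Fin 2 → ℂ) : conj₂ (star v) = star (conj₂ v) := by
  funext i
  fin_cases i <;> simp

/-- **`conj₂` in split coordinates is `conjIm`.** [folklore] -/
@[simp]
theorem split_conj₂ (v : Fin 2 → ℂ) : split (conj₂ v) = conjIm (split v) :=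
  Prod.ext (funext fun i => by fin_cases i <;> simp) (Complex.ext (by simp) (by simp))

/-- **The reflection `r₃` of `ℝ⁴`** in the last coordinate: `(w₀, w₁, w₂, w₃) ↦ (w₀, w₁, w₂, -w₃)`
(read as `conjIm` in split coordinates). [folklore] -/
def r₃ : EuclideanSpace ℝ (Fin 4) ≃L[ℝ] EuclideanSpace ℝ (Fin 4) :=
  LinearEquiv.toContinuousLinearEquiv
    ({ toFun := fun w => WithLp.toLp 2 ![w 0, w 1, w 2, -w 3]
       invFun := fun w => WithLp.toLp 2 ![w 0, w 1, w 2, -w 3]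
       map_add' := fun v w => by
         ext i; fin_cases i <;> simp; ring
       map_smul' := fun r v => by
         ext i; fin_cases i <;> simp
       left_inv := fun v => by
         ext i; fin_cases i <;> simp
       right_inv := fun v => by
         ext i; fin_cases i <;> simp } :
      EuclideanSpace ℝ (Fin 4) ≃ₗ[ℝ] EuclideanSpace ℝ (Fin 4))

/-- Unfolding lemma for `r₃`. [folklore] -/
@[simp]
theorem r₃_apply (w : EuclideanSpace ℝ (Fin 4)) : r₃ w = WithLp.toLp 2 ![w 0, w 1, w 2, -w 3] :=
  rfl

/-- **`r₃` in split coordinates is `conjIm`.** [folklore] -/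
@[simp]
theorem splitW_r₃ (w : EuclideanSpace ℝ (Fin 4)) : splitW (r₃ w) = conjIm (splitW w) :=
  Prod.ext (funext fun i => by fin_cases i <;> simp) (Complex.ext (by simp) (by simp))

/-- **The model intertwines `conj₂` and `r₃`**: `branchedDoubleModel (conj₂ v) = r₃ (branchedDoubleModel v)`.
[folklore] -/
theorem branchedDoubleModel_conj₂ (v : Fin 2 → ℂ) :
    branchedDoubleModel (conj₂ v) = r₃ (branchedDoubleModel v) := by
  apply splitW.injective
  rw [splitW_branchedDoubleModel, split_conj₂, sqModel_conjIm, splitW_r₃,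
    splitW_branchedDoubleModel]

end BranchedModel

/-! ### Model diffeomorphisms and the maximal atlas -/

section Atlas

variable {E : Type*} [NormedAddCommGroup E] [NormedSpace ℝ E] {M : Type*} [TopologicalSpace M]
  [ChartedSpace E M]

/-- **A continuous linear automorphism of the model space belongs to the `C^∞` groupoid.**
[folklore] -/
theorem clEquiv_mem_contDiffGroupoid (A : E ≃L[ℝ] E) :
    A.toHomeomorph.toOpenPartialHomeomorph ∈ contDiffGroupoid ∞ 𝓘(ℝ, E) := by
  rw [contDiffGroupoid, mem_groupoid_of_pregroupoid]
  simp only [contDiffPregroupoid, modelWithCornersSelf_coe, modelWithCornersSelf_coe_symm,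
    CompTriple.comp_eq, range_id, inter_univ, preimage_id_eq, id_eq,
    Homeomorph.toOpenPartialHomeomorph_source, Homeomorph.toOpenPartialHomeomorph_target]
  exact ⟨A.contDiff.contDiffOn, A.symm.contDiff.contDiffOn⟩

/-- **Post-composing a chart of the maximal atlas with a groupoid element stays in the maximal
atlas.** [folklore] -/
theorem trans_mem_maximalAtlas_of_mem_groupoid {H : Type*} [TopologicalSpace H]
    {N : Type*} [TopologicalSpace N] [ChartedSpace H N] (G : StructureGroupoid H)
    {e : OpenPartialHomeomorph N H} (he : e ∈ G.maximalAtlas N) {f : OpenPartialHomeomorph H H}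
    (hf : f ∈ G) : e.trans f ∈ G.maximalAtlas N := by
  intro e' he'
  refine ⟨?_, ?_⟩
  · rw [OpenPartialHomeomorph.trans_symm_eq_symm_trans_symm, OpenPartialHomeomorph.trans_assoc]
    exact G.trans (G.symm hf) (he e' he').1
  · rw [← OpenPartialHomeomorph.trans_assoc]
    exact G.trans (he e' he').2 hf

/-- A chart of the `C^∞` maximal atlas post-composed with a continuous linear automorphism of
the model is again in the maximal atlas. [folklore] -/
theorem trans_equiv_mem_maximalAtlas {e : OpenPartialHomeomorph M E}
    (he : e ∈ IsManifold.maximalAtlas 𝓘(ℝ, E) ∞ M) (A : E ≃L[ℝ] E) :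
    e.trans A.toHomeomorph.toOpenPartialHomeomorph ∈ IsManifold.maximalAtlas 𝓘(ℝ, E) ∞ M :=
  trans_mem_maximalAtlas_of_mem_groupoid _ he (clEquiv_mem_contDiffGroupoid A)

end Atlas

namespace ChartPair

variable {X : Type*} [TopologicalSpace X] [ChartedSpace (Fin 2 → ℂ) X]
  {Y₁ : Type*} [TopologicalSpace Y₁] [ChartedSpace (EuclideanSpace ℝ (Fin 4)) Y₁]
  {Y₂ : Type*} [TopologicalSpace Y₂] [ChartedSpace (EuclideanSpace ℝ (Fin 4)) Y₂]
  {σ : X → X} {q₁ : X → Y₁} {q₂ : X → Y₂}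

/-! ### Flipping a chart pair -/

/-- **The flipped chart pair**: `(φ₂, ψ₂)` replaced by `(conj₂ ∘ φ₂, r₃ ∘ ψ₂)`. Its mixed
transition is `conjIm ∘ θ`, so the orientation of the normal derivative is reversed.
[folklore] -/
def flip (c : ChartPair σ q₁ q₂) : ChartPair σ q₁ q₂ where
  φ₁ := c.φ₁
  ψ₁ := c.ψ₁
  φ₂ := c.φ₂.trans conj₂.toHomeomorph.toOpenPartialHomeomorph
  ψ₂ := c.ψ₂.trans r₃.toHomeomorph.toOpenPartialHomeomorph
  φ₁_mem := c.φ₁_mem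
  ψ₁_mem := c.ψ₁_mem
  φ₂_mem := trans_equiv_mem_maximalAtlas c.φ₂_mem conj₂
  ψ₂_mem := trans_equiv_mem_maximalAtlas c.ψ₂_mem r₃
  adapted₁ := c.adapted₁
  adapted₂ := fun y hy => by
    have hy' : y ∈ c.φ₂.source := by simpa [OpenPartialHomeomorph.trans_source] using hy
    obtain ⟨h1, h2, h3, h4⟩ := c.adapted₂ y hy'
    refine ⟨by simpa [OpenPartialHomeomorph.trans_source] using h1, ?_, ?_, ?_⟩
    · simp only [OpenPartialHomeomorph.coe_trans, Function.comp_apply,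
        Homeomorph.toOpenPartialHomeomorph_apply, ContinuousLinearEquiv.coe_toHomeomorph, h2,
        conj₂_star]
    · simpa [OpenPartialHomeomorph.trans_source] using h3
    · simp only [OpenPartialHomeomorph.coe_trans, Function.comp_apply,
        Homeomorph.toOpenPartialHomeomorph_apply, ContinuousLinearEquiv.coe_toHomeomorph, h4,
        branchedDoubleModel_conj₂]

/-- Flipping does not change `φ₁`. [folklore] -/
@[simp]
theorem flip_φ₁ (c : ChartPair σ q₁ q₂) : c.flip.φ₁ = c.φ₁ := rfl

/-- The flipped `φ₂` as a map. [folklore] -/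
@[simp]
theorem flip_φ₂_apply (c : ChartPair σ q₁ q₂) (y : X) : c.flip.φ₂ y = conj₂ (c.φ₂ y) := rfl

/-- Flipping does not change the source of `φ₂`. [folklore] -/
@[simp]
theorem flip_φ₂_source (c : ChartPair σ q₁ q₂) : c.flip.φ₂.source = c.φ₂.source := by
  simp [flip]

/-- Flipping does not change the common domain. [folklore] -/
@[simp]
theorem flip_dom (c : ChartPair σ q₁ q₂) : c.flip.dom = c.dom := by
  simp [dom]

/-- **The mixed transition of the flipped pair is `conjIm ∘ θ`** (as total functions).
[folklore] -/
theorem flip_θ_eq (c : ChartPair σ q₁ q₂) : (c.flip.θ : 𝕄 → 𝕄) = conjIm ∘ c.θ := by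
  funext x
  show split (conj₂ (c.φ₂ (c.φ₁.symm (split.symm x)))) =
    conjIm (split (c.φ₂ (c.φ₁.symm (split.symm x))))
  exact split_conj₂ _

/-- Flipping does not change the source of `θ`. [folklore] -/
@[simp]
theorem flip_θ_source (c : ChartPair σ q₁ q₂) : c.flip.θ.source = c.θ.source := by
  ext x
  rw [mem_θ_source, mem_θ_source, flip_φ₁, flip_φ₂_source]

/-- Flipping does not change the real locus. [folklore] -/
@[simp]
theorem flip_realSource (c : ChartPair σ q₁ q₂) : c.flip.realSource = c.realSource := by
  simp [realSource]

/-- **The normal derivative of the flipped pair is `conj ∘ L`.** [folklore] -/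
theorem flip_L (c : ChartPair σ q₁ q₂) (u : Fin 2 → ℝ) :
    c.flip.L u = (Complex.conjCLE : ℂ →L[ℝ] ℂ).comp (c.L u) := by
  rw [L, L, flip_θ_eq]
  have : fderiv ℝ ((conjIm : 𝕄 → 𝕄) ∘ c.θ) (u, 0) = (conjIm : 𝕄 →L[ℝ] 𝕄).comp (fderiv ℝ c.θ (u, 0)) :=
    conjIm.comp_fderiv
  rw [this, normalPart_conjIm_comp]

/-- Flipping swaps `|α|` and `|β|`: the conformal coefficient of the flipped pair has the norm of
the anticonformal coefficient of the pair. [folklore] -/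
theorem norm_conformalPart_flip_L (c : ChartPair σ q₁ q₂) (u : Fin 2 → ℝ) :
    ‖conformalPart (c.flip.L u)‖ = ‖anticonformalPart (c.L u)‖ := by
  rw [flip_L, conformalPart_conj_comp, Complex.norm_conj]

/-- Flipping swaps `|α|` and `|β|` (the other coefficient). [folklore] -/
theorem norm_anticonformalPart_flip_L (c : ChartPair σ q₁ q₂) (u : Fin 2 → ℝ) :
    ‖anticonformalPart (c.flip.L u)‖ = ‖conformalPart (c.L u)‖ := by
  rw [flip_L, anticonformalPart_conj_comp, Complex.norm_conj]

/-! ### Shrinking a chart pair above an open `flipIm`-invariant set -/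

/-- The set of points of `φ₁.source` read in an open set `U` of the split model. [folklore] -/
def shrinkSet (c : ChartPair σ q₁ q₂) (U : Set 𝕄) : Set X :=
  c.φ₁.source ∩ c.φ₁ ⁻¹' (split ⁻¹' U)

/-- `shrinkSet` is open for `U` open. [folklore] -/
theorem isOpen_shrinkSet (c : ChartPair σ q₁ q₂) {U : Set 𝕄} (hU : IsOpen U) :
    IsOpen (c.shrinkSet U) :=
  c.φ₁.isOpen_inter_preimage (hU.preimage split.continuous)

/-- **The shrunk chart pair**: `φ₁` restricted to the points read in the open `flipIm`-invariant
set `U`. [folklore] -/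
def shrink (c : ChartPair σ q₁ q₂) (U : Set 𝕄) (hU : IsOpen U)
    (hUi : ∀ x ∈ U, flipIm x ∈ U) : ChartPair σ q₁ q₂ where
  φ₁ := c.φ₁.restr (c.shrinkSet U)
  ψ₁ := c.ψ₁
  φ₂ := c.φ₂
  ψ₂ := c.ψ₂
  φ₁_mem := restr_mem_maximalAtlas _ c.φ₁_mem (c.isOpen_shrinkSet hU)
  ψ₁_mem := c.ψ₁_mem
  φ₂_mem := c.φ₂_mem
  ψ₂_mem := c.ψ₂_mem
  adapted₁ := fun y hy => by
    rw [c.φ₁.restr_source' _ (c.isOpen_shrinkSet hU)] at hy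
    obtain ⟨h1, h2, h3, h4⟩ := c.adapted₁ y hy.1
    refine ⟨?_, by simpa using h2, h3, by simpa using h4⟩
    rw [c.φ₁.restr_source' _ (c.isOpen_shrinkSet hU)]
    refine ⟨h1, h1, ?_⟩
    have hyU : split (c.φ₁ y) ∈ U := hy.2.2
    show split (c.φ₁ (σ y)) ∈ U
    rw [h2, split_star]
    exact hUi _ hyU
  adapted₂ := c.adapted₂

/-- The mixed transition of the shrunk pair is the same map. [folklore] -/
theorem shrink_θ_eq (c : ChartPair σ q₁ q₂) (U : Set 𝕄) (hU : IsOpen U)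
    (hUi : ∀ x ∈ U, flipIm x ∈ U) : ((c.shrink U hU hUi).θ : 𝕄 → 𝕄) = c.θ := by
  funext x
  simp [θ_apply, shrink]

/-- The normal derivative of the shrunk pair is the same map. [folklore] -/
theorem shrink_L (c : ChartPair σ q₁ q₂) (U : Set 𝕄) (hU : IsOpen U)
    (hUi : ∀ x ∈ U, flipIm x ∈ U) (u : Fin 2 → ℝ) : (c.shrink U hU hUi).L u = c.L u := by
  rw [L, L, shrink_θ_eq]

/-- **Real points of the source of the shrunk transition are read in `U`.** [folklore] -/
theorem mem_of_mem_shrink_θ_source (c : ChartPair σ q₁ q₂) (U : Set 𝕄) (hU : IsOpen U)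
    (hUi : ∀ x ∈ U, flipIm x ∈ U) {x : 𝕄} (hx : x ∈ (c.shrink U hU hUi).θ.source) : x ∈ U := by
  rw [mem_θ_source] at hx
  obtain ⟨h1, -⟩ := hx
  change split.symm x ∈ (c.φ₁.restr (c.shrinkSet U)).target at h1
  rw [OpenPartialHomeomorph.restr_target, (c.isOpen_shrinkSet hU).interior_eq] at h1
  obtain ⟨h2, h3⟩ := h1
  have h4 : split (c.φ₁ (c.φ₁.symm (split.symm x))) ∈ U := h3.2
  rwa [c.φ₁.right_inv h2, ContinuousLinearEquiv.apply_symm_apply] at h4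

/-- The source of `φ₁` of the shrunk pair. [folklore] -/
theorem shrink_φ₁_source (c : ChartPair σ q₁ q₂) (U : Set 𝕄) (hU : IsOpen U)
    (hUi : ∀ x ∈ U, flipIm x ∈ U) : (c.shrink U hU hUi).φ₁.source = c.shrinkSet U := by
  rw [show (c.shrink U hU hUi).φ₁ = c.φ₁.restr (c.shrinkSet U) from rfl,
    c.φ₁.restr_source' _ (c.isOpen_shrinkSet hU)]
  exact inter_eq_right.2 inter_subset_left

/-! ### Existence of positive chart pairs -/

/-- **Every fixed point of `σ` lies in the common domain of a positive chart pair.**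
[folklore] -/
theorem exists_isPos (h₁ : IsBranchedDoubleQuotient σ q₁) (h₂ : IsBranchedDoubleQuotient σ q₂)
    {x : X} (hx : σ x = x) : ∃ c : ChartPair σ q₁ q₂, c.IsPos ∧ x ∈ c.dom := by
  obtain ⟨c₀, hx₀⟩ := exists_mem_dom h₁ h₂ hx
  -- Step 1: a pair which is positive at the base point
  obtain ⟨c₁, hx₁, hpos₁⟩ : ∃ c₁ : ChartPair σ q₁ q₂, x ∈ c₁.dom ∧
      ‖anticonformalPart (c₁.L (split (c₁.φ₁ x)).1)‖ < ‖conformalPart (c₁.L (split (c₁.φ₁ x)).1)‖ := by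
    have h0 : (split (c₀.φ₁ x)).2 = 0 := c₀.snd_split_φ₁_eq_zero hx₀ hx
    have hreal : (split (c₀.φ₁ x)).1 ∈ c₀.realSource := by
      show ((split (c₀.φ₁ x)).1, (0 : ℂ)) ∈ c₀.θ.source
      rw [← eq_real_of_snd_eq_zero h0]
      exact c₀.split_mem_θ_source hx₀
    have hne := norm_conformalPart_ne_of_injective (c₀.injective_L hreal)
    rcases hne.lt_or_gt with hlt | hlt
    · -- negative at the base point: flip
      refine ⟨c₀.flip, (by rw [flip_dom]; exact hx₀), ?_⟩
      rw [flip_φ₁, norm_conformalPart_flip_L, norm_anticonformalPart_flip_L]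
      exact hlt
    · exact ⟨c₀, hx₀, hlt⟩
  -- Step 2: shrink to the positivity set
  set P : Set (Fin 2 → ℝ) := {u | u ∈ c₁.realSource ∧
    ‖anticonformalPart (c₁.L u)‖ < ‖conformalPart (c₁.L u)‖} with hP
  have hPopen : IsOpen P := by
    have hc : ContinuousOn (fun u => (‖anticonformalPart (c₁.L u)‖, ‖conformalPart (c₁.L u)‖))
        c₁.realSource := by
      refine ContinuousOn.prodMk ?_ ?_
      · exact (contDiff_anticonformalPart.continuous.comp_continuousOn
          c₁.contDiffOn_L.continuousOn).norm
      · exact (contDiff_conformalPart.continuous.comp_continuousOn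
          c₁.contDiffOn_L.continuousOn).norm
    have := hc.isOpen_inter_preimage c₁.isOpen_realSource (isOpen_lt continuous_fst continuous_snd)
    have hPeq : P = c₁.realSource ∩ (fun u => (‖anticonformalPart (c₁.L u)‖,
        ‖conformalPart (c₁.L u)‖)) ⁻¹' {b | b.1 < b.2} := Set.ext fun u => Iff.rfl
    rw [hPeq]
    exact this
  set U : Set 𝕄 := {y | y.1 ∈ P} with hU
  have hUopen : IsOpen U := hPopen.preimage continuous_fst
  have hUi : ∀ y ∈ U, flipIm y ∈ U := fun y hy => by simpa [hU] using hy
  refine ⟨c₁.shrink U hUopen hUi, ?_, ?_⟩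
  · -- positivity everywhere on the shrunk pair
    intro u hu
    rw [shrink_L]
    have hmem := c₁.mem_of_mem_shrink_θ_source U hUopen hUi hu
    exact hmem.2
  · -- the base point survives
    have h0 : (split (c₁.φ₁ x)).2 = 0 := c₁.snd_split_φ₁_eq_zero hx₁ hx
    have hreal : (split (c₁.φ₁ x)).1 ∈ c₁.realSource := by
      show ((split (c₁.φ₁ x)).1, (0 : ℂ)) ∈ c₁.θ.source
      rw [← eq_real_of_snd_eq_zero h0]
      exact c₁.split_mem_θ_source hx₁
    refine ⟨?_, hx₁.2⟩
    rw [shrink_φ₁_source]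
    exact ⟨hx₁.1, ⟨hreal, hpos₁⟩⟩

end ChartPair

end Literature.Topology.FourManifolds

end


/-!
# Transitions between chart pairs: the local solutions are compatible to first order

Topic `Topology/FourManifolds`; namespace `Literature.Topology.FourManifolds`. Fifth file of the
proof of `Literature.Topology.FourManifolds.DegtyarevKharlamov2000_conjQuotient_unique`
(`ConjugationQuotients.lean`). Everything is proved; no named facts.

For the averaging of the local solutions `b.floc` of finitely many positive chart pairs `b`
(`ConjugationQuotientsChartPairs.lean`) we read everything in ONE pair `k` near a branch point.
This file supplies the first-order data of the maps so read:

* **Adapted transitions.** For two adapted charts `(φ, ψ)`, `(φ', ψ')` of the SAME branched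
  double quotient, the upstairs transition `xTrans φ φ' = split ∘ φ' ∘ φ⁻¹ ∘ split⁻¹` is smooth
  and `flipIm`-equivariant and the downstairs transition `yTrans ψ ψ' = splitW ∘ ψ' ∘ ψ⁻¹ ∘ splitW⁻¹`
  is smooth and DESCENDS it (`yTrans_sqModel`); hence (`BranchedModelCalculus.sq_normalDeriv_eq`)
  at a real point the normal derivative `τ` of `xTrans` is conformal or anticonformal and the
  normal block of `D(yTrans)` is `hatOf τ = α² + β² conj` (`normalPart_fderiv_yTrans`).
* **Chain rule for the normal derivatives.** On the overlap of two pairs `b`, `k`,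
  `k.θ = xTrans b.φ₂ k.φ₂ ∘ b.θ ∘ xTrans k.φ₁ b.φ₁`, whence `k.L u = τ₂ ∘ b.L u_b ∘ τ₁`
  (`ChartPair.L_eq_comp`).
* **The local solution of `b` read in `k`**, `crossLoc b k = yTrans b.ψ₂ k.ψ₂ ∘ b.Θloc ∘ yTrans k.ψ₁ b.ψ₁`
  (`ChartPair.crossLoc`), is differentiable at the branch point with normal block
  `hatOf τ₂ ∘ Ô_b ∘ hatOf τ₁ = λ • Ô_k`, **`λ > 0`** (`ChartPair.normalPart_fderiv_crossLoc`;
  the algebra is `BranchedModel.hat_comp_polarSq_comp_hat`), and restricts to `(γ_k, 0)` on the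
  real locus (`ChartPair.crossLoc_real`).
* **The comparison map read in `k`** has derivative `polarDeriv k.θ (u, s, e)` at
  `sqModel (u, s e)`, `s ≠ 0` (`ChartPair.hasFDerivAt_Θh`; from `BranchedModelPolar.lean`).

## References

* A. Degtyarev, V. Kharlamov, Russian Math. Surveys 55 (2000), arXiv:math/0004134, §3.2 ¶1.
  [DegtyarevKharlamov2000]
-/

noncomputable section

open scoped Manifold ContDiff Topology ComplexConjugate
open Set Function Filter
open Literature.Topology.FourManifolds.BranchedModel

namespace Literature.Topology.FourManifolds

/-- Local notation: `𝕄` is the split model space `(Fin 2 → ℝ) × ℂ`. -/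
local notation "𝕄" => (Fin 2 → ℝ) × ℂ

/-! ### Algebra: hats, coefficients of compositions, and the compatibility of polar squares -/

namespace BranchedModel

/-- **The hat** `w ↦ α² w + β² w̄` of a real-linear `τ : ℂ → ℂ`, `τ b = α b + β b̄`: for `τ`
conformal or anticonformal (`α β = 0`) it is the linear map `w ↦ (τ √w)²`, the normal block of the
derivative of a descended transition (`sq_normalDeriv_apply`). [folklore] -/
def hatOf (τ : ℂ →L[ℝ] ℂ) : ℂ →L[ℝ] ℂ :=
  conformalPart τ ^ 2 • ContinuousLinearMap.id ℝ ℂ +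
    anticonformalPart τ ^ 2 • (Complex.conjCLE : ℂ →L[ℝ] ℂ)

/-- Unfolding lemma for `hatOf`. [folklore] -/
@[simp]
theorem hatOf_apply (τ : ℂ →L[ℝ] ℂ) (w : ℂ) :
    hatOf τ w = conformalPart τ ^ 2 * w + anticonformalPart τ ^ 2 * conj w := by
  simp [hatOf, smul_eq_mul]

/-- Uniqueness of the representation `b ↦ a b + c b̄`. [folklore] -/
theorem eq_of_forall_mul_add_mul_conj {a c a' c' : ℂ}
    (h : ∀ b : ℂ, a * b + c * conj b = a' * b + c' * conj b) : a = a' ∧ c = c' := by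
  have h1 := h 1
  have hI := h Complex.I
  simp only [map_one, mul_one, Complex.conj_I] at h1 hI
  have h2 : a - c = a' - c' :=
    mul_left_cancel₀ Complex.I_ne_zero (by linear_combination hI)
  constructor
  · linear_combination (h1 + h2) / 2
  · linear_combination (h1 - h2) / 2

/-- The coefficients of a real-linear map are determined by its values. [folklore] -/
theorem conformalPart_eq_of_forall {L : ℂ →L[ℝ] ℂ} {a c : ℂ}
    (h : ∀ b : ℂ, L b = a * b + c * conj b) : conformalPart L = a ∧ anticonformalPart L = c := by
  refine eq_of_forall_mul_add_mul_conj fun b => ?_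
  rw [← apply_eq_conformalPart_add, h]

/-- **Coefficients of `τ ∘ L` for conformal `τ`** (`τ b = c b`). [folklore] -/
theorem parts_comp_left_of_conformal {τ L : ℂ →L[ℝ] ℂ} (hτ : anticonformalPart τ = 0) :
    conformalPart (τ.comp L) = conformalPart τ * conformalPart L ∧
      anticonformalPart (τ.comp L) = conformalPart τ * anticonformalPart L := by
  refine conformalPart_eq_of_forall fun b => ?_
  rw [ContinuousLinearMap.coe_comp, Function.comp_apply, apply_eq_conformalPart_add τ, hτ,
    apply_eq_conformalPart_add L]
  ring

/-- **Coefficients of `L ∘ τ` for conformal `τ`.** [folklore] -/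
theorem parts_comp_right_of_conformal {τ L : ℂ →L[ℝ] ℂ} (hτ : anticonformalPart τ = 0) :
    conformalPart (L.comp τ) = conformalPart L * conformalPart τ ∧
      anticonformalPart (L.comp τ) = anticonformalPart L * conj (conformalPart τ) := by
  refine conformalPart_eq_of_forall fun b => ?_
  rw [ContinuousLinearMap.coe_comp, Function.comp_apply, apply_eq_conformalPart_add τ, hτ,
    apply_eq_conformalPart_add L]
  simp only [zero_mul, add_zero, map_mul]
  ring

/-- **Coefficients of `τ ∘ L` for anticonformal `τ`** (`τ b = c b̄`). [folklore] -/
theorem parts_comp_left_of_anticonformal {τ L : ℂ →L[ℝ] ℂ} (hτ : conformalPart τ = 0) :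
    conformalPart (τ.comp L) = anticonformalPart τ * conj (anticonformalPart L) ∧
      anticonformalPart (τ.comp L) = anticonformalPart τ * conj (conformalPart L) := by
  refine conformalPart_eq_of_forall fun b => ?_
  rw [ContinuousLinearMap.coe_comp, Function.comp_apply, apply_eq_conformalPart_add τ, hτ,
    apply_eq_conformalPart_add L]
  simp only [zero_mul, zero_add, map_add, map_mul, Complex.conj_conj]
  ring

/-- **Coefficients of `L ∘ τ` for anticonformal `τ`.** [folklore] -/
theorem parts_comp_right_of_anticonformal {τ L : ℂ →L[ℝ] ℂ} (hτ : conformalPart τ = 0) :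
    conformalPart (L.comp τ) = anticonformalPart L * conj (anticonformalPart τ) ∧
      anticonformalPart (L.comp τ) = conformalPart L * anticonformalPart τ := by
  refine conformalPart_eq_of_forall fun b => ?_
  rw [ContinuousLinearMap.coe_comp, Function.comp_apply, apply_eq_conformalPart_add τ, hτ,
    apply_eq_conformalPart_add L]
  simp only [zero_mul, zero_add, map_mul, Complex.conj_conj]
  ring

/-- A nonzero real-linear map has a nonzero coefficient. [folklore] -/
theorem ne_zero_of_parts {τ : ℂ →L[ℝ] ℂ} (hτ : τ ≠ 0) (hc : conformalPart τ = 0) :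
    anticonformalPart τ ≠ 0 := by
  intro ha
  apply hτ
  ext b
  rw [apply_eq_conformalPart_add τ b, hc, ha]
  simp

/-- A nonzero real-linear map has a nonzero coefficient (other order). [folklore] -/
theorem ne_zero_of_parts' {τ : ℂ →L[ℝ] ℂ} (hτ : τ ≠ 0) (ha : anticonformalPart τ = 0) :
    conformalPart τ ≠ 0 := by
  intro hc
  exact ne_zero_of_parts hτ hc ha

/-- The **unit square** `(z/‖z‖)²`. [folklore] -/
def unitSq (z : ℂ) : ℂ :=
  (z / (‖z‖ : ℂ)) ^ 2

/-- `unitSq` of a product. [folklore] -/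
theorem unitSq_mul (a b : ℂ) : unitSq (a * b) = unitSq a * unitSq b := by
  unfold unitSq
  rw [norm_mul]
  push_cast
  ring

/-- `unitSq` of a conjugate. [folklore] -/
theorem unitSq_conj (a : ℂ) : unitSq (conj a) = conj (unitSq a) := by
  unfold unitSq
  rw [Complex.norm_conj, map_pow, map_div₀, Complex.conj_ofReal]

/-- `unitSq a · ‖a‖² = a²`. [folklore] -/
theorem unitSq_mul_norm_sq (a : ℂ) : unitSq a * (‖a‖ : ℂ) ^ 2 = a ^ 2 := by
  unfold unitSq
  by_cases ha : a = 0
  · simp [ha]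
  · have : (‖a‖ : ℂ) ≠ 0 := by exact_mod_cast norm_ne_zero_iff.2 ha
    field_simp

/-- `polarSq` of a positive map is multiplication by `unitSq α`. [folklore] -/
theorem polarSq_apply_of_lt' {L : ℂ →L[ℝ] ℂ} (h : ‖anticonformalPart L‖ < ‖conformalPart L‖)
    (w : ℂ) : polarSq L w = unitSq (conformalPart L) * w :=
  polarSq_apply_of_lt h w

/-- **Compatibility of the polar squares of two positive pairs.** Let `L` be positive
(`|β| < |α|`), `τ₁`, `τ₂` nonzero and each conformal or anticonformal, and suppose
`L' = τ₂ ∘ L ∘ τ₁` is positive too. Then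
`hatOf τ₂ ∘ polarSq L ∘ hatOf τ₁ = λ • polarSq L'` with `λ = (|α₁|² + |β₁|²)(|α₂|² + |β₂|²)`
(the mixed conformal/anticonformal cases contradict the positivity of `L'`). [folklore] -/
theorem hat_comp_polarSq_comp_hat {L τ₁ τ₂ : ℂ →L[ℝ] ℂ}
    (hL : ‖anticonformalPart L‖ < ‖conformalPart L‖)
    (h₁ : conformalPart τ₁ * anticonformalPart τ₁ = 0) (h₁0 : τ₁ ≠ 0)
    (h₂ : conformalPart τ₂ * anticonformalPart τ₂ = 0) (h₂0 : τ₂ ≠ 0)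
    (hL' : ‖anticonformalPart (τ₂.comp (L.comp τ₁))‖ < ‖conformalPart (τ₂.comp (L.comp τ₁))‖)
    (w : ℂ) :
    hatOf τ₂ (polarSq L (hatOf τ₁ w)) =
      (((‖conformalPart τ₁‖ ^ 2 + ‖anticonformalPart τ₁‖ ^ 2) *
        (‖conformalPart τ₂‖ ^ 2 + ‖anticonformalPart τ₂‖ ^ 2) : ℝ) : ℂ) *
        polarSq (τ₂.comp (L.comp τ₁)) w := by
  set α := conformalPart L with hα
  set β := anticonformalPart L with hβ
  rcases mul_eq_zero.1 h₁ with hc₁ | ha₁ <;> rcases mul_eq_zero.1 h₂ with hc₂ | ha₂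
  · -- τ₁ anticonformal, τ₂ anticonformal
    have hb₁ := ne_zero_of_parts h₁0 hc₁
    have hb₂ := ne_zero_of_parts h₂0 hc₂
    obtain ⟨e1, e2⟩ := parts_comp_right_of_anticonformal (L := L) hc₁
    obtain ⟨e3, e4⟩ := parts_comp_left_of_anticonformal (L := L.comp τ₁) hc₂
    rw [e2] at e3
    simp only [map_mul] at e3
    rw [polarSq_apply_of_lt' hL', e3, hatOf_apply, hatOf_apply, polarSq_apply_of_lt' hL, hc₁, hc₂,
      unitSq_mul, unitSq_mul, unitSq_conj, unitSq_conj, ← hα]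
    simp only [zero_pow two_ne_zero, zero_mul, zero_add, map_mul, Complex.conj_conj, norm_zero,
      map_pow]
    push_cast
    have k2 := unitSq_mul_norm_sq (anticonformalPart τ₂)
    have k1' : conj (unitSq (anticonformalPart τ₁)) * (‖anticonformalPart τ₁‖ : ℂ) ^ 2 =
        conj (anticonformalPart τ₁) ^ 2 := by
      rw [← unitSq_conj, ← Complex.norm_conj]
      exact unitSq_mul_norm_sq _
    linear_combination (-(conj (unitSq α) * w * conj (anticonformalPart τ₁) ^ 2)) * k2 +
      (-(conj (unitSq α) * w * unitSq (anticonformalPart τ₂) *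
        (‖anticonformalPart τ₂‖ : ℂ) ^ 2)) * k1'
  · -- τ₁ anticonformal, τ₂ conformal: `L'` would be negative
    exfalso
    have hb₁ := ne_zero_of_parts h₁0 hc₁
    have hc₂' := ne_zero_of_parts' h₂0 ha₂
    obtain ⟨e1, e2⟩ := parts_comp_right_of_anticonformal (L := L) hc₁
    obtain ⟨e3, e4⟩ := parts_comp_left_of_conformal (L := L.comp τ₁) ha₂
    rw [e1] at e3
    rw [e2] at e4
    rw [e3, e4] at hL'
    simp only [norm_mul, Complex.norm_conj] at hL'
    have hpos : 0 < ‖conformalPart τ₂‖ * ‖anticonformalPart τ₁‖ := by positivity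
    nlinarith [mul_pos hpos (sub_pos.2 hL), norm_nonneg α, norm_nonneg β]
  · -- τ₁ conformal, τ₂ anticonformal: `L'` would be negative
    exfalso
    have hb₂ := ne_zero_of_parts h₂0 hc₂
    have hc₁' := ne_zero_of_parts' h₁0 ha₁
    obtain ⟨e1, e2⟩ := parts_comp_right_of_conformal (L := L) ha₁
    obtain ⟨e3, e4⟩ := parts_comp_left_of_anticonformal (L := L.comp τ₁) hc₂
    rw [e2] at e3
    rw [e1] at e4
    simp only [map_mul] at e3 e4
    rw [e3, e4] at hL'
    simp only [norm_mul, Complex.norm_conj] at hL'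
    have hpos : 0 < ‖anticonformalPart τ₂‖ * ‖conformalPart τ₁‖ := by positivity
    nlinarith [mul_pos hpos (sub_pos.2 hL), norm_nonneg α, norm_nonneg β]
  · -- τ₁ conformal, τ₂ conformal
    have hc₁' := ne_zero_of_parts' h₁0 ha₁
    have hc₂' := ne_zero_of_parts' h₂0 ha₂
    obtain ⟨e1, e2⟩ := parts_comp_right_of_conformal (L := L) ha₁
    obtain ⟨e3, e4⟩ := parts_comp_left_of_conformal (L := L.comp τ₁) ha₂
    rw [e1] at e3
    rw [polarSq_apply_of_lt' hL', e3, hatOf_apply, hatOf_apply, polarSq_apply_of_lt' hL, ha₁, ha₂,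
      unitSq_mul, unitSq_mul, ← hα]
    simp only [zero_pow two_ne_zero, zero_mul, add_zero, norm_zero]
    push_cast
    have k1 := unitSq_mul_norm_sq (conformalPart τ₁)
    have k2 := unitSq_mul_norm_sq (conformalPart τ₂)
    linear_combination (-(unitSq α * w * conformalPart τ₂ ^ 2)) * k1 +
      (-(unitSq α * w * unitSq (conformalPart τ₁) * (‖conformalPart τ₁‖ : ℂ) ^ 2)) * k2

/-- The scalar of `hat_comp_polarSq_comp_hat` is positive. [folklore] -/
theorem hat_scalar_pos {τ₁ τ₂ : ℂ →L[ℝ] ℂ} (h₁0 : τ₁ ≠ 0) (h₂0 : τ₂ ≠ 0) :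
    0 < (‖conformalPart τ₁‖ ^ 2 + ‖anticonformalPart τ₁‖ ^ 2) *
      (‖conformalPart τ₂‖ ^ 2 + ‖anticonformalPart τ₂‖ ^ 2) := by
  have key : ∀ {τ : ℂ →L[ℝ] ℂ}, τ ≠ 0 → 0 < ‖conformalPart τ‖ ^ 2 + ‖anticonformalPart τ‖ ^ 2 := by
    intro τ hτ
    by_cases hc : conformalPart τ = 0
    · have := ne_zero_of_parts hτ hc
      have : 0 < ‖anticonformalPart τ‖ := norm_pos_iff.2 this
      positivity
    · have : 0 < ‖conformalPart τ‖ := norm_pos_iff.2 hc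
      positivity
  exact mul_pos (key h₁0) (key h₂0)

end BranchedModel

/-! ### Self pairs: two adapted charts of the same quotient -/

namespace ChartPair

variable {X : Type*} [TopologicalSpace X] [ChartedSpace (Fin 2 → ℂ) X]
  {Y₁ : Type*} [TopologicalSpace Y₁] [ChartedSpace (EuclideanSpace ℝ (Fin 4)) Y₁]
  {Y₂ : Type*} [TopologicalSpace Y₂] [ChartedSpace (EuclideanSpace ℝ (Fin 4)) Y₂]
  {σ : X → X} {q₁ : X → Y₁} {q₂ : X → Y₂}

/-- **The self pair of the `q₁`-charts of two chart pairs** `k`, `b`: the chart pair of the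
quotient `q₁` with ITSELF made of `(k.φ₁, k.ψ₁)` and `(b.φ₁, b.ψ₁)`. Its mixed transition is the
upstairs transition `split ∘ b.φ₁ ∘ k.φ₁⁻¹ ∘ split⁻¹` of the first branched structure and its
comparison map read in the pair is the downstairs transition `splitW ∘ b.ψ₁ ∘ k.ψ₁⁻¹ ∘ splitW⁻¹`
(`pairWith₁_Θh_apply`), which is smooth everywhere. [folklore] -/
def pairWith₁ (k b : ChartPair σ q₁ q₂) : ChartPair σ q₁ q₁ where
  φ₁ := k.φ₁
  ψ₁ := k.ψ₁
  φ₂ := b.φ₁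
  ψ₂ := b.ψ₁
  φ₁_mem := k.φ₁_mem
  ψ₁_mem := k.ψ₁_mem
  φ₂_mem := b.φ₁_mem
  ψ₂_mem := b.ψ₁_mem
  adapted₁ := k.adapted₁
  adapted₂ := b.adapted₁

/-- **The self pair of the `q₂`-charts of two chart pairs** `b`, `k` (from `b` to `k`).
[folklore] -/
def pairWith₂ (b k : ChartPair σ q₁ q₂) : ChartPair σ q₂ q₂ where
  φ₁ := b.φ₂
  ψ₁ := b.ψ₂
  φ₂ := k.φ₂
  ψ₂ := k.ψ₂
  φ₁_mem := b.φ₂_mem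
  ψ₁_mem := b.ψ₂_mem
  φ₂_mem := k.φ₂_mem
  ψ₂_mem := k.ψ₂_mem
  adapted₁ := b.adapted₂
  adapted₂ := k.adapted₂

/-- The comparison map of a quotient with itself is the identity. [folklore] -/
theorem _root_.Literature.Topology.FourManifolds.IsBranchedDoubleQuotient.comparison_self
    {Y : Type*} [TopologicalSpace Y] [ChartedSpace (EuclideanSpace ℝ (Fin 4)) Y] {q : X → Y}
    (h : IsBranchedDoubleQuotient σ q) (y : Y) : IsBranchedDoubleQuotient.comparison h h y = y := by
  obtain ⟨x, rfl⟩ := h.surjective y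
  exact IsBranchedDoubleQuotient.comparison_apply h h x

section Self

variable {Y : Type*} [TopologicalSpace Y] [ChartedSpace (EuclideanSpace ℝ (Fin 4)) Y] {q : X → Y}

/-- **For a self pair the comparison map read in the pair is the downstairs transition**
`splitW ∘ ψ₂ ∘ ψ₁⁻¹ ∘ splitW⁻¹`. [folklore] -/
theorem Θh_self_apply (P : ChartPair σ q q) (h : IsBranchedDoubleQuotient σ q) (w : 𝕄) :
    P.Θh h h w = splitW (P.ψ₂ (P.ψ₁.symm (splitW.symm w))) := by
  rw [Θh, IsBranchedDoubleQuotient.comparison_self]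

/-- **The downstairs transition of a self pair is `C^∞` at every chart point** (both charts lie
in the `C^∞` maximal atlas of `Y`), in particular ACROSS the branch locus. [folklore] -/
theorem contDiffAt_Θh_self (P : ChartPair σ q q) (h : IsBranchedDoubleQuotient σ q) {y : Y}
    (hy₁ : y ∈ P.ψ₁.source) (hy₂ : y ∈ P.ψ₂.source) :
    ContDiffAt ℝ ∞ (P.Θh h h) (splitW (P.ψ₁ y)) := by
  have hc := ((contDiffGroupoid ∞ (𝓡 4)).compatible_of_mem_maximalAtlas P.ψ₁_mem P.ψ₂_mem).1
  simp only [contDiffPregroupoid, modelWithCornersSelf_coe, modelWithCornersSelf_coe_symm,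
    CompTriple.comp_eq, range_id, inter_univ, preimage_id_eq, id_eq] at hc
  have hsrc : P.ψ₁ y ∈ (P.ψ₁.symm.trans P.ψ₂).source := by
    simp only [OpenPartialHomeomorph.trans_source, OpenPartialHomeomorph.symm_source,
      mem_inter_iff, mem_preimage]
    exact ⟨P.ψ₁.map_source hy₁, by rwa [P.ψ₁.left_inv hy₁]⟩
  have h1 : ContDiffAt ℝ ∞ (P.ψ₂ ∘ P.ψ₁.symm) (P.ψ₁ y) :=
    (hc _ hsrc).contDiffAt ((P.ψ₁.symm.trans P.ψ₂).open_source.mem_nhds hsrc)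
  have h2 : ContDiffAt ℝ ∞ (P.ψ₂ ∘ P.ψ₁.symm) (splitW.symm (splitW (P.ψ₁ y))) := by
    rwa [ContinuousLinearEquiv.symm_apply_apply]
  have h3 := splitW.contDiff.contDiffAt.comp _ (h2.comp _ splitW.symm.contDiff.contDiffAt)
  refine h3.congr_of_eventuallyEq (Eventually.of_forall fun w => ?_)
  simp [Θh_self_apply, Function.comp_apply]

/-- The downstairs transition of a self pair is `C^∞` at the image of every source point of its
upstairs transition (in particular at real points). [folklore] -/
theorem contDiffAt_Θh_self_sqModel (P : ChartPair σ q q) (h : IsBranchedDoubleQuotient σ q)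
    {x : 𝕄} (hx : x ∈ P.θ.source) : ContDiffAt ℝ ∞ (P.Θh h h) (sqModel x) := by
  set y := P.φ₁.symm (split.symm x) with hy
  have hyd : y ∈ P.dom := P.symm_mem_dom hx
  have hx' : x = split (P.φ₁ y) := (P.split_φ₁_symm hx).symm
  rw [hx', P.sqModel_split_φ₁ hyd.1]
  exact P.contDiffAt_Θh_self h (P.adapted₁ y hyd.1).2.2.1 (P.adapted₂ y hyd.2).2.2.1

/-- The downstairs transition of a self pair is differentiable at real points. [folklore] -/
theorem hasFDerivAt_Θh_self (P : ChartPair σ q q) (h : IsBranchedDoubleQuotient σ q)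
    {u : Fin 2 → ℝ} (hu : u ∈ P.realSource) :
    HasFDerivAt (P.Θh h h) (fderiv ℝ (P.Θh h h) (u, 0)) (u, 0) := by
  have := P.contDiffAt_Θh_self_sqModel h hu
  rw [sqModel_of_snd_eq_zero rfl] at this
  exact (this.differentiableAt (by simp)).hasFDerivAt

/-- **The normal derivative of a self pair is conformal or anticonformal** (`α β = 0`): the
downstairs transition is a SMOOTH descent of the upstairs one. [folklore] -/
theorem conformalPart_mul_anticonformalPart_L_self (P : ChartPair σ q q)
    (h : IsBranchedDoubleQuotient σ q) {u : Fin 2 → ℝ} (hu : u ∈ P.realSource) :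
    conformalPart (P.L u) * anticonformalPart (P.L u) = 0 :=
  conformalPart_mul_anticonformalPart_eq_zero (K := normalPart (fderiv ℝ (P.Θh h h) (u, 0)))
    fun b => sq_normalDeriv_eq (P.hasFDerivAt_θ hu) (P.θ_snd_eq_zero hu)
      (P.hasFDerivAt_Θh_self h hu) (P.eventually_Θh_sqModel h h hu) b

/-- **The normal block of the derivative of the downstairs transition of a self pair is the hat
of its normal derivative**: `normalPart (D Θh (u, 0)) = hatOf (L u)`. [folklore] -/
theorem normalPart_fderiv_Θh_self (P : ChartPair σ q q) (h : IsBranchedDoubleQuotient σ q)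
    {u : Fin 2 → ℝ} (hu : u ∈ P.realSource) :
    normalPart (fderiv ℝ (P.Θh h h) (u, 0)) = hatOf (P.L u) := by
  ext w
  rw [hatOf_apply]
  exact sq_normalDeriv_apply (fun b => sq_normalDeriv_eq (P.hasFDerivAt_θ hu) (P.θ_snd_eq_zero hu)
    (P.hasFDerivAt_Θh_self h hu) (P.eventually_Θh_sqModel h h hu) b) w

/-- The downstairs transition of a self pair preserves the real locus:
`Θh (u', 0) = (γ u', 0)` on the real locus. [folklore] -/
theorem Θh_self_real (P : ChartPair σ q q) (h : IsBranchedDoubleQuotient σ q)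
    {u : Fin 2 → ℝ} (hu : u ∈ P.realSource) : P.Θh h h (u, 0) = (P.γ u, 0) := by
  have := P.Θh_sqModel h h hu
  rw [sqModel_of_snd_eq_zero rfl, P.θ_real hu] at this
  rw [this]
  simp [sqModel]

/-- The derivative of the downstairs transition of a self pair at a real point kills the
normal component of real vectors. [folklore] -/
theorem snd_fderiv_Θh_self_inl (P : ChartPair σ q q) (h : IsBranchedDoubleQuotient σ q)
    {u : Fin 2 → ℝ} (hu : u ∈ P.realSource) (a : Fin 2 → ℝ) :
    (fderiv ℝ (P.Θh h h) (u, 0) (a, 0)).2 = 0 := by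
  have hev : ∀ᶠ u' in 𝓝 u, u' ∈ P.realSource := P.isOpen_realSource.mem_nhds hu
  refine fderiv_inl_eq_zero_of_eventually_const (c := (0 : ℂ)) (P.hasFDerivAt_Θh_self h hu).snd
    ?_ a
  filter_upwards [hev] with u' hu'
  rw [P.Θh_self_real h hu']

/-- The normal derivative of a self pair is nonzero. [folklore] -/
theorem L_self_ne_zero (P : ChartPair σ q q) {u : Fin 2 → ℝ} (hu : u ∈ P.realSource) :
    P.L u ≠ 0 := by
  intro h0
  have := P.injective_L hu (a₁ := 1) (a₂ := 0) (by rw [h0]; simp)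
  exact one_ne_zero this

end Self

/-! ### Blocks of compositions -/

omit [TopologicalSpace X] [ChartedSpace (Fin 2 → ℂ) X] in
/-- **Normal part of a composition**: if `A` kills the normal component of real vectors then
`normalPart (A ∘ B) = normalPart A ∘ normalPart B`. [folklore] -/
theorem _root_.Literature.Topology.FourManifolds.BranchedModel.normalPart_comp
    {A B : 𝕄 →L[ℝ] 𝕄} (hA : ∀ a : Fin 2 → ℝ, (A (a, 0)).2 = 0) :
    normalPart (A.comp B) = (normalPart A).comp (normalPart B) := by
  ext b
  simp only [normalPart_apply, ContinuousLinearMap.coe_comp, Function.comp_apply]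
  set v := B ((0 : Fin 2 → ℝ), b) with hv
  have hsplit : v = (v.1, 0) + (0, v.2) := by simp
  conv_lhs => rw [hsplit]
  rw [map_add, Prod.snd_add, hA, zero_add]

/-! ### The chain rule for the normal derivatives of two pairs -/

/-- The point of pair `b` over the point `(u, 0)` of pair `k`: `u_b = ((k.pairWith₁ b).θ (u, 0)).1`.
[folklore] -/
def crossU (k b : ChartPair σ q₁ q₂) (u : Fin 2 → ℝ) : Fin 2 → ℝ :=
  ((k.pairWith₁ b).θ (u, 0)).1

/-- For a fixed point `y` in both common domains, the real point of `k` over `y`. [folklore] -/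
theorem split_φ₁_eq_real (k : ChartPair σ q₁ q₂) {y : X} (hy : y ∈ k.dom) (hfix : σ y = y) :
    split (k.φ₁ y) = ((split (k.φ₁ y)).1, 0) :=
  eq_real_of_snd_eq_zero (k.snd_split_φ₁_eq_zero hy hfix)

/-- The real point of `k` over a fixed point of the common domain lies in the real locus of `k`.
[folklore] -/
theorem fst_split_φ₁_mem_realSource (k : ChartPair σ q₁ q₂) {y : X} (hy : y ∈ k.dom)
    (hfix : σ y = y) : (split (k.φ₁ y)).1 ∈ k.realSource := by
  show (((split (k.φ₁ y)).1, (0 : ℂ)) : 𝕄) ∈ k.θ.source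
  rw [← k.split_φ₁_eq_real hy hfix]
  exact k.split_mem_θ_source hy

/-- The real point of `k` over `y` lies in the real locus of the self pair `k.pairWith₁ b`.
[folklore] -/
theorem fst_split_φ₁_mem_realSource_pairWith₁ (k b : ChartPair σ q₁ q₂) {y : X} (hyk : y ∈ k.dom)
    (hyb : y ∈ b.dom) (hfix : σ y = y) : (split (k.φ₁ y)).1 ∈ (k.pairWith₁ b).realSource := by
  show (((split (k.φ₁ y)).1, (0 : ℂ)) : 𝕄) ∈ (k.pairWith₁ b).θ.source
  rw [← k.split_φ₁_eq_real hyk hfix]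
  exact (k.pairWith₁ b).split_mem_θ_source (y := y) ⟨hyk.1, hyb.1⟩

/-- The upstairs `q₁`-transition maps the real point of `k` over `y` to the real point of `b`
over `y`. [folklore] -/
theorem pairWith₁_θ_apply (k b : ChartPair σ q₁ q₂) {y : X} (hyk : y ∈ k.dom) (hyb : y ∈ b.dom) :
    (k.pairWith₁ b).θ (split (k.φ₁ y)) = split (b.φ₁ y) :=
  (k.pairWith₁ b).θ_apply_split (y := y) ⟨hyk.1, hyb.1⟩

/-- `crossU` over a fixed point: `u_b = (split (b.φ₁ y)).1`. [folklore] -/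
theorem crossU_eq (k b : ChartPair σ q₁ q₂) {y : X} (hyk : y ∈ k.dom) (hyb : y ∈ b.dom)
    (hfix : σ y = y) : k.crossU b (split (k.φ₁ y)).1 = (split (b.φ₁ y)).1 := by
  rw [crossU, ← k.split_φ₁_eq_real hyk hfix, k.pairWith₁_θ_apply b hyk hyb]

/-- **The mixed transition of `k` factors through that of `b`** near the point of `k` over a
common fixed point: `k.θ = (b.pairWith₂ k).θ ∘ b.θ ∘ (k.pairWith₁ b).θ`. [folklore] -/
theorem θ_eventuallyEq_comp (k b : ChartPair σ q₁ q₂) {y : X} (hyk : y ∈ k.dom) (hyb : y ∈ b.dom) :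
    (k.θ : 𝕄 → 𝕄) =ᶠ[𝓝 (split (k.φ₁ y))]
      (b.pairWith₂ k).θ ∘ b.θ ∘ (k.pairWith₁ b).θ := by
  -- the open set of points of `k.θ.source` whose point of `X` lies in `b.dom`
  have hopen : IsOpen (k.θ.source ∩ (fun x => k.φ₁.symm (split.symm x)) ⁻¹' b.dom) := by
    refine (ContinuousOn.isOpen_inter_preimage ?_ k.isOpen_θ_source b.isOpen_dom)
    refine k.φ₁.continuousOn_symm.comp split.symm.continuous.continuousOn fun x hx => ?_
    exact ((k.mem_θ_source x).1 hx).1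
  have hmem : split (k.φ₁ y) ∈ k.θ.source ∩ (fun x => k.φ₁.symm (split.symm x)) ⁻¹' b.dom := by
    refine ⟨k.split_mem_θ_source hyk, ?_⟩
    simp only [mem_preimage, ContinuousLinearEquiv.symm_apply_apply, k.φ₁.left_inv hyk.1]
    exact hyb
  filter_upwards [hopen.mem_nhds hmem] with x hx
  obtain ⟨hx₁, hx₂⟩ := hx
  set z := k.φ₁.symm (split.symm x) with hz
  have hzk : z ∈ k.dom := k.symm_mem_dom hx₁
  have hx' : x = split (k.φ₁ z) := (k.split_φ₁_symm hx₁).symm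
  simp only [Function.comp_apply]
  rw [hx', k.θ_apply_split hzk, k.pairWith₁_θ_apply b hzk hx₂, b.θ_apply_split hx₂]
  exact ((b.pairWith₂ k).θ_apply_split (y := z) ⟨hx₂.2, hzk.2⟩).symm

/-- **Chain rule for the normal derivatives**: over a common fixed point,
`k.L u_k = τ₂ ∘ b.L u_b ∘ τ₁` with `τ₁ = (k.pairWith₁ b).L u_k`, `τ₂ = (b.pairWith₂ k).L (b.γ u_b)`.
[folklore] -/
theorem L_eq_comp (k b : ChartPair σ q₁ q₂) {y : X} (hyk : y ∈ k.dom) (hyb : y ∈ b.dom)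
    (hfix : σ y = y) :
    k.L (split (k.φ₁ y)).1 =
      ((b.pairWith₂ k).L (b.γ (split (b.φ₁ y)).1)).comp
        ((b.L (split (b.φ₁ y)).1).comp ((k.pairWith₁ b).L (split (k.φ₁ y)).1)) := by
  set uk := (split (k.φ₁ y)).1 with huk
  set ub := (split (b.φ₁ y)).1 with hub
  have hk : uk ∈ k.realSource := k.fst_split_φ₁_mem_realSource hyk hfix
  have hb : ub ∈ b.realSource := b.fst_split_φ₁_mem_realSource hyb hfix
  have hP : uk ∈ (k.pairWith₁ b).realSource := k.fst_split_φ₁_mem_realSource_pairWith₁ b hyk hyb hfix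
  have hxk : split (k.φ₁ y) = ((uk, 0) : 𝕄) := k.split_φ₁_eq_real hyk hfix
  have hxb : split (b.φ₁ y) = ((ub, 0) : 𝕄) := b.split_φ₁_eq_real hyb hfix
  -- the point of the second self pair
  have hQ : b.γ ub ∈ (b.pairWith₂ k).realSource := by
    show (((b.γ ub), (0 : ℂ)) : 𝕄) ∈ (b.pairWith₂ k).θ.source
    rw [← b.θ_real hb, ← hxb, b.θ_apply_split hyb]
    exact (b.pairWith₂ k).split_mem_θ_source (y := y) ⟨hyb.2, hyk.2⟩
  -- chain rule
  have h1 : HasFDerivAt (k.pairWith₁ b).θ (fderiv ℝ (k.pairWith₁ b).θ (uk, 0)) (uk, 0) :=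
    (k.pairWith₁ b).hasFDerivAt_θ hP
  have hmid : (k.pairWith₁ b).θ (uk, 0) = (ub, 0) := by
    rw [← hxk, k.pairWith₁_θ_apply b hyk hyb, hxb]
  have h2 : HasFDerivAt b.θ (fderiv ℝ b.θ (ub, 0)) ((k.pairWith₁ b).θ (uk, 0)) := by
    rw [hmid]; exact b.hasFDerivAt_θ hb
  have hmid2 : b.θ ((k.pairWith₁ b).θ (uk, 0)) = (b.γ ub, 0) := by
    rw [hmid, b.θ_real hb]
  have h3 : HasFDerivAt (b.pairWith₂ k).θ (fderiv ℝ (b.pairWith₂ k).θ (b.γ ub, 0))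
      (b.θ ((k.pairWith₁ b).θ (uk, 0))) := by
    rw [hmid2]; exact (b.pairWith₂ k).hasFDerivAt_θ hQ
  have hcomp := (h3.comp _ h2).comp (uk, 0) h1
  have hk' : HasFDerivAt k.θ (fderiv ℝ k.θ (uk, 0)) (uk, 0) := k.hasFDerivAt_θ hk
  have hev := k.θ_eventuallyEq_comp b hyk hyb
  rw [hxk] at hev
  have heq := hk'.unique (hcomp.congr_of_eventuallyEq hev)
  -- take normal parts
  rw [L, heq, ContinuousLinearMap.comp_assoc,
    normalPart_comp (fun a => (b.pairWith₂ k).snd_fderiv_θ_inl hQ a),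
    normalPart_comp (fun a => b.snd_fderiv_θ_inl hb a)]
  rfl

/-! ### The local solution of one pair read in another -/

/-- **The local solution of `b` read in the pair `k`**:
`crossLoc b k = splitW ∘ k.ψ₂ ∘ b.floc ∘ k.ψ₁⁻¹ ∘ splitW⁻¹`. [folklore] -/
def crossLoc (b k : ChartPair σ q₁ q₂) (w : 𝕄) : 𝕄 :=
  splitW (k.ψ₂ (b.floc (k.ψ₁.symm (splitW.symm w))))

/-- `crossLoc` is the composite `yTrans₂ ∘ Θloc ∘ yTrans₁` of the downstairs transitions of the
self pairs with the local solution in coordinates. [folklore] -/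
theorem crossLoc_eq (b k : ChartPair σ q₁ q₂) (h₁ : IsBranchedDoubleQuotient σ q₁)
    (h₂ : IsBranchedDoubleQuotient σ q₂) :
    b.crossLoc k = (b.pairWith₂ k).Θh h₂ h₂ ∘ b.Θloc ∘ (k.pairWith₁ b).Θh h₁ h₁ := by
  funext w
  simp only [Function.comp_apply, Θh_self_apply, crossLoc, floc]
  rfl

/-- **The local solution of `b` read in `k` is `(γ_k, 0)` on the real locus** near the point over
a common fixed point. [folklore] -/
theorem crossLoc_real (b k : ChartPair σ q₁ q₂) {y : X} (hyk : y ∈ k.dom) (hyb : y ∈ b.dom)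
    (hfix : σ y = y) :
    ∀ᶠ u' in 𝓝 (split (k.φ₁ y)).1, b.crossLoc k (u', 0) = (k.γ u', 0) := by
  -- near the base point, real points of `k` come from fixed points lying in `b.dom`
  have hopen : IsOpen (k.realSource ∩
      (fun u' : Fin 2 → ℝ => k.φ₁.symm (split.symm (u', 0))) ⁻¹' b.dom) := by
    refine ContinuousOn.isOpen_inter_preimage ?_ k.isOpen_realSource b.isOpen_dom
    refine k.φ₁.continuousOn_symm.comp
      (split.symm.continuous.comp (Continuous.prodMk_left 0)).continuousOn fun u' hu' => ?_
    exact ((k.mem_θ_source _).1 hu').1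
  have hmem : (split (k.φ₁ y)).1 ∈ k.realSource ∩
      (fun u' : Fin 2 → ℝ => k.φ₁.symm (split.symm (u', 0))) ⁻¹' b.dom := by
    refine ⟨k.fst_split_φ₁_mem_realSource hyk hfix, ?_⟩
    simp only [mem_preimage]
    rw [← k.split_φ₁_eq_real hyk hfix, ContinuousLinearEquiv.symm_apply_apply,
      k.φ₁.left_inv hyk.1]
    exact hyb
  filter_upwards [hopen.mem_nhds hmem] with u' hu'
  obtain ⟨hu'k, hu'b⟩ := hu'
  set z := k.φ₁.symm (split.symm (u', 0)) with hz
  have hzk : z ∈ k.dom := k.symm_mem_dom hu'k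
  have hzfix : σ z = z := (k.snd_eq_zero_iff hu'k).1 rfl
  have hx' : ((u', 0) : 𝕄) = split (k.φ₁ z) := (k.split_φ₁_symm hu'k).symm
  -- `crossLoc (u', 0) = splitW (k.ψ₂ (b.floc (q₁ z))) = splitW (k.ψ₂ (q₂ z))`
  have h1 : k.ψ₁.symm (splitW.symm (u', 0)) = q₁ z := by
    rw [hx', ← sqModel_of_snd_eq_zero (k.snd_split_φ₁_eq_zero hzk hzfix),
      k.sqModel_split_φ₁ hzk.1, ContinuousLinearEquiv.symm_apply_apply,
      k.ψ₁.left_inv (k.adapted₁ z hzk.1).2.2.1]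
  rw [crossLoc, h1, b.floc_apply_of_mem_fixedPoints hu'b hzfix, ← k.sqModel_split_φ₂ hzk.2,
    ← k.θ_apply_split hzk, ← hx', k.θ_real hu'k]
  simp [sqModel]

/-! ### The derivative of the local solution of `b` read in `k` at the branch point -/

/-- The normal part of `ΘlocDeriv` is the polar square. [folklore] -/
theorem normalPart_ΘlocDeriv (b : ChartPair σ q₁ q₂) (u : Fin 2 → ℝ) :
    normalPart (b.ΘlocDeriv u) = polarSq (b.L u) := by
  ext w; simp

/-- `ΘlocDeriv` kills the normal component of real vectors. [folklore] -/
theorem snd_ΘlocDeriv_inl (b : ChartPair σ q₁ q₂) (u a : Fin 2 → ℝ) :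
    (b.ΘlocDeriv u (a, 0)).2 = 0 := by
  simp

/-- **The derivative of `crossLoc b k` at the branch point** over a common fixed point `y`: the
composite of the derivatives of the downstairs `q₂`-transition, of the local solution of `b` in
coordinates, and of the downstairs `q₁`-transition. [folklore] -/
theorem hasFDerivAt_crossLoc (b k : ChartPair σ q₁ q₂) (h₁ : IsBranchedDoubleQuotient σ q₁)
    (h₂ : IsBranchedDoubleQuotient σ q₂) (hb : b.IsPos) {y : X} (hyk : y ∈ k.dom)
    (hyb : y ∈ b.dom) (hfix : σ y = y) :
    HasFDerivAt (b.crossLoc k)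
      ((fderiv ℝ ((b.pairWith₂ k).Θh h₂ h₂) (b.γ (split (b.φ₁ y)).1, 0)).comp
        ((b.ΘlocDeriv (split (b.φ₁ y)).1).comp
          (fderiv ℝ ((k.pairWith₁ b).Θh h₁ h₁) ((split (k.φ₁ y)).1, 0))))
      ((split (k.φ₁ y)).1, 0) := by
  set uk := (split (k.φ₁ y)).1 with huk
  set ub := (split (b.φ₁ y)).1 with hub
  have hbr : ub ∈ b.realSource := b.fst_split_φ₁_mem_realSource hyb hfix
  have hP : uk ∈ (k.pairWith₁ b).realSource :=
    k.fst_split_φ₁_mem_realSource_pairWith₁ b hyk hyb hfix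
  have hxb : split (b.φ₁ y) = ((ub, 0) : 𝕄) := b.split_φ₁_eq_real hyb hfix
  have hQ : b.γ ub ∈ (b.pairWith₂ k).realSource := by
    show (((b.γ ub), (0 : ℂ)) : 𝕄) ∈ (b.pairWith₂ k).θ.source
    rw [← b.θ_real hbr, ← hxb, b.θ_apply_split hyb]
    exact (b.pairWith₂ k).split_mem_θ_source (y := y) ⟨hyb.2, hyk.2⟩
  -- values at the base points
  have hv1 : (k.pairWith₁ b).Θh h₁ h₁ (uk, 0) = (ub, 0) := by
    rw [(k.pairWith₁ b).Θh_self_real h₁ hP]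
    congr 1
    exact k.crossU_eq b hyk hyb hfix
  have hv2 : b.Θloc ((k.pairWith₁ b).Θh h₁ h₁ (uk, 0)) = (b.γ ub, 0) := by
    rw [hv1, Θloc_real]
  -- chain rule
  have g1 : HasFDerivAt ((k.pairWith₁ b).Θh h₁ h₁)
      (fderiv ℝ ((k.pairWith₁ b).Θh h₁ h₁) (uk, 0)) (uk, 0) := (k.pairWith₁ b).hasFDerivAt_Θh_self h₁ hP
  have g2 : HasFDerivAt b.Θloc (b.ΘlocDeriv ub) ((k.pairWith₁ b).Θh h₁ h₁ (uk, 0)) := by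
    rw [hv1]; exact b.hasFDerivAt_Θloc hb hbr
  have g3 : HasFDerivAt ((b.pairWith₂ k).Θh h₂ h₂)
      (fderiv ℝ ((b.pairWith₂ k).Θh h₂ h₂) (b.γ ub, 0)) (b.Θloc ((k.pairWith₁ b).Θh h₁ h₁ (uk, 0))) := by
    rw [hv2]; exact (b.pairWith₂ k).hasFDerivAt_Θh_self h₂ hQ
  have hcomp := (g3.comp _ g2).comp (uk, 0) g1
  rw [b.crossLoc_eq k h₁ h₂]
  rwa [← ContinuousLinearMap.comp_assoc]

/-- **The normal block of the derivative of `crossLoc b k` at the branch point is a POSITIVE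
multiple of the polar square of `k`**: `λ • Ô_k`, `λ = (|α₁|² + |β₁|²)(|α₂|² + |β₂|²) > 0` for
the normal derivatives `τ₁`, `τ₂` of the two self pairs. [folklore] -/
theorem normalPart_fderiv_crossLoc (b k : ChartPair σ q₁ q₂) (h₁ : IsBranchedDoubleQuotient σ q₁)
    (h₂ : IsBranchedDoubleQuotient σ q₂) (hb : b.IsPos) (hk : k.IsPos) {y : X} (hyk : y ∈ k.dom)
    (hyb : y ∈ b.dom) (hfix : σ y = y) :
    ∃ lam : ℝ, 0 < lam ∧
      normalPart ((fderiv ℝ ((b.pairWith₂ k).Θh h₂ h₂) (b.γ (split (b.φ₁ y)).1, 0)).comp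
        ((b.ΘlocDeriv (split (b.φ₁ y)).1).comp
          (fderiv ℝ ((k.pairWith₁ b).Θh h₁ h₁) ((split (k.φ₁ y)).1, 0)))) =
        lam • polarSq (k.L (split (k.φ₁ y)).1) := by
  set uk := (split (k.φ₁ y)).1 with huk
  set ub := (split (b.φ₁ y)).1 with hub
  have hkr : uk ∈ k.realSource := k.fst_split_φ₁_mem_realSource hyk hfix
  have hbr : ub ∈ b.realSource := b.fst_split_φ₁_mem_realSource hyb hfix
  have hP : uk ∈ (k.pairWith₁ b).realSource :=
    k.fst_split_φ₁_mem_realSource_pairWith₁ b hyk hyb hfix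
  have hxb : split (b.φ₁ y) = ((ub, 0) : 𝕄) := b.split_φ₁_eq_real hyb hfix
  have hQ : b.γ ub ∈ (b.pairWith₂ k).realSource := by
    show (((b.γ ub), (0 : ℂ)) : 𝕄) ∈ (b.pairWith₂ k).θ.source
    rw [← b.θ_real hbr, ← hxb, b.θ_apply_split hyb]
    exact (b.pairWith₂ k).split_mem_θ_source (y := y) ⟨hyb.2, hyk.2⟩
  set τ₁ := (k.pairWith₁ b).L uk with hτ₁
  set τ₂ := (b.pairWith₂ k).L (b.γ ub) with hτ₂
  refine ⟨(‖conformalPart τ₁‖ ^ 2 + ‖anticonformalPart τ₁‖ ^ 2) *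
    (‖conformalPart τ₂‖ ^ 2 + ‖anticonformalPart τ₂‖ ^ 2),
    hat_scalar_pos ((k.pairWith₁ b).L_self_ne_zero hP) ((b.pairWith₂ k).L_self_ne_zero hQ), ?_⟩
  rw [normalPart_comp (fun a => (b.pairWith₂ k).snd_fderiv_Θh_self_inl h₂ hQ a),
    normalPart_comp (fun a => b.snd_ΘlocDeriv_inl ub a),
    (b.pairWith₂ k).normalPart_fderiv_Θh_self h₂ hQ, b.normalPart_ΘlocDeriv,
    (k.pairWith₁ b).normalPart_fderiv_Θh_self h₁ hP]
  -- the algebra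
  have hchain : k.L uk = τ₂.comp ((b.L ub).comp τ₁) := k.L_eq_comp b hyk hyb hfix
  have hk' : ‖anticonformalPart (τ₂.comp ((b.L ub).comp τ₁))‖ <
      ‖conformalPart (τ₂.comp ((b.L ub).comp τ₁))‖ := by
    rw [← hchain]; exact hk uk hkr
  ext w
  rw [ContinuousLinearMap.coe_comp, ContinuousLinearMap.coe_comp, Function.comp_apply,
    Function.comp_apply, smul_apply, hchain, Complex.real_smul]
  exact hat_comp_polarSq_comp_hat (hb ub hbr)
    ((k.pairWith₁ b).conformalPart_mul_anticonformalPart_L_self h₁ hP)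
    ((k.pairWith₁ b).L_self_ne_zero hP)
    ((b.pairWith₂ k).conformalPart_mul_anticonformalPart_L_self h₂ hQ)
    ((b.pairWith₂ k).L_self_ne_zero hQ) hk' w

/-- **Summary for the averaging.** For positive pairs `b`, `k` and a common fixed point `y`, the
local solution of `b` read in `k` is differentiable at the branch point `(u_k, 0)` with a
derivative `D` such that: `D (a, 0) = (Dγ_k a, 0)` (it restricts to `(γ_k, 0)` on the real
locus) and `normalPart D = λ • Ô_k` with `λ > 0`. [folklore] -/
theorem crossLoc_firstOrder (b k : ChartPair σ q₁ q₂) (h₁ : IsBranchedDoubleQuotient σ q₁)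
    (h₂ : IsBranchedDoubleQuotient σ q₂) (hb : b.IsPos) (hk : k.IsPos) {y : X} (hyk : y ∈ k.dom)
    (hyb : y ∈ b.dom) (hfix : σ y = y) :
    ∃ D : 𝕄 →L[ℝ] 𝕄, HasFDerivAt (b.crossLoc k) D ((split (k.φ₁ y)).1, 0) ∧
      (∀ a : Fin 2 → ℝ, D (a, 0) = (fderiv ℝ k.γ (split (k.φ₁ y)).1 a, 0)) ∧
      ∃ lam : ℝ, 0 < lam ∧ normalPart D = lam • polarSq (k.L (split (k.φ₁ y)).1) := by
  obtain ⟨lam, hlam, hN⟩ := b.normalPart_fderiv_crossLoc k h₁ h₂ hb hk hyk hyb hfix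
  refine ⟨_, b.hasFDerivAt_crossLoc k h₁ h₂ hb hyk hyb hfix, fun a => ?_, lam, hlam, hN⟩
  -- the real directions: compare with `u' ↦ (γ_k u', 0)`
  set uk := (split (k.φ₁ y)).1 with huk
  have hkr : uk ∈ k.realSource := k.fst_split_φ₁_mem_realSource hyk hfix
  have hD := b.hasFDerivAt_crossLoc k h₁ h₂ hb hyk hyb hfix
  set D := (fderiv ℝ ((b.pairWith₂ k).Θh h₂ h₂) (b.γ (split (b.φ₁ y)).1, 0)).comp
    ((b.ΘlocDeriv (split (b.φ₁ y)).1).comp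
      (fderiv ℝ ((k.pairWith₁ b).Θh h₁ h₁) (uk, 0))) with hDdef
  have hi : HasFDerivAt (fun u' : Fin 2 → ℝ => ((u', 0) : 𝕄))
      (ContinuousLinearMap.inl ℝ (Fin 2 → ℝ) ℂ) uk :=
    (ContinuousLinearMap.inl ℝ (Fin 2 → ℝ) ℂ).hasFDerivAt.congr_of_eventuallyEq
      (Eventually.of_forall fun u' => by simp)
  have hD' : HasFDerivAt (b.crossLoc k) D ((fun u' : Fin 2 → ℝ => ((u', 0) : 𝕄)) uk) := hD
  have hc1 : HasFDerivAt (b.crossLoc k ∘ fun u' : Fin 2 → ℝ => ((u', 0) : 𝕄))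
      (D.comp (ContinuousLinearMap.inl ℝ (Fin 2 → ℝ) ℂ)) uk := hD'.comp uk hi
  have hc2 : HasFDerivAt (fun u' : Fin 2 → ℝ => ((k.γ u', (0 : ℂ)) : 𝕄))
      ((ContinuousLinearMap.inl ℝ (Fin 2 → ℝ) ℂ).comp (fderiv ℝ k.γ uk)) uk := by
    have hγ := (k.hasFDerivAt_γ hkr).differentiableAt.hasFDerivAt
    exact (ContinuousLinearMap.inl ℝ (Fin 2 → ℝ) ℂ).hasFDerivAt.comp uk hγ
  have heq : (fun u' : Fin 2 → ℝ => b.crossLoc k (u', 0)) =ᶠ[𝓝 uk]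
      fun u' : Fin 2 → ℝ => ((k.γ u', (0 : ℂ)) : 𝕄) := b.crossLoc_real k hyk hyb hfix
  have := hc1.unique (hc2.congr_of_eventuallyEq heq)
  have h3 := congrArg (fun A : (Fin 2 → ℝ) →L[ℝ] 𝕄 => A a) this
  simpa using h3

/-! ### The derivative of the comparison map read in a pair, off the branch locus -/

omit [TopologicalSpace X] [ChartedSpace (Fin 2 → ℂ) X] in
/-- `sqModelDeriv z` is onto for `z ≠ 0` (right inverse `(a, b) ↦ (a, b/(2z))`). [folklore] -/
theorem _root_.Literature.Topology.FourManifolds.BranchedModel.sqModelDeriv_surjective {z : ℂ}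
    (hz : z ≠ 0) : Surjective (sqModelDeriv z) := by
  intro v
  refine ⟨(v.1, v.2 / (2 * z)), ?_⟩
  rw [sqModelDeriv_apply]
  refine Prod.ext rfl ?_
  show 2 * z * (v.2 / (2 * z)) = v.2
  field_simp

/-- **The derivative of the comparison map read in the pair `k` at `sqModel (u, s e)`, `s ≠ 0`,
is the polar derivative field `polarDeriv k.θ (u, s, e)`** (`BranchedModelPolar.lean`). [folklore] -/
theorem hasFDerivAt_Θh_polar (k : ChartPair σ q₁ q₂) (h₁ : IsBranchedDoubleQuotient σ q₁)
    (h₂ : IsBranchedDoubleQuotient σ q₂) {u : Fin 2 → ℝ} {s : ℝ} {e : ℂ}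
    (hx : ((u, s • e) : 𝕄) ∈ k.θ.source) (hs : s ≠ 0) (he : e ≠ 0) :
    HasFDerivAt (k.Θh h₁ h₂) (polarDeriv k.θ (u, s, e)) (sqModel (u, s • e)) := by
  have hz : s • e ≠ 0 := smul_ne_zero hs he
  have hdiff : ContDiffAt ℝ ∞ (k.Θh h₁ h₂) (sqModel (u, s • e)) := k.contDiffAt_Θh h₁ h₂ hx hz
  set A := fderiv ℝ (k.Θh h₁ h₂) (sqModel (u, s • e)) with hA
  have hA' : HasFDerivAt (k.Θh h₁ h₂) A (sqModel (u, s • e)) :=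
    (hdiff.differentiableAt (by simp)).hasFDerivAt
  -- both `A` and `polarDeriv` solve `? ∘ D(sqModel) = D(sqModel) ∘ Dθ`
  have h1 : HasFDerivAt (k.Θh h₁ h₂ ∘ sqModel) (A.comp (sqModelDeriv (s • e))) (u, s • e) :=
    hA'.comp _ (hasFDerivAt_sqModel (u, s • e))
  have h2 : HasFDerivAt (sqModel ∘ k.θ) ((sqModelDeriv (k.θ (u, s • e)).2).comp
      (fderiv ℝ k.θ (u, s • e))) (u, s • e) :=
    (hasFDerivAt_sqModel (k.θ (u, s • e))).comp _ (k.hasFDerivAt_θ hx)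
  have hev : k.Θh h₁ h₂ ∘ sqModel =ᶠ[𝓝 ((u, s • e) : 𝕄)] sqModel ∘ (k.θ : 𝕄 → 𝕄) := by
    filter_upwards [k.eventually_Θh_sqModel h₁ h₂ hx] with x' hx'
    exact hx'
  have heq := h1.unique (h2.congr_of_eventuallyEq hev)
  have hpol := polarDeriv_comp_sqModelDeriv k.θ (p := (u, s, e)) hs he
  simp only [pt_apply] at hpol
  have hAP : A = polarDeriv k.θ (u, s, e) := by
    refine ContinuousLinearMap.ext fun v => ?_
    obtain ⟨w, rfl⟩ := sqModelDeriv_surjective hz v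
    have := congrArg (fun B : 𝕄 →L[ℝ] 𝕄 => B w) (heq.trans hpol.symm)
    simpa using this
  rw [hAP] at hA'
  exact hA'

end ChartPair

end Literature.Topology.FourManifolds

end


/-!
# The averaging set-up: pairs, partition of unity, radial function, cutoff, weights, `Φ`

Topic `Topology/FourManifolds`; namespace `Literature.Topology.FourManifolds`. Seventh file of the
proof of `Literature.Topology.FourManifolds.DegtyarevKharlamov2000_conjQuotient_unique`
(`ConjugationQuotients.lean`). Everything is proved; no named facts.

For two branched double quotients `q₁ : X → Y₁`, `q₂ : X → Y₂` of a compact `X` by `σ` we FIX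
(`Setup`, existence `Setup.exists_nonempty`):
* finitely many positive chart pairs `c i` whose common domains cover `Fix σ`
  (`ChartPair.exists_isPos`, compactness);
* a smooth partition of unity `(ηᵢ)ᵢ, η∞` on `Y₁` subordinate to the open sets
  `V i = (c i).flocSource ∩ q₁ '' (c i).dom` (on which the local solution `(c i).floc` is smooth
  and above whose branch points the pair is centred) and to the complement of the branch locus;
* a Whitney embedding `emb : Y₂ → ℝᴺ` with a smooth retraction `retr` of an open tube
  (Mathlib `exists_embedding_euclidean_of_compact`, tree `exists_normalRetraction`).

From these: the **radial function** `rad = ∑ᵢ ηᵢ · ‖wᵢ‖² + η∞` (`wᵢ` the normal coordinate in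
pair `i`; smooth, `≥ 0`, vanishing exactly on the branch locus), the **logarithmic cutoff**
`χ = cut a Λ (log rad)` (`1` where `rad < eᵃ`, `0` where `rad ≥ e^{a+Λ}`, smooth), the
**weights** `tᵢ = χ ηᵢ`, `t∞ = 1 - ∑ tᵢ` and the **averaged map**
`Φ = retr (∑ᵢ tᵢ • emb ∘ flocᵢ + t∞ • emb ∘ comparison)`. This file records their elementary
properties; smoothness of `Φ` and the main estimate are in the sequel files.

## References

* A. Degtyarev, V. Kharlamov, Russian Math. Surveys 55 (2000), arXiv:math/0004134, §3.2 ¶1.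
  [DegtyarevKharlamov2000]
-/

noncomputable section

open scoped Manifold ContDiff Topology
open Set Function Filter
open Literature.Topology.FourManifolds.BranchedModel

namespace Literature.Topology.FourManifolds

/-- Local notation: `𝕄` is the split model space `(Fin 2 → ℝ) × ℂ`. -/
local notation "𝕄" => (Fin 2 → ℝ) × ℂ

/-- Local notation: the Euclidean space `ℝᴺ`. -/
local notation "𝔼" N:arg => EuclideanSpace ℝ (Fin N)

variable {X : Type*} [TopologicalSpace X] [ChartedSpace (Fin 2 → ℂ) X]
  {Y₁ : Type*} [TopologicalSpace Y₁] [ChartedSpace (EuclideanSpace ℝ (Fin 4)) Y₁]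
  {Y₂ : Type*} [TopologicalSpace Y₂] [ChartedSpace (EuclideanSpace ℝ (Fin 4)) Y₂]

/-- **The averaging set-up** for two branched double quotients `q₁`, `q₂` of `X` by `σ`:
finitely many positive chart pairs covering the fixed points, a smooth partition of unity on
`Y₁` subordinate to their good open sets and to the complement of the branch locus, and a
Whitney embedding of `Y₂` with a smooth tubular retraction. [folklore] -/
structure Setup (ι : Type*) [Fintype ι] (σ : X → X) (q₁ : X → Y₁) (q₂ : X → Y₂) (N : ℕ) where
  /-- `q₁` is a branched double quotient -/
  h₁ : IsBranchedDoubleQuotient σ q₁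
  /-- `q₂` is a branched double quotient -/
  h₂ : IsBranchedDoubleQuotient σ q₂
  /-- the involution is continuous -/
  hσ : Continuous σ
  /-- the positive chart pairs -/
  c : ι → ChartPair σ q₁ q₂
  pos : ∀ i, (c i).IsPos
  cover : ∀ x, σ x = x → ∃ i, x ∈ (c i).dom
  /-- the partition of unity on `Y₁` (index `none` for the complement of the branch locus) -/
  pou : SmoothPartitionOfUnity (Option ι) (𝓡 4) Y₁ univ
  sub : pou.IsSubordinate fun o => o.elim (q₁ '' fixedPoints σ)ᶜ
    fun i => (c i).flocSource ∩ q₁ '' (c i).dom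
  /-- the Whitney embedding of `Y₂` -/
  emb : Y₂ → 𝔼 N
  emb_smooth : ContMDiff (𝓡 4) 𝓘(ℝ, 𝔼 N) ∞ emb
  /-- the open tube and its smooth retraction -/
  tube : Set (𝔼 N)
  tube_open : IsOpen tube
  retr : 𝔼 N → Y₂
  retr_smooth : ContMDiffOn 𝓘(ℝ, 𝔼 N) (𝓡 4) ∞ retr tube
  emb_mem : ∀ y, emb y ∈ tube
  retr_emb : ∀ y, retr (emb y) = y

namespace Setup

variable {ι : Type*} [Fintype ι] {σ : X → X} {q₁ : X → Y₁} {q₂ : X → Y₂} {N : ℕ}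

/-! ### Existence of a set-up -/

/-- **A set-up exists** for compact Hausdorff `X`, continuous `σ`, and targets which are
Hausdorff `C^∞` manifolds (then compact as images of `X`). [folklore] -/
theorem exists_nonempty [T2Space X] [CompactSpace X] [Nonempty X] [T2Space Y₁]
    [IsManifold (𝓡 4) ∞ Y₁] [T2Space Y₂] [IsManifold (𝓡 4) ∞ Y₂]
    (h₁ : IsBranchedDoubleQuotient σ q₁) (h₂ : IsBranchedDoubleQuotient σ q₂) (hσ : Continuous σ) :
    ∃ (m N : ℕ), Nonempty (Setup (Fin m) σ q₁ q₂ N) := by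
  haveI : CompactSpace Y₁ := h₁.compactSpace
  haveI : CompactSpace Y₂ := h₂.compactSpace
  haveI : Nonempty Y₂ := ⟨q₂ (Classical.arbitrary X)⟩
  -- positive pairs at the fixed points and a finite subcover
  have hF : IsCompact (fixedPoints σ) :=
    (IsBranchedDoubleQuotient.isClosed_fixedPoints (X := X) hσ).isCompact
  choose cx hcx using fun x : fixedPoints σ =>
    ChartPair.exists_isPos h₁ h₂ (show σ (x : X) = x from x.2)
  obtain ⟨t, ht⟩ := hF.elim_finite_subcover (fun x : fixedPoints σ => (cx x).dom)
    (fun x => (cx x).isOpen_dom) fun x hx => mem_iUnion.2 ⟨⟨x, hx⟩, (hcx ⟨x, hx⟩).2⟩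
  set m := t.card with hm
  set c : Fin m → ChartPair σ q₁ q₂ := fun j => cx (t.equivFin.symm j) with hc
  have hpos : ∀ j, (c j).IsPos := fun j => (hcx _).1
  have hcover : ∀ x, σ x = x → ∃ j, x ∈ (c j).dom := fun x hx => by
    obtain ⟨x', hx'⟩ := mem_iUnion.1 (ht hx)
    obtain ⟨hx't, hxdom⟩ := mem_iUnion.1 hx'
    refine ⟨t.equivFin ⟨x', hx't⟩, ?_⟩
    simp only [hc, Equiv.symm_apply_apply]
    exact hxdom
  -- the partition of unity
  set U : Option (Fin m) → Set Y₁ := fun o => o.elim (q₁ '' fixedPoints σ)ᶜ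
    fun i => (c i).flocSource ∩ q₁ '' (c i).dom with hU
  have hUo : ∀ o, IsOpen (U o) := by
    rintro (_ | i)
    · exact (h₁.isClosed_image_fixedPoints hσ).isOpen_compl
    · exact ((c i).isOpen_flocSource (hpos i)).inter (h₁.isOpen_image hσ (c i).isOpen_dom)
  have hUcov : (univ : Set Y₁) ⊆ ⋃ o, U o := by
    intro y _
    by_cases hy : y ∈ q₁ '' fixedPoints σ
    · obtain ⟨x, hx, rfl⟩ := hy
      obtain ⟨j, hj⟩ := hcover x hx
      exact mem_iUnion.2 ⟨some j, (c j).mem_flocSource hj hx, x, hj, rfl⟩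
    · exact mem_iUnion.2 ⟨none, hy⟩
  obtain ⟨P, hsub⟩ := SmoothPartitionOfUnity.exists_isSubordinate (𝓡 4) isClosed_univ U hUo hUcov
  -- Whitney embedding and retraction
  obtain ⟨N, e, he, hemb, hinj⟩ := exists_embedding_euclidean_of_compact (I := 𝓡 4) (M := Y₂)
  obtain ⟨ε, hε, hTopen, hr, hre⟩ := exists_normalRetraction (I := 𝓡 4) he hemb.injective hinj
  have hreT : ∀ y : Y₂, e y ∈ normalTube (𝓡 4) e ε ∧ normalRetraction (𝓡 4) e ε (e y) = y :=
    fun y => by simpa using hre y 0 (Submodule.zero_mem _) (by simpa using hε)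
  exact ⟨m, N, ⟨{
    h₁ := h₁, h₂ := h₂, hσ := hσ, c := c, pos := hpos, cover := hcover, pou := P
    sub := hsub, emb := e, emb_smooth := he, tube := normalTube (𝓡 4) e ε, tube_open := hTopen
    retr := normalRetraction (𝓡 4) e ε, retr_smooth := hr, emb_mem := fun y => (hreT y).1
    retr_emb := fun y => (hreT y).2 }⟩⟩

/-! ### The good open sets and the partition of unity -/

/-- The good open set of the pair `i`: the local solution `(c i).floc` is smooth on it and its
branch points are the images of the fixed points of the common domain. [folklore] -/
def V (S : Setup ι σ q₁ q₂ N) (i : ι) : Set Y₁ :=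
  (S.c i).flocSource ∩ q₁ '' (S.c i).dom

/-- The good sets are open. [folklore] -/
theorem isOpen_V (S : Setup ι σ q₁ q₂ N) (i : ι) : IsOpen (S.V i) :=
  ((S.c i).isOpen_flocSource (S.pos i)).inter (S.h₁.isOpen_image S.hσ (S.c i).isOpen_dom)

/-- A branch point of `V i` is `q₁ x` for a fixed point `x` of the common domain of pair `i`.
[folklore] -/
theorem exists_of_mem_V (S : Setup ι σ q₁ q₂ N) {i : ι} {y : Y₁} (hy : y ∈ S.V i)
    (hyB : y ∈ q₁ '' fixedPoints σ) : ∃ x ∈ (S.c i).dom, σ x = x ∧ q₁ x = y := by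
  obtain ⟨x, hx, rfl⟩ := hy.2
  exact ⟨x, hx, (S.h₁.apply_mem_image_fixedPoints_iff x).1 hyB, rfl⟩

/-- The weight functions of the pairs. [folklore] -/
def η (S : Setup ι σ q₁ q₂ N) (i : ι) : Y₁ → ℝ :=
  S.pou (some i)

/-- The weight function of the complement of the branch locus. [folklore] -/
def ηinf (S : Setup ι σ q₁ q₂ N) : Y₁ → ℝ :=
  S.pou none

/-- `ηᵢ` is smooth. [folklore] -/
theorem contMDiff_η (S : Setup ι σ q₁ q₂ N) (i : ι) : ContMDiff (𝓡 4) 𝓘(ℝ, ℝ) ∞ (S.η i) :=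
  (S.pou (some i)).contMDiff

/-- `η∞` is smooth. [folklore] -/
theorem contMDiff_ηinf (S : Setup ι σ q₁ q₂ N) : ContMDiff (𝓡 4) 𝓘(ℝ, ℝ) ∞ S.ηinf :=
  (S.pou none).contMDiff

/-- `0 ≤ ηᵢ`. [folklore] -/
theorem η_nonneg (S : Setup ι σ q₁ q₂ N) (i : ι) (y : Y₁) : 0 ≤ S.η i y :=
  S.pou.nonneg _ _

/-- `0 ≤ η∞`. [folklore] -/
theorem ηinf_nonneg (S : Setup ι σ q₁ q₂ N) (y : Y₁) : 0 ≤ S.ηinf y :=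
  S.pou.nonneg _ _

/-- **The weights sum to one**: `∑ᵢ ηᵢ + η∞ = 1`. [folklore] -/
theorem sum_η (S : Setup ι σ q₁ q₂ N) (y : Y₁) : ∑ i, S.η i y + S.ηinf y = 1 := by
  have h := S.pou.sum_eq_one (mem_univ y)
  rw [finsum_eq_sum_of_fintype, Fintype.sum_option] at h
  simpa [η, ηinf, add_comm] using h

/-- `ηᵢ ≤ 1`. [folklore] -/
theorem η_le_one (S : Setup ι σ q₁ q₂ N) (i : ι) (y : Y₁) : S.η i y ≤ 1 :=
  S.pou.le_one _ _

/-- `∑ᵢ ηᵢ ≤ 1`. [folklore] -/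
theorem sum_η_le_one (S : Setup ι σ q₁ q₂ N) (y : Y₁) : ∑ i, S.η i y ≤ 1 := by
  have := S.sum_η y
  linarith [S.ηinf_nonneg y]

/-- `∑ᵢ ηᵢ = 1 - η∞`. [folklore] -/
theorem sum_η_eq (S : Setup ι σ q₁ q₂ N) (y : Y₁) : ∑ i, S.η i y = 1 - S.ηinf y := by
  have := S.sum_η y; linarith

/-- The support of `ηᵢ` lies in the good set `V i`. [folklore] -/
theorem tsupport_η_subset (S : Setup ι σ q₁ q₂ N) (i : ι) : tsupport (S.η i) ⊆ S.V i :=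
  S.sub (some i)

/-- The support of `η∞` misses the branch locus. [folklore] -/
theorem tsupport_ηinf_subset (S : Setup ι σ q₁ q₂ N) : tsupport S.ηinf ⊆ (q₁ '' fixedPoints σ)ᶜ :=
  S.sub none

/-- `η∞` vanishes on a neighbourhood of the branch locus. [folklore] -/
theorem ηinf_eventuallyEq_zero (S : Setup ι σ q₁ q₂ N) {y : Y₁} (hy : y ∈ q₁ '' fixedPoints σ) :
    S.ηinf =ᶠ[𝓝 y] 0 := by
  have : y ∉ tsupport S.ηinf := fun h => S.tsupport_ηinf_subset h hy
  exact notMem_tsupport_iff_eventuallyEq.1 this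

/-! ### The radial function -/

/-- The squared normal coordinate of `y` in the pair `i` (junk off the chart domain). [folklore] -/
def nsq (S : Setup ι σ q₁ q₂ N) (i : ι) (y : Y₁) : ℝ :=
  ‖(splitW ((S.c i).ψ₁ y)).2‖ ^ 2

/-- **The radial function** `rad = ∑ᵢ ηᵢ ‖wᵢ‖² + η∞`. [folklore] -/
def rad (S : Setup ι σ q₁ q₂ N) (y : Y₁) : ℝ :=
  ∑ i, S.η i y * S.nsq i y + S.ηinf y

/-- `0 ≤ rad`. [folklore] -/
theorem rad_nonneg (S : Setup ι σ q₁ q₂ N) (y : Y₁) : 0 ≤ S.rad y := by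
  refine add_nonneg (Finset.sum_nonneg fun i _ => mul_nonneg (S.η_nonneg i y) ?_) (S.ηinf_nonneg y)
  unfold nsq; positivity

/-- The squared normal coordinate vanishes at branch points of `V i`. [folklore] -/
theorem nsq_eq_zero (S : Setup ι σ q₁ q₂ N) {i : ι} {y : Y₁} (hy : y ∈ S.V i)
    (hyB : y ∈ q₁ '' fixedPoints σ) : S.nsq i y = 0 := by
  obtain ⟨x, hx, hfix, rfl⟩ := S.exists_of_mem_V hy hyB
  have h0 := (S.c i).snd_split_φ₁_eq_zero hx hfix
  have h1 : splitW ((S.c i).ψ₁ (q₁ x)) = split ((S.c i).φ₁ x) := by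
    rw [← (S.c i).sqModel_split_φ₁ hx.1, ChartPair.sqModel_of_snd_eq_zero h0]
  rw [nsq, h1, h0]
  simp

/-- **The radial function vanishes on the branch locus.** [folklore] -/
theorem rad_eq_zero (S : Setup ι σ q₁ q₂ N) {y : Y₁} (hyB : y ∈ q₁ '' fixedPoints σ) :
    S.rad y = 0 := by
  have hinf : S.ηinf y = 0 := (S.ηinf_eventuallyEq_zero hyB).self_of_nhds
  rw [rad, hinf, add_zero]
  refine Finset.sum_eq_zero fun i _ => ?_
  by_cases hi : S.η i y = 0
  · rw [hi, zero_mul]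
  · have hyV : y ∈ S.V i := S.tsupport_η_subset i (subset_tsupport _ hi)
    rw [S.nsq_eq_zero hyV hyB, mul_zero]

/-- The squared normal coordinate is positive off the branch locus (on `V i`). [folklore] -/
theorem nsq_pos (S : Setup ι σ q₁ q₂ N) {i : ι} {y : Y₁} (hy : y ∈ S.V i)
    (hyB : y ∉ q₁ '' fixedPoints σ) : 0 < S.nsq i y := by
  obtain ⟨x, hx, rfl⟩ := hy.2
  have hfix : σ x ≠ x := fun h => hyB ⟨x, h, rfl⟩
  have hne : (split ((S.c i).φ₁ x)).2 ≠ 0 := by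
    intro h0
    apply hfix
    have := ((S.c i).snd_eq_zero_iff ((S.c i).split_mem_θ_source hx)).1 h0
    rwa [ContinuousLinearEquiv.symm_apply_apply, (S.c i).φ₁.left_inv hx.1] at this
  have h1 : (splitW ((S.c i).ψ₁ (q₁ x))).2 = (split ((S.c i).φ₁ x)).2 ^ 2 := by
    rw [← (S.c i).sqModel_split_φ₁ hx.1]; simp [sqModel]
  unfold nsq
  rw [h1]
  have : 0 < ‖(split ((S.c i).φ₁ x)).2 ^ 2‖ := norm_pos_iff.2 (pow_ne_zero 2 hne)
  positivity

/-- **The radial function is positive off the branch locus.** [folklore] -/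
theorem rad_pos (S : Setup ι σ q₁ q₂ N) {y : Y₁} (hyB : y ∉ q₁ '' fixedPoints σ) : 0 < S.rad y := by
  classical
  by_cases hinf : S.ηinf y = 0
  · -- some `ηᵢ y > 0` with `y ∈ V i`
    have hsum : ∑ i, S.η i y = 1 := by rw [S.sum_η_eq, hinf, sub_zero]
    obtain ⟨i, -, hi⟩ : ∃ i ∈ Finset.univ, 0 < S.η i y := by
      by_contra hall
      push Not at hall
      have : ∑ i, S.η i y ≤ 0 := Finset.sum_nonpos fun i hi => hall i hi
      linarith
    have hyV : y ∈ S.V i := S.tsupport_η_subset i (subset_tsupport _ hi.ne')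
    have hterm : 0 < S.η i y * S.nsq i y := mul_pos hi (S.nsq_pos hyV hyB)
    have hrest : 0 ≤ ∑ j ∈ Finset.univ.erase i, S.η j y * S.nsq j y :=
      Finset.sum_nonneg fun j _ => mul_nonneg (S.η_nonneg j y) (by unfold nsq; positivity)
    rw [rad, hinf, add_zero, ← Finset.add_sum_erase _ _ (Finset.mem_univ i)]
    linarith
  · have : 0 < S.ηinf y := lt_of_le_of_ne (S.ηinf_nonneg y) (Ne.symm hinf)
    have h0 : 0 ≤ ∑ i, S.η i y * S.nsq i y :=
      Finset.sum_nonneg fun i _ => mul_nonneg (S.η_nonneg i y) (by unfold nsq; positivity)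
    rw [rad]; linarith

/-- `rad y = 0 ↔ y` lies on the branch locus. [folklore] -/
theorem rad_eq_zero_iff (S : Setup ι σ q₁ q₂ N) (y : Y₁) : S.rad y = 0 ↔ y ∈ q₁ '' fixedPoints σ :=
  ⟨fun h => by_contra fun hy => (S.rad_pos hy).ne' h, S.rad_eq_zero⟩

section Smooth

/-- The squared normal coordinate is smooth on the chart domain of pair `i`. [folklore] -/
theorem contMDiffOn_nsq (S : Setup ι σ q₁ q₂ N) (i : ι) :
    ContMDiffOn (𝓡 4) 𝓘(ℝ, ℝ) ∞ (S.nsq i) (S.c i).ψ₁.source := by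
  have h1 : ContMDiffOn (𝓡 4) 𝓘(ℝ, EuclideanSpace ℝ (Fin 4)) ∞ (S.c i).ψ₁ (S.c i).ψ₁.source :=
    contMDiffOn_of_mem_maximalAtlas (S.c i).ψ₁_mem
  have h2 : ContMDiff 𝓘(ℝ, EuclideanSpace ℝ (Fin 4)) 𝓘(ℝ, ℝ) ∞
      fun w : EuclideanSpace ℝ (Fin 4) => ‖(splitW w).2‖ ^ 2 := by
    rw [contMDiff_iff_contDiff]
    have : ContDiff ℝ ∞ fun w : EuclideanSpace ℝ (Fin 4) => (splitW w).2 :=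
      contDiff_snd.comp splitW.contDiff
    exact this.norm_sq ℝ
  exact h2.comp_contMDiffOn h1

/-- `ηᵢ · nsqᵢ` is smooth on all of `Y₁` (the first factor is supported in the chart domain).
[folklore] -/
theorem contMDiff_η_mul_nsq (S : Setup ι σ q₁ q₂ N) (i : ι) :
    ContMDiff (𝓡 4) 𝓘(ℝ, ℝ) ∞ fun y => S.η i y * S.nsq i y := by
  intro y
  by_cases hy : y ∈ tsupport (S.η i)
  · have hyψ : y ∈ (S.c i).ψ₁.source := (S.c i).flocSource_subset (S.tsupport_η_subset i hy).1
    exact ((S.contMDiff_η i) y).mul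
      ((S.contMDiffOn_nsq i).contMDiffAt ((S.c i).ψ₁.open_source.mem_nhds hyψ))
  · -- near `y` the product vanishes
    have hev : (fun y => S.η i y * S.nsq i y) =ᶠ[𝓝 y] fun _ => 0 := by
      filter_upwards [(notMem_tsupport_iff_eventuallyEq.1 hy)] with y' hy'
      simp [hy']
    exact contMDiffAt_const.congr_of_eventuallyEq hev

/-- **The radial function is smooth.** [folklore] -/
theorem contMDiff_rad (S : Setup ι σ q₁ q₂ N) : ContMDiff (𝓡 4) 𝓘(ℝ, ℝ) ∞ S.rad := by
  have h1 : ContMDiff (𝓡 4) 𝓘(ℝ, ℝ) ∞ fun y => ∑ i, S.η i y * S.nsq i y :=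
    ContMDiff.sum fun i _ => S.contMDiff_η_mul_nsq i
  exact h1.add S.contMDiff_ηinf

end Smooth

/-! ### The logarithmic cutoff -/

/-- **The cutoff profile** `cut a Λ r = smoothTransition ((a + Λ - r)/Λ)`: `1` for `r ≤ a`, `0` for
`r ≥ a + Λ`, smooth, with derivative of size `O(1/Λ)`. [folklore] -/
def cut (a Λ r : ℝ) : ℝ :=
  Real.smoothTransition ((a + Λ - r) / Λ)

/-- `cut a Λ r = 1` for `r ≤ a` (`Λ > 0`). [folklore] -/
theorem cut_of_le {a Λ r : ℝ} (hΛ : 0 < Λ) (h : r ≤ a) : cut a Λ r = 1 :=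
  Real.smoothTransition.one_of_one_le ((one_le_div hΛ).2 (by linarith))

/-- `cut a Λ r = 0` for `a + Λ ≤ r` (`Λ > 0`). [folklore] -/
theorem cut_of_ge {a Λ r : ℝ} (hΛ : 0 < Λ) (h : a + Λ ≤ r) : cut a Λ r = 0 :=
  Real.smoothTransition.zero_of_nonpos (div_nonpos_of_nonpos_of_nonneg (by linarith) hΛ.le)

/-- `0 ≤ cut ≤ 1`. [folklore] -/
theorem cut_nonneg (a Λ r : ℝ) : 0 ≤ cut a Λ r := Real.smoothTransition.nonneg _

/-- `0 ≤ cut ≤ 1`. [folklore] -/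
theorem cut_le_one (a Λ r : ℝ) : cut a Λ r ≤ 1 := Real.smoothTransition.le_one _

/-- `cut a Λ` is smooth. [folklore] -/
theorem contDiff_cut (a Λ : ℝ) : ContDiff ℝ ∞ (cut a Λ) := by
  unfold cut
  exact Real.smoothTransition.contDiff.comp ((contDiff_const.sub contDiff_id).div_const _)

/-- **A bound for the derivative of the smooth transition** (it is `C¹` and constant off `[0, 1]`).
[folklore] -/
theorem exists_bound_deriv_smoothTransition :
    ∃ C₀ : ℝ, 0 < C₀ ∧ ∀ x, ‖deriv Real.smoothTransition x‖ ≤ C₀ := by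
  have hc : Continuous (deriv Real.smoothTransition) :=
    (Real.smoothTransition.contDiff (n := 1)).continuous_deriv le_rfl
  obtain ⟨C, hC⟩ := isCompact_Icc.exists_bound_of_continuousOn (s := Icc (0 : ℝ) 1) hc.continuousOn
  refine ⟨max C 1, by positivity, fun x => ?_⟩
  by_cases hx : x ∈ Icc (0 : ℝ) 1
  · exact (hC x hx).trans (le_max_left _ _)
  · -- off `[0, 1]` the function is locally constant
    have hd : deriv Real.smoothTransition x = 0 := by
      rcases not_and_or.1 (fun h => hx ⟨h.1, h.2⟩) with h0 | h1
      · have h0' : x < 0 := not_le.1 h0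
        have hev : Real.smoothTransition =ᶠ[𝓝 x] fun _ => 0 := by
          filter_upwards [gt_mem_nhds h0'] with x' hx'
          exact Real.smoothTransition.zero_of_nonpos hx'.le
        rw [hev.deriv_eq]; simp
      · have h1' : 1 < x := not_le.1 h1
        have hev : Real.smoothTransition =ᶠ[𝓝 x] fun _ => 1 := by
          filter_upwards [lt_mem_nhds h1'] with x' hx'
          exact Real.smoothTransition.one_of_one_le hx'.le
        rw [hev.deriv_eq]; simp
    rw [hd, norm_zero]
    positivity

/-- **The derivative of the cutoff profile is `O(1/Λ)`.** [folklore] -/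
theorem norm_deriv_cut_le {C₀ : ℝ} (hC₀ : ∀ x, ‖deriv Real.smoothTransition x‖ ≤ C₀) (a : ℝ)
    {Λ : ℝ} (hΛ : 0 < Λ) (r : ℝ) : ‖deriv (cut a Λ) r‖ ≤ C₀ / Λ := by
  have h : HasDerivAt (cut a Λ) (deriv Real.smoothTransition ((a + Λ - r) / Λ) * (-1 / Λ)) r := by
    have h1 : HasDerivAt (fun r => (a + Λ - r) / Λ) (-1 / Λ) r := by
      have := ((hasDerivAt_const r (a + Λ)).sub (hasDerivAt_id r)).div_const Λ
      simpa using this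
    exact ((Real.smoothTransition.contDiff (n := 1)).contDiffAt.differentiableAt one_ne_zero
      |>.hasDerivAt.comp r h1)
  have hn : ‖(-1 / Λ : ℝ)‖ = 1 / Λ := by
    rw [norm_div, norm_neg, norm_one, Real.norm_of_nonneg hΛ.le]
  rw [h.deriv, norm_mul, hn]
  calc ‖deriv Real.smoothTransition ((a + Λ - r) / Λ)‖ * (1 / Λ) ≤ C₀ * (1 / Λ) := by
        gcongr; exact hC₀ _
    _ = C₀ / Λ := by ring

/-- **The cutoff** `χ = cut a Λ (log rad)`, set to `1` where `rad < eᵃ` (there `log rad ≤ a` anyway,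
and this also covers the branch locus `rad = 0`). [folklore] -/
def χ (S : Setup ι σ q₁ q₂ N) (a Λ : ℝ) (y : Y₁) : ℝ :=
  if S.rad y < Real.exp a then 1 else cut a Λ (Real.log (S.rad y))

/-- `χ = 1` where `rad < eᵃ`. [folklore] -/
theorem χ_of_lt (S : Setup ι σ q₁ q₂ N) {a Λ : ℝ} {y : Y₁} (h : S.rad y < Real.exp a) :
    S.χ a Λ y = 1 := by
  simp [χ, h]

/-- `χ = cut a Λ (log rad)` where `rad > 0` (`Λ > 0`). [folklore] -/
theorem χ_of_pos (S : Setup ι σ q₁ q₂ N) {a Λ : ℝ} (hΛ : 0 < Λ) {y : Y₁} (h : 0 < S.rad y) :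
    S.χ a Λ y = cut a Λ (Real.log (S.rad y)) := by
  unfold χ
  split_ifs with h'
  · exact (cut_of_le hΛ ((Real.log_lt_iff_lt_exp h).2 h').le).symm
  · rfl

/-- `χ = 0` where `rad ≥ e^{a+Λ}`. [folklore] -/
theorem χ_of_ge (S : Setup ι σ q₁ q₂ N) {a Λ : ℝ} (hΛ : 0 < Λ) {y : Y₁}
    (h : Real.exp (a + Λ) ≤ S.rad y) : S.χ a Λ y = 0 := by
  have hpos : 0 < S.rad y := (Real.exp_pos _).trans_le h
  rw [S.χ_of_pos hΛ hpos]
  exact cut_of_ge hΛ ((Real.le_log_iff_exp_le hpos).2 h)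

/-- `0 ≤ χ ≤ 1`. [folklore] -/
theorem χ_nonneg (S : Setup ι σ q₁ q₂ N) (a Λ : ℝ) (y : Y₁) : 0 ≤ S.χ a Λ y := by
  unfold χ; split_ifs; exacts [zero_le_one, cut_nonneg _ _ _]

/-- `0 ≤ χ ≤ 1`. [folklore] -/
theorem χ_le_one (S : Setup ι σ q₁ q₂ N) (a Λ : ℝ) (y : Y₁) : S.χ a Λ y ≤ 1 := by
  unfold χ; split_ifs; exacts [le_rfl, cut_le_one _ _ _]

section SmoothCut

/-- **The cutoff is smooth** (`Λ > 0`): it is `1` on the open set `{rad < eᵃ}` and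
`cut ∘ log ∘ rad` on the open set `{rad > eᵃ/2}`, where both descriptions agree. [folklore] -/
theorem contMDiff_χ (S : Setup ι σ q₁ q₂ N) (a : ℝ) {Λ : ℝ} (hΛ : 0 < Λ) :
    ContMDiff (𝓡 4) 𝓘(ℝ, ℝ) ∞ (S.χ a Λ) := by
  intro y
  by_cases hy : S.rad y < Real.exp a
  · have hev : S.χ a Λ =ᶠ[𝓝 y] fun _ => 1 := by
      filter_upwards [(S.contMDiff_rad.continuous.continuousAt (x := y)).eventually
        (gt_mem_nhds hy)] with y' hy'
      exact S.χ_of_lt hy'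
    exact contMDiffAt_const.congr_of_eventuallyEq hev
  · have hpos : 0 < S.rad y := (Real.exp_pos a).trans_le (not_lt.1 hy)
    have hev : S.χ a Λ =ᶠ[𝓝 y] fun y' => cut a Λ (Real.log (S.rad y')) := by
      filter_upwards [(S.contMDiff_rad.continuous.continuousAt (x := y)).eventually
        (lt_mem_nhds hpos)] with y' hy'
      exact S.χ_of_pos hΛ hy'
    refine ContMDiffAt.congr_of_eventuallyEq ?_ hev
    have h1 : ContMDiffAt (𝓡 4) 𝓘(ℝ, ℝ) ∞ (fun y' => Real.log (S.rad y')) y := by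
      have hl : ContDiffAt ℝ ∞ Real.log (S.rad y) := Real.contDiffAt_log.2 hpos.ne'
      exact hl.contMDiffAt.comp y (S.contMDiff_rad y)
    exact (contDiff_cut a Λ).contDiffAt.contMDiffAt.comp y h1

end SmoothCut

/-! ### The weights -/

/-- The weight of the pair `i`: `tᵢ = χ ηᵢ`. [folklore] -/
def t (S : Setup ι σ q₁ q₂ N) (a Λ : ℝ) (i : ι) (y : Y₁) : ℝ :=
  S.χ a Λ y * S.η i y

/-- The weight of the comparison map: `t∞ = 1 - ∑ᵢ tᵢ`. [folklore] -/
def tinf (S : Setup ι σ q₁ q₂ N) (a Λ : ℝ) (y : Y₁) : ℝ :=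
  1 - ∑ i, S.t a Λ i y

/-- `∑ᵢ tᵢ + t∞ = 1`. [folklore] -/
theorem sum_t (S : Setup ι σ q₁ q₂ N) (a Λ : ℝ) (y : Y₁) :
    ∑ i, S.t a Λ i y + S.tinf a Λ y = 1 := by
  rw [tinf]; ring

/-- `t∞ = 1 - χ (1 - η∞)`. [folklore] -/
theorem tinf_eq (S : Setup ι σ q₁ q₂ N) (a Λ : ℝ) (y : Y₁) :
    S.tinf a Λ y = 1 - S.χ a Λ y * (1 - S.ηinf y) := by
  rw [tinf, ← S.sum_η_eq y, Finset.mul_sum]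
  rfl

/-- `0 ≤ tᵢ`. [folklore] -/
theorem t_nonneg (S : Setup ι σ q₁ q₂ N) (a Λ : ℝ) (i : ι) (y : Y₁) : 0 ≤ S.t a Λ i y :=
  mul_nonneg (S.χ_nonneg a Λ y) (S.η_nonneg i y)

/-- `0 ≤ t∞`. [folklore] -/
theorem tinf_nonneg (S : Setup ι σ q₁ q₂ N) (a Λ : ℝ) (y : Y₁) : 0 ≤ S.tinf a Λ y := by
  rw [S.tinf_eq]
  have h1 := S.χ_le_one a Λ y
  have h2 := S.χ_nonneg a Λ y
  have h3 := S.ηinf_nonneg y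
  have h4 : S.ηinf y ≤ 1 := S.pou.le_one _ _
  nlinarith

/-- The support of `tᵢ` lies in the good set `V i`. [folklore] -/
theorem tsupport_t_subset (S : Setup ι σ q₁ q₂ N) (a Λ : ℝ) (i : ι) :
    tsupport (S.t a Λ i) ⊆ S.V i := by
  refine (tsupport_mul_subset_right (f := S.χ a Λ) (g := S.η i)).trans (S.tsupport_η_subset i)

/-- **Far from the branch locus the weights are trivial**: where `rad ≥ e^{a+Λ}`, `tᵢ = 0` and
`t∞ = 1`. [folklore] -/
theorem t_of_ge (S : Setup ι σ q₁ q₂ N) {a Λ : ℝ} (hΛ : 0 < Λ) {y : Y₁}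
    (h : Real.exp (a + Λ) ≤ S.rad y) (i : ι) : S.t a Λ i y = 0 := by
  rw [t, S.χ_of_ge hΛ h, zero_mul]

/-- Where `rad ≥ e^{a+Λ}`, `t∞ = 1`. [folklore] -/
theorem tinf_of_ge (S : Setup ι σ q₁ q₂ N) {a Λ : ℝ} (hΛ : 0 < Λ) {y : Y₁}
    (h : Real.exp (a + Λ) ≤ S.rad y) : S.tinf a Λ y = 1 := by
  rw [tinf, Finset.sum_eq_zero fun i _ => S.t_of_ge hΛ h i, sub_zero]

/-- **Near the branch locus the comparison map has weight zero**: where `rad < eᵃ`, `t∞ = η∞`,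
which vanishes on a neighbourhood of the branch locus. [folklore] -/
theorem tinf_of_lt (S : Setup ι σ q₁ q₂ N) {a Λ : ℝ} {y : Y₁} (h : S.rad y < Real.exp a) :
    S.tinf a Λ y = S.ηinf y := by
  rw [S.tinf_eq, S.χ_of_lt h]; ring

/-- `t∞` vanishes on a neighbourhood of every branch point. [folklore] -/
theorem tinf_eventuallyEq_zero (S : Setup ι σ q₁ q₂ N) (a Λ : ℝ) {y : Y₁}
    (hy : y ∈ q₁ '' fixedPoints σ) : S.tinf a Λ =ᶠ[𝓝 y] fun _ => 0 := by
  have h0 : S.rad y < Real.exp a := by rw [S.rad_eq_zero hy]; exact Real.exp_pos a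
  have hev := (S.contMDiff_rad.continuous.continuousAt (x := y)).eventually (gt_mem_nhds h0)
  filter_upwards [hev, S.ηinf_eventuallyEq_zero hy] with y' h1 h2
  rw [S.tinf_of_lt h1, h2, Pi.zero_apply]

section SmoothWeights

/-- `tᵢ` is smooth. [folklore] -/
theorem contMDiff_t (S : Setup ι σ q₁ q₂ N) (a : ℝ) {Λ : ℝ} (hΛ : 0 < Λ) (i : ι) :
    ContMDiff (𝓡 4) 𝓘(ℝ, ℝ) ∞ (S.t a Λ i) :=
  (S.contMDiff_χ a hΛ).mul (S.contMDiff_η i)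

/-- `t∞` is smooth. [folklore] -/
theorem contMDiff_tinf (S : Setup ι σ q₁ q₂ N) (a : ℝ) {Λ : ℝ} (hΛ : 0 < Λ) :
    ContMDiff (𝓡 4) 𝓘(ℝ, ℝ) ∞ (S.tinf a Λ) :=
  contMDiff_const.sub (ContMDiff.sum fun i _ => S.contMDiff_t a hΛ i)

end SmoothWeights

/-! ### The averaged map -/

/-- The comparison map of the set-up. [folklore] -/
def hcmp (S : Setup ι σ q₁ q₂ N) : Y₁ → Y₂ :=
  IsBranchedDoubleQuotient.comparison S.h₁ S.h₂

/-- **The average in `ℝᴺ`**: `avg = ∑ᵢ tᵢ • emb ∘ flocᵢ + t∞ • emb ∘ comparison`. [folklore] -/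
def avg (S : Setup ι σ q₁ q₂ N) (a Λ : ℝ) (y : Y₁) : 𝔼 N :=
  ∑ i, S.t a Λ i y • S.emb ((S.c i).floc y) + S.tinf a Λ y • S.emb (S.hcmp y)

/-- **The averaged map** `Φ = retr ∘ avg : Y₁ → Y₂`. [folklore] -/
def Φ (S : Setup ι σ q₁ q₂ N) (a Λ : ℝ) (y : Y₁) : Y₂ :=
  S.retr (S.avg a Λ y)

/-- **Far from the branch locus the averaged map is the comparison map**: on the open set
`{rad > e^{a+Λ}}`. [folklore] -/
theorem Φ_of_gt (S : Setup ι σ q₁ q₂ N) {a Λ : ℝ} (hΛ : 0 < Λ) {y : Y₁}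
    (h : Real.exp (a + Λ) < S.rad y) : S.Φ a Λ y = S.hcmp y := by
  rw [Φ, avg, Finset.sum_eq_zero fun i _ => by rw [S.t_of_ge hΛ h.le i, zero_smul], zero_add,
    S.tinf_of_ge hΛ h.le, one_smul, S.retr_emb]

/-- The averaged map agrees with the comparison map near every point with `rad > e^{a+Λ}`.
[folklore] -/
theorem Φ_eventuallyEq (S : Setup ι σ q₁ q₂ N) {a Λ : ℝ} (hΛ : 0 < Λ)
    {y : Y₁} (h : Real.exp (a + Λ) < S.rad y) : S.Φ a Λ =ᶠ[𝓝 y] S.hcmp := by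
  filter_upwards [(S.contMDiff_rad.continuous.continuousAt (x := y)).eventually (lt_mem_nhds h)]
    with y' hy'
  exact S.Φ_of_gt hΛ hy'

/-- **On the branch locus every active local solution equals the comparison map**, so
`avg y = emb (comparison y)` and `Φ y = comparison y`. [folklore] -/
theorem floc_eq_of_t_ne_zero (S : Setup ι σ q₁ q₂ N) {a Λ : ℝ} {i : ι} {y : Y₁}
    (hyB : y ∈ q₁ '' fixedPoints σ) (ht : S.t a Λ i y ≠ 0) : (S.c i).floc y = S.hcmp y := by
  have hyV : y ∈ S.V i := S.tsupport_t_subset a Λ i (subset_tsupport _ ht)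
  obtain ⟨x, hx, hfix, rfl⟩ := S.exists_of_mem_V hyV hyB
  rw [(S.c i).floc_apply_of_mem_fixedPoints hx hfix, hcmp, IsBranchedDoubleQuotient.comparison_apply]

/-- On the branch locus `avg y = emb (comparison y)`. [folklore] -/
theorem avg_of_mem (S : Setup ι σ q₁ q₂ N) (a Λ : ℝ) {y : Y₁} (hyB : y ∈ q₁ '' fixedPoints σ) :
    S.avg a Λ y = S.emb (S.hcmp y) := by
  have h1 : ∀ i, S.t a Λ i y • S.emb ((S.c i).floc y) = S.t a Λ i y • S.emb (S.hcmp y) := by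
    intro i
    by_cases ht : S.t a Λ i y = 0
    · rw [ht, zero_smul, zero_smul]
    · rw [S.floc_eq_of_t_ne_zero hyB ht]
  rw [avg, Finset.sum_congr rfl fun i _ => h1 i, ← Finset.sum_smul, ← add_smul, S.sum_t, one_smul]

/-- **The averaged map agrees with the comparison map on the branch locus.** [folklore] -/
theorem Φ_of_mem (S : Setup ι σ q₁ q₂ N) (a Λ : ℝ) {y : Y₁} (hyB : y ∈ q₁ '' fixedPoints σ) :
    S.Φ a Λ y = S.hcmp y := by
  rw [Φ, S.avg_of_mem a Λ hyB, S.retr_emb]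

end Setup

end Literature.Topology.FourManifolds

end


/-!
# Smoothness of the averaged map and its expression in a chart pair

Topic `Topology/FourManifolds`; namespace `Literature.Topology.FourManifolds`. Eighth file of the
proof of `Literature.Topology.FourManifolds.DegtyarevKharlamov2000_conjQuotient_unique`
(`ConjugationQuotients.lean`), continuing `ConjugationQuotientsSetup.lean`. Everything is
proved; no named facts.

* The terms `tᵢ • emb ∘ flocᵢ` and `t∞ • emb ∘ comparison` of the average are smooth on all of
  `Y₁` (`Setup.contMDiff_term`, `Setup.contMDiff_terminf`: the weights are supported where the
  maps are smooth, and `t∞` vanishes near the branch locus where the comparison map is not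
  smooth); hence `avg` is smooth and `Φ = retr ∘ avg` is smooth at every point whose average lies
  in the tube (`Setup.contMDiffAt_Φ`), in particular near the branch locus
  (`Setup.avg_mem_tube_of_mem`).
* **Chart expression.** In the charts `(c k).ψ₁`, `(c k).ψ₂` of a pair `k` centred at a branch
  point `y₀ = q₁ x₀`, `x₀ ∈ (c k).dom` fixed, the averaged map reads, near `w₀ = (u₀, 0)`,
  `Φch = Rch ∘ (∑ᵢ tchᵢ • Ech ∘ Gᵢ + tinfch • Ech ∘ Gh)` (`Setup.avgch_eventuallyEq`, `Setup.Φch_eq`)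
  with `Gᵢ = crossLoc (c i) (c k)`, `Gh = (c k).Θh`, `Ech = emb ∘ ψ₂⁻¹ ∘ splitW⁻¹`,
  `Rch = splitW ∘ ψ₂ ∘ retr`, and `Rch ∘ Ech = id` on the chart target (`Setup.Rch_Ech`).

## References

* A. Degtyarev, V. Kharlamov, Russian Math. Surveys 55 (2000), arXiv:math/0004134, §3.2 ¶1.
  [DegtyarevKharlamov2000]
-/

noncomputable section

open scoped Manifold ContDiff Topology
open Set Function Filter
open Literature.Topology.FourManifolds.BranchedModel

namespace Literature.Topology.FourManifolds

/-- Local notation: `𝕄` is the split model space `(Fin 2 → ℝ) × ℂ`. -/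
local notation "𝕄" => (Fin 2 → ℝ) × ℂ

/-- Local notation: the Euclidean space `ℝᴺ`. -/
local notation "𝔼" N:arg => EuclideanSpace ℝ (Fin N)

namespace Setup

variable {X : Type*} [TopologicalSpace X] [ChartedSpace (Fin 2 → ℂ) X]
  {Y₁ : Type*} [TopologicalSpace Y₁] [ChartedSpace (EuclideanSpace ℝ (Fin 4)) Y₁]
  {Y₂ : Type*} [TopologicalSpace Y₂] [ChartedSpace (EuclideanSpace ℝ (Fin 4)) Y₂]
  {ι : Type*} [Fintype ι] {σ : X → X} {q₁ : X → Y₁} {q₂ : X → Y₂} {N : ℕ}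

/-! ### Smoothness of the terms, of the average, and of `Φ` -/

section Smooth

variable [IsManifold (𝓡 4) ∞ Y₁] [IsManifold (𝓡 4) ∞ Y₂]

/-- The local solution of pair `i` is smooth at every point of its good set. [folklore] -/
theorem contMDiffAt_floc (S : Setup ι σ q₁ q₂ N) {i : ι} {y : Y₁} (hy : y ∈ S.V i) :
    ContMDiffAt (𝓡 4) (𝓡 4) ∞ (S.c i).floc y :=
  ((S.c i).contMDiffOn_floc (S.pos i)).contMDiffAt
    (((S.c i).isOpen_flocSource (S.pos i)).mem_nhds hy.1)

/-- **The term `tᵢ • emb ∘ flocᵢ` is smooth on `Y₁`.** [folklore] -/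
theorem contMDiff_term (S : Setup ι σ q₁ q₂ N) (a : ℝ) {Λ : ℝ} (hΛ : 0 < Λ) (i : ι) :
    ContMDiff (𝓡 4) 𝓘(ℝ, 𝔼 N) ∞ fun y => S.t a Λ i y • S.emb ((S.c i).floc y) := by
  intro y
  by_cases hy : y ∈ tsupport (S.t a Λ i)
  · have hyV := S.tsupport_t_subset a Λ i hy
    exact ((S.contMDiff_t a hΛ i) y).smul ((S.emb_smooth _).comp y (S.contMDiffAt_floc hyV))
  · have hev : (fun y => S.t a Λ i y • S.emb ((S.c i).floc y)) =ᶠ[𝓝 y] fun _ => 0 := by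
      filter_upwards [notMem_tsupport_iff_eventuallyEq.1 hy] with y' hy'
      simp [hy']
    exact contMDiffAt_const.congr_of_eventuallyEq hev

omit [IsManifold (𝓡 4) ∞ Y₁] [IsManifold (𝓡 4) ∞ Y₂] in
/-- The comparison map is smooth off the branch locus. [folklore] -/
theorem contMDiffAt_hcmp (S : Setup ι σ q₁ q₂ N) {y : Y₁} (hy : y ∉ q₁ '' fixedPoints σ) :
    ContMDiffAt (𝓡 4) (𝓡 4) ∞ S.hcmp y := by
  obtain ⟨x, rfl⟩ := S.h₁.surjective y
  have hx : σ x ≠ x := fun h => hy ⟨x, h, rfl⟩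
  exact IsBranchedDoubleQuotient.contMDiffAt_comparison S.h₁ S.h₂ hx

omit [IsManifold (𝓡 4) ∞ Y₁] [IsManifold (𝓡 4) ∞ Y₂] in
/-- **The term `t∞ • emb ∘ comparison` is smooth on `Y₁`.** [folklore] -/
theorem contMDiff_terminf (S : Setup ι σ q₁ q₂ N) (a : ℝ) {Λ : ℝ} (hΛ : 0 < Λ) :
    ContMDiff (𝓡 4) 𝓘(ℝ, 𝔼 N) ∞ fun y => S.tinf a Λ y • S.emb (S.hcmp y) := by
  intro y
  by_cases hy : y ∈ q₁ '' fixedPoints σ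
  · have hev : (fun y => S.tinf a Λ y • S.emb (S.hcmp y)) =ᶠ[𝓝 y] fun _ => 0 := by
      filter_upwards [S.tinf_eventuallyEq_zero a Λ hy] with y' hy'
      simp [hy']
    exact contMDiffAt_const.congr_of_eventuallyEq hev
  · exact ((S.contMDiff_tinf a hΛ) y).smul ((S.emb_smooth _).comp y (S.contMDiffAt_hcmp hy))

/-- **The average is smooth.** [folklore] -/
theorem contMDiff_avg (S : Setup ι σ q₁ q₂ N) (a : ℝ) {Λ : ℝ} (hΛ : 0 < Λ) :
    ContMDiff (𝓡 4) 𝓘(ℝ, 𝔼 N) ∞ (S.avg a Λ) :=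
  (ContMDiff.sum fun i _ => S.contMDiff_term a hΛ i).add (S.contMDiff_terminf a hΛ)

/-- **`Φ` is smooth at every point whose average lies in the tube.** [folklore] -/
theorem contMDiffAt_Φ (S : Setup ι σ q₁ q₂ N) (a : ℝ) {Λ : ℝ} (hΛ : 0 < Λ) {y : Y₁}
    (hy : S.avg a Λ y ∈ S.tube) : ContMDiffAt (𝓡 4) (𝓡 4) ∞ (S.Φ a Λ) y :=
  (S.retr_smooth.contMDiffAt (S.tube_open.mem_nhds hy)).comp y (S.contMDiff_avg a hΛ y)

omit [IsManifold (𝓡 4) ∞ Y₁] [IsManifold (𝓡 4) ∞ Y₂] in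
/-- On the branch locus the average lies in the tube. [folklore] -/
theorem avg_mem_tube_of_mem (S : Setup ι σ q₁ q₂ N) (a Λ : ℝ) {y : Y₁}
    (hyB : y ∈ q₁ '' fixedPoints σ) : S.avg a Λ y ∈ S.tube := by
  rw [S.avg_of_mem a Λ hyB]; exact S.emb_mem _

/-- The average stays in the tube near the branch locus (it is continuous and the tube is open).
[folklore] -/
theorem eventually_avg_mem_tube (S : Setup ι σ q₁ q₂ N) (a : ℝ) {Λ : ℝ} (hΛ : 0 < Λ) {y : Y₁}
    (hyB : y ∈ q₁ '' fixedPoints σ) : ∀ᶠ y' in 𝓝 y, S.avg a Λ y' ∈ S.tube :=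
  (S.contMDiff_avg a hΛ).continuous.continuousAt.preimage_mem_nhds
    (S.tube_open.mem_nhds (S.avg_mem_tube_of_mem a Λ hyB))

/-- If the average is everywhere in the tube then `Φ` is smooth. [folklore] -/
theorem contMDiff_Φ (S : Setup ι σ q₁ q₂ N) (a : ℝ) {Λ : ℝ} (hΛ : 0 < Λ)
    (h : ∀ y, S.avg a Λ y ∈ S.tube) : ContMDiff (𝓡 4) (𝓡 4) ∞ (S.Φ a Λ) := fun y =>
  S.contMDiffAt_Φ a hΛ (h y)

end Smooth

/-! ### Chart-level objects of a pair `k` -/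

/-- The embedding read in the target chart of pair `k`: `Ech = emb ∘ ψ₂⁻¹ ∘ splitW⁻¹`. [folklore] -/
def Ech (S : Setup ι σ q₁ q₂ N) (k : ι) (z : 𝕄) : 𝔼 N :=
  S.emb ((S.c k).ψ₂.symm (splitW.symm z))

/-- The retraction read in the target chart of pair `k`: `Rch = splitW ∘ ψ₂ ∘ retr`. [folklore] -/
def Rch (S : Setup ι σ q₁ q₂ N) (k : ι) (p : 𝔼 N) : 𝕄 :=
  splitW ((S.c k).ψ₂ (S.retr p))

/-- The point of `Y₁` with chart coordinates `w` in pair `k`. [folklore] -/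
def ych (S : Setup ι σ q₁ q₂ N) (k : ι) (w : 𝕄) : Y₁ :=
  (S.c k).ψ₁.symm (splitW.symm w)

/-- The averaged map read in the charts of pair `k`: `Φch = splitW ∘ ψ₂ ∘ Φ ∘ ψ₁⁻¹ ∘ splitW⁻¹`.
[folklore] -/
def Φch (S : Setup ι σ q₁ q₂ N) (k : ι) (a Λ : ℝ) (w : 𝕄) : 𝕄 :=
  splitW ((S.c k).ψ₂ (S.Φ a Λ (S.ych k w)))

/-- The weights read in the source chart of pair `k`. [folklore] -/
def tch (S : Setup ι σ q₁ q₂ N) (k : ι) (a Λ : ℝ) (i : ι) (w : 𝕄) : ℝ :=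
  S.t a Λ i (S.ych k w)

/-- The weight of the comparison map read in the source chart of pair `k`. [folklore] -/
def tinfch (S : Setup ι σ q₁ q₂ N) (k : ι) (a Λ : ℝ) (w : 𝕄) : ℝ :=
  S.tinf a Λ (S.ych k w)

/-- `∑ᵢ tchᵢ + tinfch = 1`. [folklore] -/
theorem sum_tch (S : Setup ι σ q₁ q₂ N) (k : ι) (a Λ : ℝ) (w : 𝕄) :
    ∑ i, S.tch k a Λ i w + S.tinfch k a Λ w = 1 :=
  S.sum_t a Λ _

/-- The average read in the source chart of pair `k`. [folklore] -/
def avgch (S : Setup ι σ q₁ q₂ N) (k : ι) (a Λ : ℝ) (w : 𝕄) : 𝔼 N :=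
  S.avg a Λ (S.ych k w)

/-- `Φch = Rch ∘ avgch`. [folklore] -/
theorem Φch_eq (S : Setup ι σ q₁ q₂ N) (k : ι) (a Λ : ℝ) (w : 𝕄) :
    S.Φch k a Λ w = S.Rch k (S.avgch k a Λ w) :=
  rfl

/-- **`Rch ∘ Ech = id` on the chart target.** [folklore] -/
theorem Rch_Ech (S : Setup ι σ q₁ q₂ N) (k : ι) {z : 𝕄} (hz : splitW.symm z ∈ (S.c k).ψ₂.target) :
    S.Rch k (S.Ech k z) = z := by
  simp only [Rch, Ech, S.retr_emb, (S.c k).ψ₂.right_inv hz, ContinuousLinearEquiv.apply_symm_apply]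

/-- The set of chart points lying over the target chart domain of pair `k` is open. [folklore] -/
theorem isOpen_Ech_good (S : Setup ι σ q₁ q₂ N) (k : ι) :
    IsOpen {z : 𝕄 | splitW.symm z ∈ (S.c k).ψ₂.target} :=
  (S.c k).ψ₂.open_target.preimage splitW.symm.continuous

/-- `Rch ∘ Ech = id` near every good chart point. [folklore] -/
theorem Rch_Ech_eventuallyEq (S : Setup ι σ q₁ q₂ N) (k : ι) {z : 𝕄}
    (hz : splitW.symm z ∈ (S.c k).ψ₂.target) :
    (S.Rch k ∘ S.Ech k) =ᶠ[𝓝 z] id := by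
  filter_upwards [(S.isOpen_Ech_good k).mem_nhds hz] with z' hz'
  exact S.Rch_Ech k hz'

section SmoothCharts

/-- **`Ech` is `C^∞` at every good chart point.** [folklore] -/
theorem contDiffAt_Ech (S : Setup ι σ q₁ q₂ N) (k : ι) {z : 𝕄}
    (hz : splitW.symm z ∈ (S.c k).ψ₂.target) : ContDiffAt ℝ ∞ (S.Ech k) z := by
  have hsm : ContMDiffAt (𝓡 4) 𝓘(ℝ, 𝔼 N) ∞ S.emb ((S.c k).ψ₂.symm (splitW.symm z)) := S.emb_smooth _
  have hy : (S.c k).ψ₂.symm (splitW.symm z) ∈ (S.c k).ψ₂.source := (S.c k).ψ₂.map_target hz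
  rw [contMDiffAt_iff_of_mem_maximalAtlas (e := (S.c k).ψ₂)
    (e' := OpenPartialHomeomorph.refl (𝔼 N)) (S.c k).ψ₂_mem
    (StructureGroupoid.chart_mem_maximalAtlas _ (0 : 𝔼 N)) hy (mem_univ _)] at hsm
  have h2 := hsm.2
  simp only [OpenPartialHomeomorph.extend_coe, OpenPartialHomeomorph.extend_coe_symm,
    modelWithCornersSelf_coe, modelWithCornersSelf_coe_symm, CompTriple.comp_eq, range_id,
    OpenPartialHomeomorph.refl_apply, (S.c k).ψ₂.right_inv hz] at h2
  have h3 : ContDiffAt ℝ ∞ (S.emb ∘ (S.c k).ψ₂.symm) (splitW.symm z) := h2.contDiffAt univ_mem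
  exact h3.comp z splitW.symm.contDiff.contDiffAt

/-- **`Rch` is `C^∞` at every point of the tube retracting into the chart domain of pair `k`.**
[folklore] -/
theorem contDiffAt_Rch (S : Setup ι σ q₁ q₂ N) (k : ι) {p : 𝔼 N} (hp : p ∈ S.tube)
    (hpk : S.retr p ∈ (S.c k).ψ₂.source) : ContDiffAt ℝ ∞ (S.Rch k) p := by
  have hsm : ContMDiffAt 𝓘(ℝ, 𝔼 N) (𝓡 4) ∞ S.retr p :=
    S.retr_smooth.contMDiffAt (S.tube_open.mem_nhds hp)
  rw [contMDiffAt_iff_of_mem_maximalAtlas (e := OpenPartialHomeomorph.refl (𝔼 N))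
    (e' := (S.c k).ψ₂) (StructureGroupoid.chart_mem_maximalAtlas _ (0 : 𝔼 N)) (S.c k).ψ₂_mem
    (mem_univ _) hpk] at hsm
  have h2 := hsm.2
  simp only [OpenPartialHomeomorph.extend_coe, OpenPartialHomeomorph.extend_coe_symm,
    modelWithCornersSelf_coe, modelWithCornersSelf_coe_symm, CompTriple.comp_eq, range_id,
    OpenPartialHomeomorph.refl_symm, OpenPartialHomeomorph.refl_apply] at h2
  have h3 : ContDiffAt ℝ ∞ ((S.c k).ψ₂ ∘ S.retr) p := h2.contDiffAt univ_mem
  exact splitW.contDiff.contDiffAt.comp p h3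

end SmoothCharts

/-! ### The chart expression near a branch point -/

/-- **Base facts of a branch point in pair `k`**: for `x₀ ∈ (c k).dom` fixed, the chart point of
`y₀ = q₁ x₀` is `w₀ = (u₀, 0)`, `ych w₀ = y₀`, the target chart point of `q₂ x₀` is `(c k).θ w₀`,
and `q₂ x₀ ∈ ψ₂.source`. [folklore] -/
theorem base_facts (S : Setup ι σ q₁ q₂ N) {k : ι} {x₀ : X} (hx₀ : x₀ ∈ (S.c k).dom)
    (hfix : σ x₀ = x₀) :
    splitW ((S.c k).ψ₁ (q₁ x₀)) = ((split ((S.c k).φ₁ x₀)).1, 0) ∧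
      S.ych k ((split ((S.c k).φ₁ x₀)).1, 0) = q₁ x₀ ∧
      splitW ((S.c k).ψ₂ (q₂ x₀)) = (S.c k).θ ((split ((S.c k).φ₁ x₀)).1, 0) ∧
      q₂ x₀ ∈ (S.c k).ψ₂.source := by
  have h0 := (S.c k).snd_split_φ₁_eq_zero hx₀ hfix
  have h1 : splitW ((S.c k).ψ₁ (q₁ x₀)) = split ((S.c k).φ₁ x₀) := by
    rw [← (S.c k).sqModel_split_φ₁ hx₀.1, ChartPair.sqModel_of_snd_eq_zero h0]
  have hreal : split ((S.c k).φ₁ x₀) = ((split ((S.c k).φ₁ x₀)).1, 0) :=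
    ChartPair.eq_real_of_snd_eq_zero h0
  refine ⟨by rw [h1, hreal], ?_, ?_, ((S.c k).adapted₂ x₀ hx₀.2).2.2.1⟩
  · rw [ych, ← hreal, ← h1, ContinuousLinearEquiv.symm_apply_apply,
      (S.c k).ψ₁.left_inv ((S.c k).adapted₁ x₀ hx₀.1).2.2.1]
  · rw [← hreal, (S.c k).θ_apply_split hx₀, ← (S.c k).sqModel_split_φ₂ hx₀.2,
      ChartPair.sqModel_of_snd_eq_zero ((S.c k).snd_split_φ₂_eq_zero hx₀ hfix)]

/-- `ych` is continuous at chart points of the source chart. [folklore] -/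
theorem continuousAt_ych (S : Setup ι σ q₁ q₂ N) (k : ι) {w : 𝕄}
    (hw : splitW.symm w ∈ (S.c k).ψ₁.target) : ContinuousAt (S.ych k) w :=
  ((S.c k).ψ₁.continuousAt_symm hw).comp splitW.symm.continuous.continuousAt

/-- The chart point of a branch point lies over the source chart target. [folklore] -/
theorem base_mem_target (S : Setup ι σ q₁ q₂ N) {k : ι} {x₀ : X} (hx₀ : x₀ ∈ (S.c k).dom)
    (hfix : σ x₀ = x₀) :
    splitW.symm (((split ((S.c k).φ₁ x₀)).1, 0) : 𝕄) ∈ (S.c k).ψ₁.target := by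
  rw [← (S.base_facts hx₀ hfix).1, ContinuousLinearEquiv.symm_apply_apply]
  exact (S.c k).ψ₁.map_source ((S.c k).adapted₁ x₀ hx₀.1).2.2.1

/-- **The term of pair `i` read in the charts of pair `k`**: near the chart point of a branch point,
and uniformly in the parameters `a, Λ`, the `i`-th term of the average equals
`tchᵢ • Ech ∘ crossLocᵢ` (when `y₀ ∈ tsupport ηᵢ`, `flocᵢ` stays in the chart domain; otherwise both
sides vanish identically near `w₀` for all parameters). [folklore] -/
theorem term_eventuallyEq [IsManifold (𝓡 4) ∞ Y₁] [IsManifold (𝓡 4) ∞ Y₂] (S : Setup ι σ q₁ q₂ N)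
    {k : ι} {x₀ : X} (hx₀ : x₀ ∈ (S.c k).dom) (hfix : σ x₀ = x₀) (i : ι) :
    ∀ᶠ w in 𝓝 (((split ((S.c k).φ₁ x₀)).1, 0) : 𝕄), ∀ a Λ : ℝ,
      S.tch k a Λ i w • S.emb ((S.c i).floc (S.ych k w)) =
        S.tch k a Λ i w • S.Ech k ((S.c i).crossLoc (S.c k) w) := by
  obtain ⟨hw₀, hy₀, hz₀, hq₂⟩ := S.base_facts hx₀ hfix
  have hyB : q₁ x₀ ∈ q₁ '' fixedPoints σ := ⟨x₀, hfix, rfl⟩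
  have hcont : ContinuousAt (S.ych k) (((split ((S.c k).φ₁ x₀)).1, 0) : 𝕄) :=
    S.continuousAt_ych k (S.base_mem_target hx₀ hfix)
  by_cases hJ : q₁ x₀ ∈ tsupport (S.η i)
  · -- active: `flocᵢ` is continuous at `y₀` with value `q₂ x₀ ∈ ψ₂.source`
    have hyV := S.tsupport_η_subset i hJ
    obtain ⟨x', hx', hfix', hq⟩ := S.exists_of_mem_V hyV hyB
    have hxx : x' = x₀ := by
      rcases (S.h₁.apply_eq_iff x' x₀).1 hq with h | h
      · exact h.symm
      · rw [h, hfix']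
    subst hxx
    have hfl : (S.c i).floc (q₁ x') = q₂ x' := (S.c i).floc_apply_of_mem_fixedPoints hx' hfix'
    have hflc : ContinuousAt (S.c i).floc (q₁ x') := (S.contMDiffAt_floc hyV).continuousAt
    have hcomp : ContinuousAt (fun w => (S.c i).floc (S.ych k w))
        (((split ((S.c k).φ₁ x')).1, 0) : 𝕄) := by
      refine ContinuousAt.comp (g := (S.c i).floc) ?_ hcont
      rw [hy₀]; exact hflc
    have hev : ∀ᶠ w in 𝓝 (((split ((S.c k).φ₁ x')).1, 0) : 𝕄),
        (S.c i).floc (S.ych k w) ∈ (S.c k).ψ₂.source := by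
      refine hcomp.preimage_mem_nhds ((S.c k).ψ₂.open_source.mem_nhds ?_)
      show (S.c i).floc (S.ych k ((split ((S.c k).φ₁ x')).1, 0)) ∈ (S.c k).ψ₂.source
      rw [hy₀, hfl]; exact hq₂
    filter_upwards [hev] with w hw a Λ
    show _ = S.tch k a Λ i w • S.emb ((S.c k).ψ₂.symm (splitW.symm
      (splitW ((S.c k).ψ₂ ((S.c i).floc (S.ych k w))))))
    rw [ContinuousLinearEquiv.symm_apply_apply, (S.c k).ψ₂.left_inv hw]
  · -- inactive: `ηᵢ`, hence every weight `tᵢ = χ ηᵢ`, vanishes near `y₀`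
    have hev0 : S.η i =ᶠ[𝓝 (q₁ x₀)] 0 := notMem_tsupport_iff_eventuallyEq.1 hJ
    have hev : ∀ᶠ w in 𝓝 (((split ((S.c k).φ₁ x₀)).1, 0) : 𝕄), ∀ a Λ : ℝ, S.tch k a Λ i w = 0 := by
      have hc' : Tendsto (S.ych k) (𝓝 (((split ((S.c k).φ₁ x₀)).1, 0) : 𝕄)) (𝓝 (q₁ x₀)) := by
        have h := hcont.tendsto
        rwa [hy₀] at h
      filter_upwards [hc'.eventually hev0] with w hw a Λ
      simp only [Pi.zero_apply] at hw
      simp [tch, t, hw]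
    filter_upwards [hev] with w hw a Λ
    rw [hw a Λ, zero_smul, zero_smul]

/-- **The comparison term read in the charts of pair `k`**: near the chart point of a branch point,
`emb (comparison (ych w)) = Ech ((c k).Θh w)`. [folklore] -/
theorem terminf_eventuallyEq (S : Setup ι σ q₁ q₂ N) {k : ι} {x₀ : X}
    (hx₀ : x₀ ∈ (S.c k).dom) (hfix : σ x₀ = x₀) :
    ∀ᶠ w in 𝓝 (((split ((S.c k).φ₁ x₀)).1, 0) : 𝕄),
      S.emb (S.hcmp (S.ych k w)) = S.Ech k ((S.c k).Θh S.h₁ S.h₂ w) := by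
  obtain ⟨hw₀, hy₀, hz₀, hq₂⟩ := S.base_facts hx₀ hfix
  have hcont : ContinuousAt (S.ych k) (((split ((S.c k).φ₁ x₀)).1, 0) : 𝕄) :=
    S.continuousAt_ych k (S.base_mem_target hx₀ hfix)
  have hhc : ContinuousAt S.hcmp (q₁ x₀) :=
    (IsBranchedDoubleQuotient.continuous_comparison S.h₁ S.h₂).continuousAt
  have hval : S.hcmp (q₁ x₀) = q₂ x₀ := IsBranchedDoubleQuotient.comparison_apply S.h₁ S.h₂ x₀
  have hcomp : ContinuousAt (fun w => S.hcmp (S.ych k w)) (((split ((S.c k).φ₁ x₀)).1, 0) : 𝕄) := by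
    refine ContinuousAt.comp (g := S.hcmp) ?_ hcont
    rw [hy₀]; exact hhc
  have hev : ∀ᶠ w in 𝓝 (((split ((S.c k).φ₁ x₀)).1, 0) : 𝕄),
      S.hcmp (S.ych k w) ∈ (S.c k).ψ₂.source := by
    refine hcomp.preimage_mem_nhds ((S.c k).ψ₂.open_source.mem_nhds ?_)
    show S.hcmp (S.ych k ((split ((S.c k).φ₁ x₀)).1, 0)) ∈ (S.c k).ψ₂.source
    rw [hy₀, hval]; exact hq₂
  filter_upwards [hev] with w hw
  show _ = S.emb ((S.c k).ψ₂.symm (splitW.symm (splitW ((S.c k).ψ₂ (S.hcmp (S.ych k w))))))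
  rw [ContinuousLinearEquiv.symm_apply_apply, (S.c k).ψ₂.left_inv hw]

/-- **The average read in the charts of pair `k` near a branch point**, uniformly in the
parameters: `avgch = ∑ᵢ tchᵢ • Ech ∘ crossLocᵢ + tinfch • Ech ∘ Θh`. [folklore] -/
theorem avgch_eventuallyEq [IsManifold (𝓡 4) ∞ Y₁] [IsManifold (𝓡 4) ∞ Y₂] (S : Setup ι σ q₁ q₂ N)
    {k : ι} {x₀ : X} (hx₀ : x₀ ∈ (S.c k).dom) (hfix : σ x₀ = x₀) :
    ∀ᶠ w in 𝓝 (((split ((S.c k).φ₁ x₀)).1, 0) : 𝕄), ∀ a Λ : ℝ,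
      S.avgch k a Λ w = ∑ i, S.tch k a Λ i w • S.Ech k ((S.c i).crossLoc (S.c k) w) +
        S.tinfch k a Λ w • S.Ech k ((S.c k).Θh S.h₁ S.h₂ w) := by
  have hall := eventually_all.2 fun i => S.term_eventuallyEq hx₀ hfix i
  filter_upwards [hall, S.terminf_eventuallyEq hx₀ hfix] with w hw hw' a Λ
  have : S.avgch k a Λ w = ∑ i, S.tch k a Λ i w • S.emb ((S.c i).floc (S.ych k w)) +
      S.tinfch k a Λ w • S.emb (S.hcmp (S.ych k w)) := rfl
  rw [this, Finset.sum_congr rfl fun i _ => hw i a Λ, hw']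

/-- The representation holds near every point near `w₀` (a form convenient for derivatives).
[folklore] -/
theorem avgch_eventuallyEq_nhds [IsManifold (𝓡 4) ∞ Y₁] [IsManifold (𝓡 4) ∞ Y₂]
    (S : Setup ι σ q₁ q₂ N) {k : ι} {x₀ : X} (hx₀ : x₀ ∈ (S.c k).dom) (hfix : σ x₀ = x₀) :
    ∀ᶠ w in 𝓝 (((split ((S.c k).φ₁ x₀)).1, 0) : 𝕄), ∀ a Λ : ℝ,
      S.avgch k a Λ =ᶠ[𝓝 w] fun w => ∑ i, S.tch k a Λ i w • S.Ech k ((S.c i).crossLoc (S.c k) w) +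
        S.tinfch k a Λ w • S.Ech k ((S.c k).Θh S.h₁ S.h₂ w) := by
  filter_upwards [(S.avgch_eventuallyEq hx₀ hfix).eventually_nhds] with w hw a Λ
  exact hw.mono fun w' hw' => hw' a Λ

end Setup

end Literature.Topology.FourManifolds

end
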